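import Mathlib
import Literature.Analysis.PDE.WeakBVStabilityProofs
import Literature.Analysis.Calculus.SmoothCutoff
import HarnessLib

/-!
# `BV` slices have strong traces; Chen–Krupa–Vasseur Theorem 1.4 from Theorem 1.3 (proofs)

Topic `Literature/Analysis/PDE`; companion PROOF file of `WeakBVStability.lean` (vocabulary and the
named facts `chenKrupaVasseur_weakBV_isentropicEuler` = Thm 1.3 + Lemma 4.5,
`chenKrupaVasseur_smallBV_unique_isentropicEuler` = Thm 1.4 + Lemma 4.5 of [ChenKrupaVasseur2022])
and of `WeakBVStabilityProofs.lean` (Lemma 4.5 (d), (e); uniqueness clause of Thm 1.3).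

This file formalizes the PRINTED PROOF of Thm 1.4 (arXiv:2010.04761, §1, the paragraph before
Thm 1.4): "Note that any `BV` function verifies the Strong Trace Property (Def. 1.2). Hence, any `BV`
solution to (1.1) [with the entropy inequality] belongs to `𝒮_weak`. Therefore a consequence of
Theorem 1.3 is that, in the case of 2 unknowns, these a priori assumptions [Tame Oscillation /
Bounded Variation Condition] are not needed to obtain the uniqueness result. We formulate this
result in the following theorem [Thm 1.4]."

* `exists_rightLimit_of_boundedVariationOn`, `exists_leftLimit_of_boundedVariationOn` — a `BV`
  function `ℝ → (Fin n → ℝ)` has one-sided limits everywhere, in `ε`–`δ` form (from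
  `exists_tendsto_nhdsGT/LT_of_boundedVariationOn` of `WeakBVStabilityProofs.lean`, whose
  `hasStrongTraces_of_boundedVariationOn` treats the case where EVERY slice is `BV`, as for
  `𝒮_BV^ε ⊆ 𝒮_weak`; Thm 1.4 needs the almost-every-slice version below).
* `measurable_essSup_prod` — measurability in `t` of `ess sup_y G(t,y)` for jointly measurable `G`.
* `exists_trace_of_ae_oneSidedLimit`, `hasStrongTraces_of_ae_boundedVariationOn` — a jointly
  measurable `v`, bounded for `t > 0`, almost all of whose slices `v(t,·)`, `t ∈ (0,T)`, have bounded
  variation verifies the Strong Trace Property `HasStrongTraces v` (Def. 1.2): the traces are the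
  one-sided limits (made measurable as sequential `limUnder`s), and
  `∫₀ᵀ ess sup_{0<±y<1/k} |v(t,X(t)+y) - u_±(t)| dt → 0` by dominated convergence in `t`.
* `smallBVUnique_of_weakBVStable` — for a general `n × n` system with bounded state set `𝒰₀ ⊇ 𝒱`:
  `WeakBVStable f η q 𝒰₀ 𝒱 → SmallBVUnique f η q 𝒰₀ 𝒱` (conclusion of Thm 1.3 ⇒ conclusion of
  Thm 1.4: every competitor of Thm 1.4 lies in `𝒮_weak`).
* `chenKrupaVasseur_smallBV_unique_isentropicEuler_of_weakBV` — the Thm 1.4 fact for isentropic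
  Euler from the Thm 1.3 fact (`𝒰₀` bounded by `isBounded_isentropicEulerStates`, `𝒱 ⊆ 𝒰₀`).

Towards Thm 1.3 itself (the strong-trace calculus used throughout §§4–7 of the printed proof;
everything below is proved, nothing is assumed):

* `ae_mem_closure_of_tendsto_lintegral_essSup` — one-sided traces (Def. 1.2) of a `W`-valued `v`
  take values in `W̄` for a.e. time; `tendsto_lintegral_essSup_comp_of_uniformContinuousOn` —
  strong traces pass to bounded uniformly continuous observables `E` (used with `E = η(·|b)`,
  `q(·;b)`): `∫₀ᵀ ess sup_{y ∈ I_k} |E(v(t,X(t)+y)) - E(v₊(t))| dt → 0`.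
* section `TraceKernel` — the one-sided averaging kernel `K = (Real.smoothTransition)'` (mass one,
  supported in `[0,1]`), its rescalings `y ↦ c K(±c y)`, and
  `tendsto_lintegral_right/leftKernelAvg_sub`: the `ess sup` form of Def. 1.2 implies
  `L¹(S,T)`-convergence of the one-sided kernel averages `∫ k K(±k y) H(r, c(r)+y) dy` to the trace.
* section `CellInequality` — `cellIneq_mollified`, `cellIneq_of_kernelTraces`,
  `cellIneq_of_strongTraces`: for bounded measurable `G₁, G₂` with `∂ₜG₁ + ∂ₓG₂ ≤ 0` in the sense
  of distributions on `(S,T) × ℝ` (the integral form of §1 / of (3.1), test functions supported in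
  `S < t < T`) and smooth curves `a < b` on `(S,T)` along which `G₁, G₂` have strong traces from
  the right (`a`) and from the left (`b`), the cell functional `I(t) = ∫_{a(t)}^{b(t)} G₁(t,x) dx`
  satisfies, for all `S < s < t < T` off a Lebesgue-null set of times,
  `I(t) ≤ I(s) + ∫_s^t ([G₂ - a'G₁](r, a(r)+) - [G₂ - b'G₁](r, b(r)-)) dr` — "integrating (3.1)
  on `Q = {t_j < r < t, h_i(r) < x < h_{i+1}(r)}` and using the strong trace property" (§7, the
  fluxes `F_i^±`; also the proofs of Lemma 4.2 and Prop. 4.4). Proof: the test function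
  `Θ((r-s)/τ)Θ((t-r)/τ)·Θ(k(x-a(r)))Θ(k(b(r)-x))` (`Θ = Real.smoothTransition`), `k → ∞` by the
  kernel traces and dominated convergence, `τ → 0` at Lebesgue points of `I`
  (`IsUnifLocDoublingMeasure.ae_tendsto_average_norm_sub`). Curves are `C^∞` here (rarefaction
  fronts, pseudoshocks and cone boundaries are affine); the Lipschitz shifts `h_i` of Prop. 4.1
  need a further approximation step, not done here.

* section `RelativeEntropyCells` — `exists_trace_mem_closure` (traces may be taken valued in
  `𝒰̄₀`) and `cellIneq_relEntropy`: the displayed cell estimate of §7 for the relative entropy of a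
  `𝒰₀`-valued `u` with strong traces, `∫_{a(t)}^{b(t)} η(u(t,·)|c) ≤ ∫_{a(s)}^{b(s)} η(u(s,·)|c)
  + ∫_s^t (F⁺_a - F⁻_b)`, `F⁺_a = q(u(a+);c) - a'η(u(a+)|c)`, `F⁻_b = q(u(b-);c) - b'η(u(b-)|c)`,
  from (3.1) for the constant state `c` (hypothesis `h31`, e.g. `relEntropy_weak_ineq_const`) and
  `η, q, f` bounded and uniformly continuous on `𝒰̄₀` (general `n × n` system, smooth fronts).

* section `ApproximateLimits` — `oneSidedLimits_of_ae_cellIneq` (Lemma 7.1, abstract form): a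
  bounded `I` with `I(t) ≤ I(s) + ∫_s^t Φ` off a null set `N` has one-sided limits along `Nᶜ` at
  EVERY time (the `ap lim` of Lemma 7.1), with nonpositive jumps ((7.2)) and the cell inequality
  between arbitrary times (as used in §7 from an interaction time `t_j` to `t`).

What remains for `chenKrupaVasseur_smallBV_unique_isentropicEuler_holds` is exactly
`chenKrupaVasseur_weakBV_isentropicEuler` (Thm 1.3 with Lemma 4.5: the `a`-contraction theory with
shifts and the modified front tracking algorithm, §§3–7 of the paper and its companion paper),
not proved in the tree; see `WeakBVStabilityProofs.lean` for its proved elementary steps.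

## References

* G. Chen, S. G. Krupa, A. F. Vasseur, *Uniqueness and weak-BV stability for `2 × 2` conservation
  laws*, Arch. Ration. Mech. Anal. 246 (2022) 299–332, doi:10.1007/s00205-022-01813-0;
  arXiv:2010.04761 (numbering used): §1 (Def. 1.2, `𝒮_weak`, `𝒮_BV^ε`, Thm 1.3, Thm 1.4 and the
  paragraph before it), §4 Lemma 4.5 [ChenKrupaVasseur2022].
-/

noncomputable section

open MeasureTheory Set Filter Bornology
open scoped Topology ENNReal

namespace Literature.Analysis.PDE

variable {n : ℕ}

section StrongTracesOfBV

/-- A function of bounded variation `w : ℝ → (Fin n → ℝ)` has a right limit at every point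
(`exists_tendsto_nhdsGT_of_boundedVariationOn` of `WeakBVStabilityProofs.lean`: componentwise Jordan
decomposition into monotone functions), here in `ε`–`δ` form along `y ↓ 0`. [folklore] -/
theorem exists_rightLimit_of_boundedVariationOn {w : ℝ → Fin n → ℝ}
    (hw : BoundedVariationOn w univ) (x : ℝ) :
    ∃ L : Fin n → ℝ, ∀ ε > 0, ∃ δ > 0, ∀ y ∈ Ioi (0 : ℝ), |y| < δ → ‖w (x + y) - L‖ ≤ ε := by
  obtain ⟨L, hT⟩ := exists_tendsto_nhdsGT_of_boundedVariationOn hw x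
  refine ⟨L, fun ε hε => ?_⟩
  have hev : ∀ᶠ z in 𝓝[>] x, dist (w z) L < ε := Metric.tendsto_nhds.1 hT ε hε
  rw [eventually_nhdsWithin_iff, Metric.eventually_nhds_iff] at hev
  obtain ⟨δ, hδ, hδ'⟩ := hev
  refine ⟨δ, hδ, fun y hy hyδ => ?_⟩
  have h1 : dist (x + y) x < δ := by simpa [Real.dist_eq] using hyδ
  have h2 : x + y ∈ Ioi x := by simpa using hy
  rw [← dist_eq_norm]
  exact (hδ' h1 h2).le

/-- A function of bounded variation `w : ℝ → (Fin n → ℝ)` has a left limit at every point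
(`exists_tendsto_nhdsLT_of_boundedVariationOn`), in `ε`–`δ` form along `y ↑ 0`. [folklore] -/
theorem exists_leftLimit_of_boundedVariationOn {w : ℝ → Fin n → ℝ}
    (hw : BoundedVariationOn w univ) (x : ℝ) :
    ∃ L : Fin n → ℝ, ∀ ε > 0, ∃ δ > 0, ∀ y ∈ Iio (0 : ℝ), |y| < δ → ‖w (x + y) - L‖ ≤ ε := by
  obtain ⟨L, hT⟩ := exists_tendsto_nhdsLT_of_boundedVariationOn hw x
  refine ⟨L, fun ε hε => ?_⟩
  have hev : ∀ᶠ z in 𝓝[<] x, dist (w z) L < ε := Metric.tendsto_nhds.1 hT ε hε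
  rw [eventually_nhdsWithin_iff, Metric.eventually_nhds_iff] at hev
  obtain ⟨δ, hδ, hδ'⟩ := hev
  refine ⟨δ, hδ, fun y hy hyδ => ?_⟩
  have h1 : dist (x + y) x < δ := by simpa [Real.dist_eq] using hyδ
  have h2 : x + y ∈ Iio x := by simpa using hy
  rw [← dist_eq_norm]
  exact (hδ' h1 h2).le

/-- Measurability in the parameter `t` of the essential supremum in `y` of a jointly measurable
`G (t, y)` (with respect to an s-finite measure in `y`). [folklore] -/
theorem measurable_essSup_prod {G : ℝ × ℝ → ℝ≥0∞} (hG : Measurable G) (ν : Measure ℝ)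
    [SFinite ν] : Measurable fun t => essSup (fun y => G (t, y)) ν := by
  refine measurable_of_Iic fun c => ?_
  have hset : (fun t => essSup (fun y => G (t, y)) ν) ⁻¹' Iic c
      = {t | ν (Prod.mk t ⁻¹' {p | c < G p}) = 0} := by
    ext t
    simp only [mem_preimage, mem_Iic, mem_setOf_eq]
    constructor
    · intro h
      have hae : ∀ᵐ y ∂ν, G (t, y) ≤ c :=
        (ENNReal.ae_le_essSup fun y => G (t, y)).mono fun y hy => hy.trans h
      rw [ae_iff] at hae
      simpa [not_le] using hae
    · intro h
      refine essSup_le_of_ae_le c ?_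
      rw [Filter.EventuallyLE, ae_iff]
      simpa [not_le] using h
  rw [hset]
  have hm : Measurable fun t => ν (Prod.mk t ⁻¹' {p | c < G p}) :=
    measurable_measure_prodMk_left (measurableSet_lt measurable_const hG)
  exact hm (measurableSet_singleton 0)

/-- **One-sided strong traces from one-sided limits** (the heart of "any `BV` function verifies the
Strong Trace Property"): if `v` is jointly measurable, bounded for `t > 0`, and for a.e. `t ∈ (0,T)`
the slice `v(t,·)` has a limit at `X(t)` along the side `S` (`S = (0,∞)` or `(-∞,0)`), then with
`u_± (t)` that limit (made measurable as a sequential `limUnder`),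
`∫₀ᵀ ess sup_{y ∈ S, |y|<1/k} ‖v(t, X(t)+y) - u_±(t)‖ dt → 0` (dominated convergence).
[cite: ChenKrupaVasseur2022, Def. 1.2 and §1 "any BV function verifies the Strong Trace Property"] -/
theorem exists_trace_of_ae_oneSidedLimit {v : ℝ → ℝ → Fin n → ℝ}
    (hv : Measurable (Function.uncurry v)) {M : ℝ} (hM : ∀ t x, 0 < t → ‖v t x‖ ≤ M)
    {X : ℝ → ℝ} (hX : Measurable X) {S : Set ℝ} (hS : MeasurableSet S) {ys : ℕ → ℝ}
    (hys : ∀ k, ys k ∈ S) (hys0 : Tendsto ys atTop (𝓝 0))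
    (hlim : ∀ T : ℝ, 0 < T → ∀ᵐ t ∂(volume.restrict (Ioo 0 T)),
      ∃ L : Fin n → ℝ, ∀ ε > 0, ∃ δ > 0, ∀ y ∈ S, |y| < δ → ‖v t (X t + y) - L‖ ≤ ε) :
    ∃ up : ℝ → Fin n → ℝ, Measurable up ∧ (∀ t, ‖up t‖ ≤ max M 0) ∧
      ∀ T : ℝ, 0 < T →
        Tendsto (fun k : ℕ => ∫⁻ t in Ioo 0 T,
          essSup (fun y => ‖v t (X t + y) - up t‖ₑ)
            (volume.restrict {y | y ∈ S ∧ |y| < 1 / (k : ℝ)})) atTop (𝓝 0) := by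
  classical
  -- the approximating sequence `F k t = v (t, X t + ys k)` and its set of convergence
  set F : ℕ → ℝ → (Fin n → ℝ) := fun k t => v t (X t + ys k) with hF
  have hFm : ∀ k, Measurable (F k) := fun k =>
    hv.comp (measurable_id.prodMk (hX.add_const (ys k)))
  set conv : Set ℝ := {t | ∃ c, Tendsto (fun k => F k t) atTop (𝓝 c)} with hconv
  have hconvm : MeasurableSet conv := MeasureTheory.measurableSet_exists_tendsto hFm
  have hlimm : Measurable fun t => limUnder atTop (fun k => F k t) :=
    (MeasureTheory.StronglyMeasurable.limUnder fun k => (hFm k).stronglyMeasurable).measurable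
  -- the trace
  set up : ℝ → Fin n → ℝ :=
    fun t => if t ∈ conv ∧ 0 < t then limUnder atTop (fun k => F k t) else 0 with hup
  have hpm : MeasurableSet {t : ℝ | t ∈ conv ∧ 0 < t} := hconvm.inter measurableSet_Ioi
  have hupm : Measurable up := Measurable.ite hpm hlimm measurable_const
  have hupb : ∀ t, ‖up t‖ ≤ max M 0 := by
    intro t
    simp only [hup]
    split_ifs with h
    · obtain ⟨⟨c, hc⟩, ht⟩ := h
      rw [hc.limUnder_eq]
      exact le_max_of_le_left
        (le_of_tendsto hc.norm (Eventually.of_forall fun k => hM t _ ht))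
    · simp
  refine ⟨up, hupm, hupb, fun T hT => ?_⟩
  set g : ℕ → ℝ → ℝ≥0∞ := fun k t => essSup (fun y => ‖v t (X t + y) - up t‖ₑ)
    (volume.restrict {y | y ∈ S ∧ |y| < 1 / (k : ℝ)}) with hg
  have hIm : ∀ k : ℕ, MeasurableSet {y : ℝ | y ∈ S ∧ |y| < 1 / (k : ℝ)} := fun k =>
    hS.inter (measurableSet_lt continuous_abs.measurable measurable_const)
  -- measurability of `g k`
  have hGm : Measurable fun p : ℝ × ℝ => ‖v p.1 (X p.1 + p.2) - up p.1‖ₑ :=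
    ((hv.comp (measurable_fst.prodMk ((hX.comp measurable_fst).add measurable_snd))).sub
      (hupm.comp measurable_fst)).enorm
  have hgm : ∀ k, Measurable (g k) := fun k => measurable_essSup_prod hGm _
  -- uniform bound
  have hgb : ∀ k, ∀ᵐ t ∂(volume.restrict (Ioo (0 : ℝ) T)), g k t ≤ ENNReal.ofReal (2 * max M 0) := by
    intro k
    filter_upwards [ae_restrict_mem measurableSet_Ioo] with t ht
    refine essSup_le_of_ae_le _ (Eventually.of_forall fun y => ?_)
    show ‖v t (X t + y) - up t‖ₑ ≤ ENNReal.ofReal (2 * max M 0)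
    rw [← ofReal_norm]
    refine ENNReal.ofReal_le_ofReal ?_
    calc ‖v t (X t + y) - up t‖ ≤ ‖v t (X t + y)‖ + ‖up t‖ := norm_sub_le _ _
      _ ≤ max M 0 + max M 0 := add_le_add ((hM t _ ht.1).trans (le_max_left _ _)) (hupb t)
      _ = 2 * max M 0 := by ring
  -- pointwise (a.e.) convergence
  have hglim : ∀ᵐ t ∂(volume.restrict (Ioo (0 : ℝ) T)), Tendsto (fun k => g k t) atTop (𝓝 0) := by
    filter_upwards [hlim T hT, ae_restrict_mem measurableSet_Ioo] with t ht htT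
    obtain ⟨L, hL⟩ := ht
    have hFL : Tendsto (fun k => F k t) atTop (𝓝 L) := by
      rw [Metric.tendsto_atTop]
      intro ε hε
      obtain ⟨δ, hδ, hδ'⟩ := hL (ε / 2) (half_pos hε)
      have hev : ∀ᶠ k in atTop, dist (ys k) 0 < δ := Metric.tendsto_nhds.1 hys0 δ hδ
      obtain ⟨N, hN⟩ := eventually_atTop.1 hev
      refine ⟨N, fun k hk => ?_⟩
      have hk' : |ys k| < δ := by simpa [Real.dist_eq] using hN k hk
      rw [dist_eq_norm]
      exact (hδ' (ys k) (hys k) hk').trans_lt (half_lt_self hε)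
    have htconv : t ∈ conv := ⟨L, hFL⟩
    have hupt : up t = L := by
      simp only [hup]
      rw [if_pos ⟨htconv, htT.1⟩]
      exact hFL.limUnder_eq
    rw [ENNReal.tendsto_atTop_zero]
    intro ε hε
    rcases eq_or_ne ε ⊤ with rfl | hεtop
    · exact ⟨0, fun k _ => le_top⟩
    have hε' : 0 < ε.toReal := ENNReal.toReal_pos hε.ne' hεtop
    obtain ⟨δ, hδ, hδ'⟩ := hL ε.toReal hε'
    obtain ⟨N, hN⟩ := exists_nat_one_div_lt hδ
    refine ⟨N + 1, fun k hk => ?_⟩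
    refine essSup_le_of_ae_le _ (ae_restrict_of_forall_mem (hIm k) fun y hy => ?_)
    obtain ⟨hyS, hyk⟩ := hy
    have hNk : ((N : ℝ) + 1) ≤ k := by exact_mod_cast hk
    have hyδ : |y| < δ :=
      calc |y| < 1 / (k : ℝ) := hyk
        _ ≤ 1 / ((N : ℝ) + 1) := one_div_le_one_div_of_le (by positivity) hNk
        _ < δ := hN
    show ‖v t (X t + y) - up t‖ₑ ≤ ε
    rw [hupt, ← ofReal_norm]
    calc ENNReal.ofReal ‖v t (X t + y) - L‖
        ≤ ENNReal.ofReal ε.toReal := ENNReal.ofReal_le_ofReal (hδ' y hyS hyδ)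
      _ = ε := ENNReal.ofReal_toReal hεtop
  -- dominated convergence on `(0,T)`
  have hfin : ∫⁻ _ in Ioo (0 : ℝ) T, ENNReal.ofReal (2 * max M 0) ≠ ⊤ := by
    rw [lintegral_const, Measure.restrict_apply_univ, Real.volume_Ioo]
    exact ENNReal.mul_ne_top ENNReal.ofReal_ne_top ENNReal.ofReal_ne_top
  have hmain := tendsto_lintegral_of_dominated_convergence
    (μ := volume.restrict (Ioo (0 : ℝ) T)) (fun _ => ENNReal.ofReal (2 * max M 0))
    hgm hgb hfin hglim
  rw [lintegral_zero] at hmain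
  exact hmain

/-- **"Any `BV` function verifies the Strong Trace Property"** (the form needed for Thm 1.4): a
jointly measurable `v`, bounded for `t > 0`, almost all of whose slices `v(t,·)`, `t ∈ (0,T)`
(every `T > 0`), have bounded variation on `ℝ`, verifies Def. 1.2 along every Lipschitz curve.
[cite: ChenKrupaVasseur2022, §1, paragraph before Thm 1.4] -/
theorem hasStrongTraces_of_ae_boundedVariationOn {v : ℝ → ℝ → Fin n → ℝ}
    (hv : Measurable (Function.uncurry v)) {M : ℝ} (hM : ∀ t x, 0 < t → ‖v t x‖ ≤ M)
    (hBV : ∀ T : ℝ, 0 < T →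
      ∀ᵐ t ∂(volume.restrict (Ioo 0 T)), BoundedVariationOn (v t) univ) :
    HasStrongTraces v := by
  intro X hX
  obtain ⟨K, hK⟩ := hX
  have hXm : Measurable X := hK.continuous.measurable
  have hys0 : Tendsto (fun k : ℕ => 1 / ((k : ℝ) + 1)) atTop (𝓝 0) :=
    tendsto_one_div_add_atTop_nhds_zero_nat
  obtain ⟨up, hupm, hupb, hup⟩ := exists_trace_of_ae_oneSidedLimit hv hM hXm measurableSet_Ioi
    (ys := fun k : ℕ => 1 / ((k : ℝ) + 1)) (fun k => by simp only [mem_Ioi]; positivity) hys0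
    (fun T hT => (hBV T hT).mono fun t ht => exists_rightLimit_of_boundedVariationOn ht (X t))
  obtain ⟨um, humm, humb, hum⟩ := exists_trace_of_ae_oneSidedLimit hv hM hXm measurableSet_Iio
    (ys := fun k : ℕ => -(1 / ((k : ℝ) + 1)))
    (fun k => by simp only [mem_Iio, neg_lt_zero]; positivity) (by simpa using hys0.neg)
    (fun T hT => (hBV T hT).mono fun t ht => exists_leftLimit_of_boundedVariationOn ht (X t))
  refine ⟨um, up, humm, hupm, ⟨max M 0, fun t => ⟨humb t, hupb t⟩⟩, fun T hT => ⟨?_, ?_⟩⟩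
  · have hset : ∀ k : ℕ, Ioo (0 : ℝ) (1 / (k : ℝ)) = {y | y ∈ Ioi (0 : ℝ) ∧ |y| < 1 / (k : ℝ)} := by
      intro k
      ext y
      simp only [mem_Ioo, mem_Ioi, mem_setOf_eq]
      constructor
      · rintro ⟨h1, h2⟩
        exact ⟨h1, by rwa [abs_of_pos h1]⟩
      · rintro ⟨h1, h2⟩
        exact ⟨h1, by rwa [abs_of_pos h1] at h2⟩
    simp_rw [hset]
    exact hup T hT
  · have hset : ∀ k : ℕ,
        Ioo (-(1 / (k : ℝ))) 0 = {y | y ∈ Iio (0 : ℝ) ∧ |y| < 1 / (k : ℝ)} := by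
      intro k
      ext y
      simp only [mem_Ioo, mem_Iio, mem_setOf_eq]
      constructor
      · rintro ⟨h1, h2⟩
        refine ⟨h2, ?_⟩
        rw [abs_of_neg h2]
        linarith
      · rintro ⟨h1, h2⟩
        rw [abs_of_neg h1] at h2
        exact ⟨by linarith, h1⟩
    simp_rw [hset]
    exact hum T hT

/-- **Theorem 1.4 from Theorem 1.3** (the printed proof of Thm 1.4, for a general system (1.1)
with bounded state set `𝒰₀ ⊇ 𝒱`): every competitor of `SmallBVUnique` — jointly measurable,
`𝒰₀`-valued, `L^∞(0,T; BV(ℝ))`, entropy weak solution with the same datum — has strong traces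
(`hasStrongTraces_of_ae_boundedVariationOn`), hence lies in `𝒮_weak`, so the uniqueness clause of
the conclusion of Thm 1.3 applies. [cite: ChenKrupaVasseur2022, §1, Thm 1.4 and the paragraph
before it] -/
theorem smallBVUnique_of_weakBVStable {f : (Fin n → ℝ) → (Fin n → ℝ)} {η q : (Fin n → ℝ) → ℝ}
    {U₀ V : Set (Fin n → ℝ)} (hU : IsBounded U₀) (hVU : V ⊆ U₀)
    (h : WeakBVStable f η q U₀ V) : SmallBVUnique f η q U₀ V := by
  intro O hO hOV
  obtain ⟨ε, hε, hεH⟩ := h O hO hOV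
  refine ⟨ε, hε, fun u₀ u hu v hvm hvU hvBV hvsol => ?_⟩
  obtain ⟨M, hM⟩ := hU.exists_norm_le
  refine (hεH u₀ u hu).2 v ⟨hvm, hu.2.1, hvU, ?_, hvsol, ?_⟩
  · exact ⟨M, fun x => hM _ (hVU (hOV (subset_closure (hu.2.2.2.1 x))))⟩
  · refine hasStrongTraces_of_ae_boundedVariationOn hvm (M := M)
      (fun t x ht => hM _ (hvU t x ht.le)) fun T hT => ?_
    have hfin := hvBV T hT
    filter_upwards [ENNReal.ae_le_essSup fun t => eVariationOn (v t) univ] with t ht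
    exact ne_top_of_le_ne_top hfin.ne ht

end StrongTracesOfBV

/-- **Thm 1.4 for isentropic Euler from Thm 1.3 for isentropic Euler** (the printed proof of
Thm 1.4 applied to the instance of Lemma 4.5): the named fact
`chenKrupaVasseur_smallBV_unique_isentropicEuler` follows from
`chenKrupaVasseur_weakBV_isentropicEuler` by `smallBVUnique_of_weakBVStable`, the state set `𝒰₀`
being bounded (`isBounded_isentropicEulerStates`, Lemma 4.5 (e)) with `𝒱 ⊆ 𝒰₀`.
[cite: ChenKrupaVasseur2022, Thm 1.4 (and the paragraph before it), Lemma 4.5] -/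
theorem chenKrupaVasseur_smallBV_unique_isentropicEuler_of_weakBV
    (h : chenKrupaVasseur_weakBV_isentropicEuler) :
    chenKrupaVasseur_smallBV_unique_isentropicEuler := fun γ C hγ hC =>
  smallBVUnique_of_weakBVStable (isBounded_isentropicEulerStates hγ)
    (isentropicEulerInterior_subset_states γ C) (h γ C hγ hC)

/-! ## Strong traces of observables -/

section TracesObservables

/-- **Traces take values in the closure of the state set.** If `v` is valued in `W` for `t > 0`
and `up` is a one-sided trace of `v` along `X` on `(0,T)` in the sense of Def. 1.2
(`∫₀ᵀ ess sup_{y ∈ I_k} ‖v(t, X(t)+y) - up(t)‖ dt → 0` for windows `I_k` of positive measure), then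
`up(t) ∈ W̄` for a.e. `t ∈ (0,T)`. [folklore] -/
theorem ae_mem_closure_of_tendsto_lintegral_essSup {v : ℝ → ℝ → Fin n → ℝ}
    (hv : Measurable (Function.uncurry v)) {X : ℝ → ℝ} (hX : Measurable X)
    {up : ℝ → Fin n → ℝ} (hup : Measurable up) {W : Set (Fin n → ℝ)}
    (hvW : ∀ t y, 0 < t → v t y ∈ W) {T : ℝ} {I : ℕ → Set ℝ} (hI : ∀ k, volume (I k) ≠ 0)
    (htr : Tendsto (fun k : ℕ => ∫⁻ t in Ioo 0 T,
        essSup (fun y => ‖v t (X t + y) - up t‖ₑ) (volume.restrict (I k))) atTop (𝓝 0)) :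
    ∀ᵐ t ∂(volume.restrict (Ioo 0 T)), up t ∈ closure W := by
  set g : ℕ → ℝ → ℝ≥0∞ := fun k t =>
    essSup (fun y => ‖v t (X t + y) - up t‖ₑ) (volume.restrict (I k)) with hg
  have hGm : Measurable fun p : ℝ × ℝ => ‖v p.1 (X p.1 + p.2) - up p.1‖ₑ :=
    ((hv.comp (measurable_fst.prodMk ((hX.comp measurable_fst).add measurable_snd))).sub
      (hup.comp measurable_fst)).enorm
  have hgm : ∀ k, Measurable (g k) := fun k => measurable_essSup_prod hGm _
  -- a subsequence along which `∑ ∫ g < ∞`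
  have hex : ∀ j : ℕ, ∃ k : ℕ, ∫⁻ t in Ioo 0 T, g k t ≤ (2⁻¹ : ℝ≥0∞) ^ j := by
    intro j
    have hpos : (0 : ℝ≥0∞) < (2⁻¹ : ℝ≥0∞) ^ j := ENNReal.pow_pos (by norm_num) _
    obtain ⟨N, hN⟩ := ENNReal.tendsto_atTop_zero.1 htr _ hpos
    exact ⟨N, hN N le_rfl⟩
  choose k hk using hex
  have hsum : ∫⁻ t in Ioo 0 T, ∑' j, g (k j) t ≠ ⊤ := by
    rw [lintegral_tsum fun j => (hgm (k j)).aemeasurable]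
    refine ne_top_of_le_ne_top ?_ (ENNReal.tsum_le_tsum hk)
    rw [ENNReal.tsum_geometric, ENNReal.one_sub_inv_two, inv_inv]
    exact ENNReal.ofNat_ne_top
  have hae : ∀ᵐ t ∂(volume.restrict (Ioo 0 T)), ∑' j, g (k j) t < ⊤ :=
    ae_lt_top (Measurable.tsum fun j => hgm (k j)) hsum
  filter_upwards [hae, ae_restrict_mem measurableSet_Ioo] with t ht htT
  have hlim : Tendsto (fun j => g (k j) t) atTop (𝓝 0) :=
    ENNReal.tendsto_atTop_zero_of_tsum_ne_top ht.ne
  rw [Metric.mem_closure_iff]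
  intro ε hε
  obtain ⟨J, hJ⟩ := ENNReal.tendsto_atTop_zero.1 hlim (ENNReal.ofReal (ε / 2))
    (ENNReal.ofReal_pos.2 (half_pos hε))
  have hJ' : g (k J) t ≤ ENNReal.ofReal (ε / 2) := hJ J le_rfl
  have hae' : ∀ᵐ y ∂(volume.restrict (I (k J))),
      ‖v t (X t + y) - up t‖ₑ ≤ ENNReal.ofReal (ε / 2) :=
    (ENNReal.ae_le_essSup fun y => ‖v t (X t + y) - up t‖ₑ).mono fun y hy => hy.trans hJ'
  have hne : NeBot (ae (volume.restrict (I (k J)))) := by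
    rw [ae_neBot]
    intro h0
    exact hI (k J) (Measure.restrict_eq_zero.1 h0)
  obtain ⟨y, hy⟩ := hae'.exists
  refine ⟨v t (X t + y), hvW t _ htT.1, ?_⟩
  rw [dist_comm, dist_eq_norm]
  have : ‖v t (X t + y) - up t‖ ≤ ε / 2 := by
    rw [← ofReal_norm] at hy
    exact (ENNReal.ofReal_le_ofReal_iff (half_pos hε).le).1 hy
  linarith

/-- **Strong traces pass to uniformly continuous observables.** If `up` is a one-sided trace of
`v` along `X` on `(0,T)` (windows `I_k`), `v` is valued in `W` for `t > 0`, `up(t) ∈ W` for a.e.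
`t ∈ (0,T)`, and `E` is bounded and uniformly continuous on `W`, then `E ∘ up` is the corresponding
one-sided trace of `E ∘ v`: `∫₀ᵀ ess sup_{y ∈ I_k} |E(v(t,X(t)+y)) - E(up(t))| dt → 0`.
(Used with `E = η(·|b)`, `q(·;b)` to integrate (3.1) on cells, §7.) [folklore] -/
theorem tendsto_lintegral_essSup_comp_of_uniformContinuousOn {v : ℝ → ℝ → Fin n → ℝ} {X : ℝ → ℝ}
    {up : ℝ → Fin n → ℝ} {W : Set (Fin n → ℝ)} {E : (Fin n → ℝ) → ℝ}
    (hE : UniformContinuousOn E W) {B : ℝ} (hB : ∀ p ∈ W, |E p| ≤ B)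
    (hvW : ∀ t y, 0 < t → v t y ∈ W) {T : ℝ}
    (hupW : ∀ᵐ t ∂(volume.restrict (Ioo 0 T)), up t ∈ W) {I : ℕ → Set ℝ}
    (htr : Tendsto (fun k : ℕ => ∫⁻ t in Ioo 0 T,
        essSup (fun y => ‖v t (X t + y) - up t‖ₑ) (volume.restrict (I k))) atTop (𝓝 0)) :
    Tendsto (fun k : ℕ => ∫⁻ t in Ioo 0 T,
        essSup (fun y => ‖E (v t (X t + y)) - E (up t)‖ₑ) (volume.restrict (I k)))
      atTop (𝓝 0) := by
  rcases le_or_gt T 0 with hT | hT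
  · have h0 : ∀ k : ℕ, ∫⁻ t in Ioo 0 T,
        essSup (fun y => ‖E (v t (X t + y)) - E (up t)‖ₑ) (volume.restrict (I k)) = 0 := by
      intro k
      rw [Ioo_eq_empty (not_lt.2 hT), Measure.restrict_empty, lintegral_zero_measure]
    simp_rw [h0]
    exact tendsto_const_nhds
  rw [ENNReal.tendsto_atTop_zero]
  intro ε hε
  -- a real `e > 0` with `e * T ≤ ε / 2`
  obtain ⟨e, he, heT⟩ : ∃ e : ℝ, 0 < e ∧ ENNReal.ofReal (e * T) ≤ ε / 2 := by
    rcases eq_or_ne ε ⊤ with rfl | hεtop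
    · refine ⟨1, one_pos, ?_⟩
      rw [ENNReal.top_div_of_ne_top (by norm_num)]
      exact le_top
    have hε2 : 0 < (ε / 2).toReal :=
      ENNReal.toReal_pos (ENNReal.half_pos hε.ne').ne'
        (ENNReal.div_ne_top hεtop (by norm_num))
    refine ⟨(ε / 2).toReal / T, div_pos hε2 hT, ?_⟩
    rw [div_mul_cancel₀ _ hT.ne', ENNReal.ofReal_toReal (ENNReal.div_ne_top hεtop (by norm_num))]
  -- modulus of continuity: `|E p - E q| ≤ e + L ‖p - q‖` on `W`
  obtain ⟨δ, hδ, hδE⟩ := Metric.uniformContinuousOn_iff.1 hE e he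
  have hWne : W.Nonempty := ⟨v (T / 2) 0, hvW _ _ (half_pos hT)⟩
  have hB0 : 0 ≤ B := by
    obtain ⟨p, hp⟩ := hWne
    exact (abs_nonneg _).trans (hB p hp)
  set L : ℝ := 2 * B / δ with hL
  have hL0 : 0 ≤ L := by positivity
  have hmod : ∀ p ∈ W, ∀ q ∈ W, |E p - E q| ≤ e + L * ‖p - q‖ := by
    intro p hp q hq
    rcases lt_or_ge ‖p - q‖ δ with hpq | hpq
    · have h1 : dist (E p) (E q) < e := hδE p hp q hq (by rwa [dist_eq_norm])
      rw [Real.dist_eq] at h1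
      have h2 : 0 ≤ L * ‖p - q‖ := by positivity
      linarith
    · have h1 : |E p - E q| ≤ 2 * B := by
        calc |E p - E q| ≤ |E p| + |E q| := abs_sub _ _
          _ ≤ B + B := add_le_add (hB p hp) (hB q hq)
          _ = 2 * B := by ring
      have h2 : 2 * B = L * δ := by rw [hL]; field_simp
      have h3 : L * δ ≤ L * ‖p - q‖ := mul_le_mul_of_nonneg_left hpq hL0
      linarith
  -- pointwise, then `ess sup`, then integral bounds
  set g : ℕ → ℝ → ℝ≥0∞ := fun k t =>
    essSup (fun y => ‖v t (X t + y) - up t‖ₑ) (volume.restrict (I k)) with hg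
  have hess : ∀ k, ∀ᵐ t ∂(volume.restrict (Ioo 0 T)),
      essSup (fun y => ‖E (v t (X t + y)) - E (up t)‖ₑ) (volume.restrict (I k))
        ≤ ENNReal.ofReal e + ENNReal.ofReal L * g k t := by
    intro k
    filter_upwards [hupW, ae_restrict_mem measurableSet_Ioo] with t ht htT
    have hpt : ∀ y, ‖E (v t (X t + y)) - E (up t)‖ₑ
        ≤ ENNReal.ofReal e + ENNReal.ofReal L * ‖v t (X t + y) - up t‖ₑ := by
      intro y
      rw [← ofReal_norm, ← ofReal_norm, ← ENNReal.ofReal_mul hL0,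
        ← ENNReal.ofReal_add he.le (by positivity), Real.norm_eq_abs]
      exact ENNReal.ofReal_le_ofReal (hmod _ (hvW t _ htT.1) _ ht)
    refine essSup_le_of_ae_le _ ?_
    exact (ENNReal.ae_le_essSup fun y => ‖v t (X t + y) - up t‖ₑ).mono fun y hy =>
      (hpt y).trans (by dsimp only; gcongr)
  have hint : ∀ k, ∫⁻ t in Ioo 0 T,
      essSup (fun y => ‖E (v t (X t + y)) - E (up t)‖ₑ) (volume.restrict (I k))
        ≤ ε / 2 + ENNReal.ofReal L * ∫⁻ t in Ioo 0 T, g k t := by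
    intro k
    calc ∫⁻ t in Ioo 0 T, essSup (fun y => ‖E (v t (X t + y)) - E (up t)‖ₑ)
            (volume.restrict (I k))
        ≤ ∫⁻ t in Ioo 0 T, (ENNReal.ofReal e + ENNReal.ofReal L * g k t) :=
          lintegral_mono_ae (hess k)
      _ = ENNReal.ofReal e * volume (Ioo (0 : ℝ) T) + ENNReal.ofReal L * ∫⁻ t in Ioo 0 T, g k t := by
          rw [lintegral_add_left measurable_const, lintegral_const, Measure.restrict_apply_univ,
            lintegral_const_mul' _ _ ENNReal.ofReal_ne_top]
      _ ≤ ε / 2 + ENNReal.ofReal L * ∫⁻ t in Ioo 0 T, g k t := by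
          gcongr
          rw [Real.volume_Ioo, sub_zero, ← ENNReal.ofReal_mul he.le]
          exact heT
  have hlim : Tendsto (fun k => ENNReal.ofReal L * ∫⁻ t in Ioo 0 T, g k t) atTop (𝓝 0) := by
    have := ENNReal.Tendsto.const_mul htr (Or.inr ENNReal.ofReal_ne_top) (a := ENNReal.ofReal L)
    rwa [mul_zero] at this
  obtain ⟨N, hN⟩ := ENNReal.tendsto_atTop_zero.1 hlim (ε / 2) (ENNReal.half_pos hε.ne')
  refine ⟨N, fun k hk => ?_⟩
  calc ∫⁻ t in Ioo 0 T, essSup (fun y => ‖E (v t (X t + y)) - E (up t)‖ₑ) (volume.restrict (I k))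
      ≤ ε / 2 + ENNReal.ofReal L * ∫⁻ t in Ioo 0 T, g k t := hint k
    _ ≤ ε / 2 + ε / 2 := by gcongr; exact hN k hk
    _ = ε := ENNReal.add_halves ε

end TracesObservables

/-! ## One-sided averaging kernels and kernel traces -/

open Literature.Analysis.Calculus

section TraceKernel

/-! ### The one-sided averaging kernel `K = smoothTransition'` -/

/-- `K` vanishes off `(0,1)`. [folklore] -/
theorem deriv_smoothTransition_eq_zero_of_not_mem {y : ℝ} (hy : y ∉ Ioo (0 : ℝ) 1) :
    deriv Real.smoothTransition y = 0 := by
  rcases le_or_gt y 0 with h | h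
  · exact deriv_smoothTransition_of_nonpos h
  · have h1 : 1 ≤ y := by
      by_contra h'
      exact hy ⟨h, not_le.1 h'⟩
    exact deriv_smoothTransition_of_one_le h1

/-- A bound `D ≥ 1` for `|K|`. [folklore] -/
theorem exists_one_le_bound_deriv_smoothTransition :
    ∃ D : ℝ, 1 ≤ D ∧ ∀ y, |deriv Real.smoothTransition y| ≤ D := by
  obtain ⟨D, -, hD⟩ := exists_bound_deriv_smoothTransition
  exact ⟨max D 1, le_max_right _ _, fun y => (hD y).trans (le_max_left _ _)⟩

/-- `K` has mass one: `∫ K = smoothTransition 1 - smoothTransition 0 = 1`. [folklore] -/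
theorem integral_deriv_smoothTransition : ∫ y, deriv Real.smoothTransition y = 1 := by
  have h1 : ∫ y in (0 : ℝ)..1, deriv Real.smoothTransition y = 1 := by
    rw [intervalIntegral.integral_deriv_eq_sub (fun x _ => differentiable_smoothTransition x)
      (((Real.smoothTransition.contDiff (n := 1)).continuous_deriv le_rfl).intervalIntegrable _ _)]
    simp [Real.smoothTransition.one, Real.smoothTransition.zero]
  rw [← h1, intervalIntegral.integral_of_le zero_le_one, ← integral_Icc_eq_integral_Ioc]
  symm
  refine setIntegral_eq_integral_of_forall_compl_eq_zero fun y hy => ?_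
  exact deriv_smoothTransition_eq_zero_of_not_mem fun h => hy (Ioo_subset_Icc_self h)

/-- The rescaled right kernel `y ↦ c K(c y)` (`c > 0`) has mass one. [folklore] -/
theorem integral_rightKernel {c : ℝ} (hc : 0 < c) :
    ∫ y, c * deriv Real.smoothTransition (c * y) = 1 := by
  rw [integral_const_mul, Measure.integral_comp_mul_left (fun y => deriv Real.smoothTransition y),
    integral_deriv_smoothTransition, abs_of_pos (inv_pos.2 hc), smul_eq_mul, mul_one,
    mul_inv_cancel₀ hc.ne']

/-- The rescaled left kernel `y ↦ c K(-c y)` (`c > 0`) has mass one. [folklore] -/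
theorem integral_leftKernel {c : ℝ} (hc : 0 < c) :
    ∫ y, c * deriv Real.smoothTransition (-(c * y)) = 1 := by
  have h : (fun y => c * deriv Real.smoothTransition (-(c * y)))
      = fun y => c * deriv Real.smoothTransition ((-c) * y) := by
    funext y
    rw [neg_mul]
  rw [h, integral_const_mul, Measure.integral_comp_mul_left (fun y => deriv Real.smoothTransition y),
    integral_deriv_smoothTransition, inv_neg, abs_neg, abs_of_pos (inv_pos.2 hc), smul_eq_mul,
    mul_one, mul_inv_cancel₀ hc.ne']

/-- The right kernel `c K(c y)` is supported in the window `(0, 1/c)`. [folklore] -/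
theorem rightKernel_eq_zero {c : ℝ} (hc : 0 < c) {y : ℝ} (hy : y ∉ Ioo (0 : ℝ) (1 / c)) :
    c * deriv Real.smoothTransition (c * y) = 0 := by
  rw [deriv_smoothTransition_eq_zero_of_not_mem, mul_zero]
  rintro ⟨h1, h2⟩
  refine hy ⟨pos_of_mul_pos_right h1 hc.le, ?_⟩
  rw [lt_div_iff₀ hc, mul_comm]
  exact h2

/-- The left kernel `c K(-c y)` is supported in the window `(-1/c, 0)`. [folklore] -/
theorem leftKernel_eq_zero {c : ℝ} (hc : 0 < c) {y : ℝ} (hy : y ∉ Ioo (-(1 / c)) (0 : ℝ)) :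
    c * deriv Real.smoothTransition (-(c * y)) = 0 := by
  rw [deriv_smoothTransition_eq_zero_of_not_mem, mul_zero]
  rintro ⟨h1, h2⟩
  refine hy ⟨?_, ?_⟩
  · have e : -(1 / c) = (-1) / c := by ring
    rw [e, div_lt_iff₀ hc]
    linarith [mul_comm c y]
  · by_contra H
    nlinarith [mul_nonneg hc.le (not_lt.1 H)]

/-- **Kernel averages against one-sided essential suprema.** For a kernel `κ` of mass one
supported in a window `W` with `|κ| ≤ B` there, and a bounded measurable `h`:
`‖∫ κ h - L‖ₑ ≤ B · |W| · ess sup_W ‖h - L‖ₑ`. [folklore] -/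
theorem enorm_integral_kernel_mul_sub_le {κ : ℝ → ℝ} (hκc : Continuous κ) {W : Set ℝ}
    (hW : MeasurableSet W) (hWb : IsBounded W) (hκW : ∀ y ∉ W, κ y = 0) {B : ℝ}
    (hB : ∀ y, |κ y| ≤ B) (hκ1 : ∫ y, κ y = 1) {h : ℝ → ℝ} (hm : AEStronglyMeasurable h)
    {M : ℝ} (hM : ∀ y, |h y| ≤ M) (L : ℝ) :
    ‖(∫ y, κ y * h y) - L‖ₑ
      ≤ ENNReal.ofReal B * volume W * essSup (fun y => ‖h y - L‖ₑ) (volume.restrict W) := by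
  have hκsupp : HasCompactSupport κ := by
    refine HasCompactSupport.intro' hWb.isCompact_closure isClosed_closure ?_
    exact fun y hy => hκW y fun h => hy (subset_closure h)
  have hκi : Integrable κ := hκc.integrable_of_hasCompactSupport hκsupp
  have hκh : Integrable fun y => κ y * h y :=
    hκi.mul_bdd hm (Eventually.of_forall fun y => by rw [Real.norm_eq_abs]; exact hM y)
  have hsub : (∫ y, κ y * h y) - L = ∫ y, κ y * (h y - L) := by
    have e : (fun y => κ y * (h y - L)) = fun y => κ y * h y - κ y * L := by
      funext y; ring
    rw [e, integral_sub hκh (hκi.mul_const L), integral_mul_const, hκ1, one_mul]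
  rw [hsub]
  refine (enorm_integral_le_lintegral_enorm _).trans ?_
  have hpt : ∀ y, ‖κ y * (h y - L)‖ₑ
      ≤ W.indicator (fun y => ENNReal.ofReal B * ‖h y - L‖ₑ) y := by
    intro y
    by_cases hy : y ∈ W
    · rw [indicator_of_mem hy, enorm_mul, Real.enorm_eq_ofReal_abs]
      gcongr
      exact hB y
    · rw [indicator_of_notMem hy, hκW y hy, zero_mul, enorm_zero]
  calc ∫⁻ y, ‖κ y * (h y - L)‖ₑ
      ≤ ∫⁻ y, W.indicator (fun y => ENNReal.ofReal B * ‖h y - L‖ₑ) y := lintegral_mono hpt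
    _ = ENNReal.ofReal B * ∫⁻ y in W, ‖h y - L‖ₑ := by
        rw [lintegral_indicator hW, lintegral_const_mul' _ _ ENNReal.ofReal_ne_top]
    _ ≤ ENNReal.ofReal B * (essSup (fun y => ‖h y - L‖ₑ) (volume.restrict W) * volume W) := by
        gcongr
        calc ∫⁻ y in W, ‖h y - L‖ₑ
            ≤ ∫⁻ _ in W, essSup (fun y => ‖h y - L‖ₑ) (volume.restrict W) :=
              lintegral_mono_ae (ENNReal.ae_le_essSup _)
          _ = essSup (fun y => ‖h y - L‖ₑ) (volume.restrict W) * volume W := by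
              rw [lintegral_const, Measure.restrict_apply_univ]
    _ = ENNReal.ofReal B * volume W * essSup (fun y => ‖h y - L‖ₑ) (volume.restrict W) := by
        ring

/-- Right kernel averages: `‖∫ c K(c y) h(y) dy - L‖ₑ ≤ D · ess sup_{0<y<1/c} ‖h - L‖ₑ`. [folklore] -/
theorem enorm_rightKernelAvg_sub_le {D : ℝ} (hD : ∀ y, |deriv Real.smoothTransition y| ≤ D)
    (hD0 : 0 ≤ D) {c : ℝ} (hc : 0 < c) {h : ℝ → ℝ} (hm : AEStronglyMeasurable h) {M : ℝ}
    (hM : ∀ y, |h y| ≤ M) (L : ℝ) :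
    ‖(∫ y, c * deriv Real.smoothTransition (c * y) * h y) - L‖ₑ
      ≤ ENNReal.ofReal D * essSup (fun y => ‖h y - L‖ₑ) (volume.restrict (Ioo 0 (1 / c))) := by
  have hκc : Continuous fun y => c * deriv Real.smoothTransition (c * y) :=
    continuous_const.mul (((Real.smoothTransition.contDiff (n := 1)).continuous_deriv le_rfl).comp (continuous_const.mul continuous_id))
  have h1 := enorm_integral_kernel_mul_sub_le hκc measurableSet_Ioo (Metric.isBounded_Ioo _ _)
    (fun y hy => rightKernel_eq_zero hc hy) (B := c * D)
    (fun y => by rw [abs_mul, abs_of_pos hc]; exact mul_le_mul_of_nonneg_left (hD _) hc.le)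
    (integral_rightKernel hc) hm hM L
  rw [Real.volume_Ioo, sub_zero, ← ENNReal.ofReal_mul (by positivity)] at h1
  have e : c * D * (1 / c) = D := by field_simp
  rwa [e] at h1

/-- Left kernel averages: `‖∫ c K(-c y) h(y) dy - L‖ₑ ≤ D · ess sup_{-1/c<y<0} ‖h - L‖ₑ`. [folklore] -/
theorem enorm_leftKernelAvg_sub_le {D : ℝ} (hD : ∀ y, |deriv Real.smoothTransition y| ≤ D)
    (hD0 : 0 ≤ D) {c : ℝ} (hc : 0 < c) {h : ℝ → ℝ} (hm : AEStronglyMeasurable h) {M : ℝ}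
    (hM : ∀ y, |h y| ≤ M) (L : ℝ) :
    ‖(∫ y, c * deriv Real.smoothTransition (-(c * y)) * h y) - L‖ₑ
      ≤ ENNReal.ofReal D * essSup (fun y => ‖h y - L‖ₑ) (volume.restrict (Ioo (-(1 / c)) 0)) := by
  have hκc : Continuous fun y => c * deriv Real.smoothTransition (-(c * y)) :=
    continuous_const.mul
      (((Real.smoothTransition.contDiff (n := 1)).continuous_deriv le_rfl).comp (continuous_const.mul continuous_id).neg)
  have h1 := enorm_integral_kernel_mul_sub_le hκc measurableSet_Ioo (Metric.isBounded_Ioo _ _)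
    (fun y hy => leftKernel_eq_zero hc hy) (B := c * D)
    (fun y => by rw [abs_mul, abs_of_pos hc]; exact mul_le_mul_of_nonneg_left (hD _) hc.le)
    (integral_leftKernel hc) hm hM L
  rw [Real.volume_Ioo, sub_neg_eq_add, zero_add, ← ENNReal.ofReal_mul (by positivity)] at h1
  have e : c * D * (1 / c) = D := by field_simp
  rwa [e] at h1

/-- **Strong traces (Def. 1.2, right side) give kernel traces**: if
`∫_S^T ess sup_{0<y<1/k} |H(r, a(r)+y) - Ha(r)| dr → 0`, then the right kernel averages
`∫ k K(k y) H(r, a(r)+y) dy` converge to `Ha` in `L¹(S,T)`. [folklore] -/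
theorem tendsto_lintegral_rightKernelAvg_sub {H : ℝ → ℝ → ℝ} (hH : Measurable (Function.uncurry H))
    {S T M : ℝ} (hM : ∀ r y, S < r → |H r y| ≤ M) {a Ha : ℝ → ℝ}
    (htr : Tendsto (fun k : ℕ => ∫⁻ r in Ioo S T,
        essSup (fun y => ‖H r (a r + y) - Ha r‖ₑ) (volume.restrict (Ioo 0 (1 / (k : ℝ)))))
      atTop (𝓝 0)) :
    Tendsto (fun k : ℕ => ∫⁻ r in Ioo S T,
        ‖(∫ y, (k : ℝ) * deriv Real.smoothTransition ((k : ℝ) * y) * H r (a r + y)) - Ha r‖ₑ)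
      atTop (𝓝 0) := by
  obtain ⟨D, hD1, hD⟩ := exists_one_le_bound_deriv_smoothTransition
  have hD0 : 0 ≤ D := zero_le_one.trans hD1
  have hlim : Tendsto (fun k : ℕ => ENNReal.ofReal D * ∫⁻ r in Ioo S T,
      essSup (fun y => ‖H r (a r + y) - Ha r‖ₑ) (volume.restrict (Ioo 0 (1 / (k : ℝ))))) atTop
      (𝓝 0) := by
    have := ENNReal.Tendsto.const_mul htr (Or.inr ENNReal.ofReal_ne_top) (a := ENNReal.ofReal D)
    rwa [mul_zero] at this
  refine tendsto_of_tendsto_of_tendsto_of_le_of_le' tendsto_const_nhds hlim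
    (Eventually.of_forall fun k => zero_le) ?_
  filter_upwards [eventually_ge_atTop 1] with k hk
  have hc : (0 : ℝ) < k := by exact_mod_cast hk
  rw [← lintegral_const_mul' _ _ ENNReal.ofReal_ne_top]
  refine lintegral_mono_ae ?_
  filter_upwards [ae_restrict_mem measurableSet_Ioo] with r hr
  have hslice : AEStronglyMeasurable (fun y => H r (a r + y)) :=
    ((hH.of_uncurry_left (x := r)).comp (measurable_const_add (a r))).aestronglyMeasurable
  exact enorm_rightKernelAvg_sub_le hD hD0 hc hslice (fun y => hM r _ hr.1) (Ha r)

/-- **Strong traces (Def. 1.2, left side) give kernel traces**: if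
`∫_S^T ess sup_{-1/k<y<0} |H(r, b(r)+y) - Hb(r)| dr → 0`, then the left kernel averages
`∫ k K(-k y) H(r, b(r)+y) dy` converge to `Hb` in `L¹(S,T)`. [folklore] -/
theorem tendsto_lintegral_leftKernelAvg_sub {H : ℝ → ℝ → ℝ} (hH : Measurable (Function.uncurry H))
    {S T M : ℝ} (hM : ∀ r y, S < r → |H r y| ≤ M) {b Hb : ℝ → ℝ}
    (htr : Tendsto (fun k : ℕ => ∫⁻ r in Ioo S T,
        essSup (fun y => ‖H r (b r + y) - Hb r‖ₑ) (volume.restrict (Ioo (-(1 / (k : ℝ))) 0)))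
      atTop (𝓝 0)) :
    Tendsto (fun k : ℕ => ∫⁻ r in Ioo S T,
        ‖(∫ y, (k : ℝ) * deriv Real.smoothTransition (-((k : ℝ) * y)) * H r (b r + y)) - Hb r‖ₑ)
      atTop (𝓝 0) := by
  obtain ⟨D, hD1, hD⟩ := exists_one_le_bound_deriv_smoothTransition
  have hD0 : 0 ≤ D := zero_le_one.trans hD1
  have hlim : Tendsto (fun k : ℕ => ENNReal.ofReal D * ∫⁻ r in Ioo S T,
      essSup (fun y => ‖H r (b r + y) - Hb r‖ₑ) (volume.restrict (Ioo (-(1 / (k : ℝ))) 0))) atTop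
      (𝓝 0) := by
    have := ENNReal.Tendsto.const_mul htr (Or.inr ENNReal.ofReal_ne_top) (a := ENNReal.ofReal D)
    rwa [mul_zero] at this
  refine tendsto_of_tendsto_of_tendsto_of_le_of_le' tendsto_const_nhds hlim
    (Eventually.of_forall fun k => zero_le) ?_
  filter_upwards [eventually_ge_atTop 1] with k hk
  have hc : (0 : ℝ) < k := by exact_mod_cast hk
  rw [← lintegral_const_mul' _ _ ENNReal.ofReal_ne_top]
  refine lintegral_mono_ae ?_
  filter_upwards [ae_restrict_mem measurableSet_Ioo] with r hr
  have hslice : AEStronglyMeasurable (fun y => H r (b r + y)) :=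
    ((hH.of_uncurry_left (x := r)).comp (measurable_const_add (b r))).aestronglyMeasurable
  exact enorm_leftKernelAvg_sub_le hD hD0 hc hslice (fun y => hM r _ hr.1) (Hb r)

end TraceKernel

/-! ## The cell inequality (integration of a distributional inequality on a cell between curves) -/

section CellInequality

/-- **Cell inequality, mollified form** (the engine of §7 / Lemma 4.2 / Prop 4.4: "integrating
(3.1) on `Q = {(r,x) : t_j < r < t, h_i(r) < x < h_{i+1}(r)}` and using the strong trace
property"). Let `G₁, G₂` be bounded measurable on `{r > S}` (`S ≥ 0`) with
`∂ₜ G₁ + ∂ₓ G₂ ≤ 0` in the sense of distributions on `(S,T) × ℝ` (smooth compactly supported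
nonnegative test functions, in the integral form of §1), let `a < b` be smooth curves on `(S,T)`,
and let `Φa`, `Φb` be the kernel traces of `G₂ - a' G₁` from the right along `a` and of
`G₂ - b' G₁` from the left along `b`. Then for `S < s < t < T` and a time cutoff
`χ(r) = Real.smoothTransition((r-s)/τ) Real.smoothTransition((t-r)/τ)` (`Real.smoothTransition = Real.smoothTransition`, `0 < 2τ ≤ t - s`):
`0 ≤ ∫ χ'(r) (∫_{a(r)}^{b(r)} G₁(r,x) dx) dr + ∫ χ(r) (Φa(r) - Φb(r)) dr`.
[cite: ChenKrupaVasseur2022, §7 (integration of (3.1) on a cell), Lemma 4.2 (proof)] -/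
theorem cellIneq_mollified {G₁ G₂ : ℝ → ℝ → ℝ} {a b Φa Φb : ℝ → ℝ} {S T M : ℝ} (hS : 0 ≤ S)
    (hG₁ : Measurable (Function.uncurry G₁)) (hG₂ : Measurable (Function.uncurry G₂))
    (hGM : ∀ r x, S < r → |G₁ r x| ≤ M ∧ |G₂ r x| ≤ M)
    (ha : ContDiff ℝ (⊤ : ℕ∞) a) (hb : ContDiff ℝ (⊤ : ℕ∞) b) (hab : ∀ r ∈ Ioo S T, a r < b r)
    (hΦam : Measurable Φa) (hΦbm : Measurable Φb) (hΦM : ∀ r, |Φa r| ≤ M ∧ |Φb r| ≤ M)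
    (hΦa : Tendsto (fun k : ℕ => ∫⁻ r in Ioo S T,
        ‖(∫ y, (k : ℝ) * deriv Real.smoothTransition ((k : ℝ) * y)
            * (G₂ r (a r + y) - deriv a r * G₁ r (a r + y))) - Φa r‖ₑ) atTop (𝓝 0))
    (hΦb : Tendsto (fun k : ℕ => ∫⁻ r in Ioo S T,
        ‖(∫ y, (k : ℝ) * deriv Real.smoothTransition (-((k : ℝ) * y))
            * (G₂ r (b r + y) - deriv b r * G₁ r (b r + y))) - Φb r‖ₑ) atTop (𝓝 0))
    (hineq : ∀ φ : ℝ × ℝ → ℝ, ContDiff ℝ (⊤ : ℕ∞) φ → HasCompactSupport φ → (∀ p, 0 ≤ φ p) →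
      (∀ p ∈ tsupport φ, S < p.1 ∧ p.1 < T) →
      0 ≤ ∫ r in Ioi (0 : ℝ), ∫ x, (deriv (fun s => φ (s, x)) r * G₁ r x
        + deriv (fun y => φ (r, y)) x * G₂ r x))
    {s t τ : ℝ} (hSs : S < s) (hst : s < t) (htT : t < T) (hτ : 0 < τ) (hτ2 : 2 * τ ≤ t - s) :
    0 ≤ (∫ r, (τ⁻¹ * deriv Real.smoothTransition ((r - s) / τ)
            - τ⁻¹ * deriv Real.smoothTransition ((t - r) / τ)) * ∫ x in a r..b r, G₁ r x)
        + ∫ r, Real.smoothTransition ((r - s) / τ) * Real.smoothTransition ((t - r) / τ)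
            * (Φa r - Φb r) := by
  obtain ⟨D, hD1, hD⟩ := exists_one_le_bound_deriv_smoothTransition
  have hD0 : 0 ≤ D := zero_le_one.trans hD1
  have hM0 : 0 ≤ M := (abs_nonneg _).trans (hΦM 0).1
  have hΘ01 : ∀ z, 0 ≤ Real.smoothTransition z ∧ Real.smoothTransition z ≤ 1 :=
    fun z => ⟨Real.smoothTransition.nonneg z, Real.smoothTransition.le_one z⟩
  -- the curves
  have ha1 : ContDiff ℝ 1 a := ha.of_le (by exact_mod_cast le_top)
  have hb1 : ContDiff ℝ 1 b := hb.of_le (by exact_mod_cast le_top)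
  have had : ∀ r, HasDerivAt a (deriv a r) r := fun r =>
    ((ha1.differentiable one_ne_zero) r).hasDerivAt
  have hbd : ∀ r, HasDerivAt b (deriv b r) r := fun r =>
    ((hb1.differentiable one_ne_zero) r).hasDerivAt
  have hac : Continuous a := ha.continuous
  have hbc : Continuous b := hb.continuous
  have ha'c : Continuous (deriv a) := ha1.continuous_deriv le_rfl
  have hb'c : Continuous (deriv b) := hb1.continuous_deriv le_rfl
  have hIcc : Icc s t ⊆ Ioo S T := fun r hr => ⟨hSs.trans_le hr.1, hr.2.trans_lt htT⟩
  -- bounds on `[s,t]`: gap `m`, window `[A,B]`, speeds `L`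
  obtain ⟨m, hm0, hm⟩ : ∃ m > 0, ∀ r ∈ Icc s t, m ≤ b r - a r := by
    obtain ⟨r₀, hr₀, hmin⟩ := isCompact_Icc.exists_isMinOn (nonempty_Icc.2 hst.le)
      ((hbc.sub hac).continuousOn (s := Icc s t))
    exact ⟨b r₀ - a r₀, sub_pos.2 (hab r₀ (hIcc hr₀)), fun r hr => (isMinOn_iff.1 hmin) r hr⟩
  obtain ⟨A, hA⟩ : ∃ A, ∀ r ∈ Icc s t, A ≤ a r := by
    obtain ⟨A, hA⟩ := (isCompact_Icc (a := s) (b := t)).bddBelow_image hac.continuousOn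
    exact ⟨A, fun r hr => hA (mem_image_of_mem a hr)⟩
  obtain ⟨B, hB⟩ : ∃ B, ∀ r ∈ Icc s t, b r ≤ B := by
    obtain ⟨B, hB⟩ := (isCompact_Icc (a := s) (b := t)).bddAbove_image hbc.continuousOn
    exact ⟨B, fun r hr => hB (mem_image_of_mem b hr)⟩
  obtain ⟨L, hL0, hL⟩ : ∃ L, 0 ≤ L ∧ ∀ r ∈ Icc s t, |deriv a r| ≤ L ∧ |deriv b r| ≤ L := by
    obtain ⟨La, hLa⟩ := isCompact_Icc.exists_bound_of_continuousOn
      (ha'c.continuousOn (s := Icc s t))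
    obtain ⟨Lb, hLb⟩ := isCompact_Icc.exists_bound_of_continuousOn
      (hb'c.continuousOn (s := Icc s t))
    refine ⟨max (max La Lb) 0, le_max_right _ _, fun r hr => ⟨?_, ?_⟩⟩
    · exact ((Real.norm_eq_abs _).symm.le.trans (hLa r hr)).trans
        ((le_max_left _ _).trans (le_max_left _ _))
    · exact ((Real.norm_eq_abs _).symm.le.trans (hLb r hr)).trans
        ((le_max_right _ _).trans (le_max_left _ _))
  have hAB : A ≤ B := by
    have hs : s ∈ Icc s t := left_mem_Icc.2 hst.le
    linarith [hA s hs, hB s hs, hm s hs]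
  -- the time cutoff `χ` and its derivative `χ'`
  set χ : ℝ → ℝ := fun r => Real.smoothTransition ((r - s) / τ) * Real.smoothTransition ((t - r) / τ) with hχ
  set χ' : ℝ → ℝ := fun r => τ⁻¹ * deriv Real.smoothTransition ((r - s) / τ) - τ⁻¹ * deriv Real.smoothTransition ((t - r) / τ) with hχ'
  have hsepL : ∀ r, deriv Real.smoothTransition ((r - s) / τ) * Real.smoothTransition ((t - r) / τ) = deriv Real.smoothTransition ((r - s) / τ) := by
    intro r
    by_cases h : (r - s) / τ ∈ Ioo (0 : ℝ) 1
    · rw [Real.smoothTransition.one_of_one_le, mul_one]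
      have h2 : r - s < τ := (div_lt_one hτ).1 h.2
      rw [le_div_iff₀ hτ]
      linarith
    · rw [deriv_smoothTransition_eq_zero_of_not_mem h, zero_mul]
  have hsepR : ∀ r, Real.smoothTransition ((r - s) / τ) * deriv Real.smoothTransition ((t - r) / τ) = deriv Real.smoothTransition ((t - r) / τ) := by
    intro r
    by_cases h : (t - r) / τ ∈ Ioo (0 : ℝ) 1
    · rw [Real.smoothTransition.one_of_one_le, one_mul]
      have h2 : t - r < τ := (div_lt_one hτ).1 h.2
      rw [le_div_iff₀ hτ]
      linarith
    · rw [deriv_smoothTransition_eq_zero_of_not_mem h, mul_zero]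
  have hχd : ∀ r, HasDerivAt χ (χ' r) r := by
    intro r
    have h1 : HasDerivAt (fun r => Real.smoothTransition ((r - s) / τ)) (deriv Real.smoothTransition ((r - s) / τ) * τ⁻¹) r := by
      have hl : HasDerivAt (fun r => (r - s) / τ) τ⁻¹ r := by
        simpa [one_div] using ((hasDerivAt_id r).sub_const s).div_const τ
      exact (differentiable_smoothTransition ((r - s) / τ)).hasDerivAt.comp r hl
    have h2 : HasDerivAt (fun r => Real.smoothTransition ((t - r) / τ)) (deriv Real.smoothTransition ((t - r) / τ) * (-τ⁻¹)) r := by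
      have hl : HasDerivAt (fun r => (t - r) / τ) (-τ⁻¹) r := by
        simpa [one_div, neg_div] using ((hasDerivAt_id r).const_sub t).div_const τ
      exact (differentiable_smoothTransition ((t - r) / τ)).hasDerivAt.comp r hl
    refine (h1.mul h2).congr_deriv ?_
    calc deriv Real.smoothTransition ((r - s) / τ) * τ⁻¹ * Real.smoothTransition ((t - r) / τ) + Real.smoothTransition ((r - s) / τ) * (deriv Real.smoothTransition ((t - r) / τ) * -τ⁻¹)
        = τ⁻¹ * (deriv Real.smoothTransition ((r - s) / τ) * Real.smoothTransition ((t - r) / τ))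
            - τ⁻¹ * (Real.smoothTransition ((r - s) / τ) * deriv Real.smoothTransition ((t - r) / τ)) := by ring
      _ = χ' r := by rw [hsepL, hsepR]
  have hχ0 : ∀ r, r ∉ Ioo s t → χ r = 0 := by
    intro r hr
    rcases le_or_gt r s with h | h
    · have : Real.smoothTransition ((r - s) / τ) = 0 :=
        Real.smoothTransition.zero_of_nonpos (div_nonpos_of_nonpos_of_nonneg (by linarith) hτ.le)
      simp only [hχ, this, zero_mul]
    · have h' : t ≤ r := by
        by_contra h''
        exact hr ⟨h, not_le.1 h''⟩
      have : Real.smoothTransition ((t - r) / τ) = 0 :=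
        Real.smoothTransition.zero_of_nonpos (div_nonpos_of_nonpos_of_nonneg (by linarith) hτ.le)
      simp only [hχ, this, mul_zero]
  have hχ'0 : ∀ r, r ∉ Ioo s t → χ' r = 0 := by
    intro r hr
    have hK1 : deriv Real.smoothTransition ((r - s) / τ) = 0 := by
      refine deriv_smoothTransition_eq_zero_of_not_mem fun h => ?_
      rcases le_or_gt r s with h' | h'
      · have : (r - s) / τ ≤ 0 := div_nonpos_of_nonpos_of_nonneg (by linarith) hτ.le
        linarith [h.1]
      · have ht : t ≤ r := by
          by_contra h''
          exact hr ⟨h', not_le.1 h''⟩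
        have : 1 ≤ (r - s) / τ := by rw [le_div_iff₀ hτ]; linarith
        linarith [h.2]
    have hK2 : deriv Real.smoothTransition ((t - r) / τ) = 0 := by
      refine deriv_smoothTransition_eq_zero_of_not_mem fun h => ?_
      rcases le_or_gt r s with h' | h'
      · have : 1 ≤ (t - r) / τ := by rw [le_div_iff₀ hτ]; linarith
        linarith [h.2]
      · have ht : t ≤ r := by
          by_contra h''
          exact hr ⟨h', not_le.1 h''⟩
        have : (t - r) / τ ≤ 0 := div_nonpos_of_nonpos_of_nonneg (by linarith) hτ.le
        linarith [h.1]
    simp only [hχ', hK1, hK2, mul_zero, sub_zero]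
  have hχb : ∀ r, |χ r| ≤ 1 := by
    intro r
    rw [hχ, abs_mul, abs_of_nonneg (hΘ01 _).1, abs_of_nonneg (hΘ01 _).1]
    exact mul_le_one₀ (hΘ01 _).2 (hΘ01 _).1 (hΘ01 _).2
  have hχ'b : ∀ r, |χ' r| ≤ 2 * D / τ := by
    intro r
    have hτi : 0 ≤ τ⁻¹ := inv_nonneg.2 hτ.le
    calc |χ' r| ≤ |τ⁻¹ * deriv Real.smoothTransition ((r - s) / τ)| + |τ⁻¹ * deriv Real.smoothTransition ((t - r) / τ)| := abs_sub _ _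
      _ ≤ τ⁻¹ * D + τ⁻¹ * D := by
          rw [abs_mul, abs_mul, abs_of_nonneg hτi]
          exact add_le_add (mul_le_mul_of_nonneg_left (hD _) hτi)
            (mul_le_mul_of_nonneg_left (hD _) hτi)
      _ = 2 * D / τ := by ring
  have hχc : Continuous χ :=
    (Real.smoothTransition.continuous.comp ((continuous_id.sub continuous_const).div_const τ)).mul
      (Real.smoothTransition.continuous.comp ((continuous_const.sub continuous_id).div_const τ))
  have hχ'c : Continuous χ' :=
    (continuous_const.mul (((Real.smoothTransition.contDiff (n := 1)).continuous_deriv le_rfl).comp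
      ((continuous_id.sub continuous_const).div_const τ))).sub
      (continuous_const.mul (((Real.smoothTransition.contDiff (n := 1)).continuous_deriv le_rfl).comp
        ((continuous_const.sub continuous_id).div_const τ)))
  -- the space cutoff `ω_c(r,x) = Real.smoothTransition(c(x - a r)) Real.smoothTransition(c(b r - x))` and its derivatives
  have hωx : ∀ c r x : ℝ, HasDerivAt (fun x => Real.smoothTransition (c * (x - a r)) * Real.smoothTransition (c * (b r - x)))
      (c * (deriv Real.smoothTransition (c * (x - a r)) * Real.smoothTransition (c * (b r - x)))
        - c * (Real.smoothTransition (c * (x - a r)) * deriv Real.smoothTransition (c * (b r - x)))) x := by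
    intro c r x
    have h1 : HasDerivAt (fun x => Real.smoothTransition (c * (x - a r))) (deriv Real.smoothTransition (c * (x - a r)) * c) x := by
      have hl : HasDerivAt (fun x => c * (x - a r)) c x := by
        simpa using ((hasDerivAt_id x).sub_const (a r)).const_mul c
      exact (differentiable_smoothTransition (c * (x - a r))).hasDerivAt.comp x hl
    have h2 : HasDerivAt (fun x => Real.smoothTransition (c * (b r - x))) (deriv Real.smoothTransition (c * (b r - x)) * (-c)) x := by
      have hl : HasDerivAt (fun x => c * (b r - x)) (-c) x := by
        simpa using ((hasDerivAt_id x).const_sub (b r)).const_mul c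
      exact (differentiable_smoothTransition (c * (b r - x))).hasDerivAt.comp x hl
    exact (h1.mul h2).congr_deriv (by ring)
  have hωr : ∀ c r x : ℝ, HasDerivAt (fun r => Real.smoothTransition (c * (x - a r)) * Real.smoothTransition (c * (b r - x)))
      (-(c * deriv a r) * (deriv Real.smoothTransition (c * (x - a r)) * Real.smoothTransition (c * (b r - x)))
        + c * deriv b r * (Real.smoothTransition (c * (x - a r)) * deriv Real.smoothTransition (c * (b r - x)))) r := by
    intro c r x
    have h1 : HasDerivAt (fun r => Real.smoothTransition (c * (x - a r))) (deriv Real.smoothTransition (c * (x - a r)) * (-(c * deriv a r))) r := by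
      have hl : HasDerivAt (fun r => c * (x - a r)) (-(c * deriv a r)) r := by
        have := ((had r).const_sub x).const_mul c
        simpa [mul_neg] using this
      exact (differentiable_smoothTransition (c * (x - a r))).hasDerivAt.comp r hl
    have h2 : HasDerivAt (fun r => Real.smoothTransition (c * (b r - x))) (deriv Real.smoothTransition (c * (b r - x)) * (c * deriv b r)) r := by
      have hl : HasDerivAt (fun r => c * (b r - x)) (c * deriv b r) r := by
        simpa using ((hbd r).sub_const x).const_mul c
      exact (differentiable_smoothTransition (c * (b r - x))).hasDerivAt.comp r hl
    exact (h1.mul h2).congr_deriv (by ring)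
  have hsep1 : ∀ c : ℝ, 0 < c → 2 / c ≤ m → ∀ r ∈ Icc s t, ∀ x,
      deriv Real.smoothTransition (c * (x - a r)) * Real.smoothTransition (c * (b r - x)) = deriv Real.smoothTransition (c * (x - a r)) := by
    intro c hc hcm r hr x
    by_cases h : c * (x - a r) ∈ Ioo (0 : ℝ) 1
    · rw [Real.smoothTransition.one_of_one_le, mul_one]
      have h2 : x - a r < 1 / c := by
        rw [lt_div_iff₀ hc, mul_comm]; exact h.2
      have h3 : 2 / c = 1 / c + 1 / c := by ring
      have h4 : 1 / c ≤ b r - x := by linarith [hm r hr]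
      calc (1 : ℝ) = c * (1 / c) := by field_simp
        _ ≤ c * (b r - x) := mul_le_mul_of_nonneg_left h4 hc.le
    · rw [deriv_smoothTransition_eq_zero_of_not_mem h, zero_mul]
  have hsep2 : ∀ c : ℝ, 0 < c → 2 / c ≤ m → ∀ r ∈ Icc s t, ∀ x,
      Real.smoothTransition (c * (x - a r)) * deriv Real.smoothTransition (c * (b r - x)) = deriv Real.smoothTransition (c * (b r - x)) := by
    intro c hc hcm r hr x
    by_cases h : c * (b r - x) ∈ Ioo (0 : ℝ) 1
    · rw [Real.smoothTransition.one_of_one_le, one_mul]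
      have h2 : b r - x < 1 / c := by
        rw [lt_div_iff₀ hc, mul_comm]; exact h.2
      have h3 : 2 / c = 1 / c + 1 / c := by ring
      have h4 : 1 / c ≤ x - a r := by linarith [hm r hr]
      calc (1 : ℝ) = c * (1 / c) := by field_simp
        _ ≤ c * (x - a r) := mul_le_mul_of_nonneg_left h4 hc.le
    · rw [deriv_smoothTransition_eq_zero_of_not_mem h, mul_zero]
  have hω0 : ∀ c : ℝ, 0 ≤ c → ∀ r x, x ∉ Ioo (a r) (b r) →
      Real.smoothTransition (c * (x - a r)) * Real.smoothTransition (c * (b r - x)) = 0 := by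
    intro c hc r x hx
    rcases le_or_gt x (a r) with h | h
    · rw [Real.smoothTransition.zero_of_nonpos (mul_nonpos_of_nonneg_of_nonpos hc (by linarith)),
        zero_mul]
    · have h' : b r ≤ x := by
        by_contra h''
        exact hx ⟨h, not_le.1 h''⟩
      rw [Real.smoothTransition.zero_of_nonpos
        (mul_nonpos_of_nonneg_of_nonpos hc (by linarith : b r - x ≤ 0)), mul_zero]
  have hωb : ∀ c r x : ℝ, |Real.smoothTransition (c * (x - a r)) * Real.smoothTransition (c * (b r - x))| ≤ 1 := by
    intro c r x
    rw [abs_mul, abs_of_nonneg (hΘ01 _).1, abs_of_nonneg (hΘ01 _).1]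
    exact mul_le_one₀ (hΘ01 _).2 (hΘ01 _).1 (hΘ01 _).2
  have hG₁m : ∀ r, Measurable (G₁ r) := fun r => hG₁.of_uncurry_left
  have hG₂m : ∀ r, Measurable (G₂ r) := fun r => hG₂.of_uncurry_left
  -- measurability in `r` of the three parametric integrals
  have hJm : ∀ k : ℕ, AEStronglyMeasurable (fun r => ∫ x,
      Real.smoothTransition ((k : ℝ) * (x - a r)) * Real.smoothTransition ((k : ℝ) * (b r - x))
        * G₁ r x) volume := by
    intro k
    have hF : Measurable fun p : ℝ × ℝ =>
        Real.smoothTransition ((k : ℝ) * (p.2 - a p.1))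
          * Real.smoothTransition ((k : ℝ) * (b p.1 - p.2)) * G₁ p.1 p.2 :=
      ((Real.smoothTransition.continuous.measurable.comp
        (measurable_const.mul (measurable_snd.sub (hac.measurable.comp measurable_fst)))).mul
        (Real.smoothTransition.continuous.measurable.comp
          (measurable_const.mul ((hbc.measurable.comp measurable_fst).sub measurable_snd)))).mul hG₁
    exact (hF.stronglyMeasurable.integral_prod_right' (ν := volume)).aestronglyMeasurable
  have hApm : ∀ k : ℕ, StronglyMeasurable (fun r => ∫ y,
      (k : ℝ) * deriv Real.smoothTransition ((k : ℝ) * y)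
        * (G₂ r (a r + y) - deriv a r * G₁ r (a r + y))) := by
    intro k
    have hsh : Measurable fun p : ℝ × ℝ => (p.1, a p.1 + p.2) :=
      measurable_fst.prodMk ((hac.measurable.comp measurable_fst).add measurable_snd)
    have hF : Measurable fun p : ℝ × ℝ => (k : ℝ) * deriv Real.smoothTransition ((k : ℝ) * p.2)
        * (G₂ p.1 (a p.1 + p.2) - deriv a p.1 * G₁ p.1 (a p.1 + p.2)) :=
      (measurable_const.mul (((Real.smoothTransition.contDiff (n := 1)).continuous_deriv le_rfl).measurable.comp
        (measurable_const.mul measurable_snd))).mul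
        ((hG₂.comp hsh).sub ((ha'c.measurable.comp measurable_fst).mul (hG₁.comp hsh)))
    exact hF.stronglyMeasurable.integral_prod_right' (ν := volume)
  have hAmm : ∀ k : ℕ, StronglyMeasurable (fun r => ∫ y,
      (k : ℝ) * deriv Real.smoothTransition (-((k : ℝ) * y))
        * (G₂ r (b r + y) - deriv b r * G₁ r (b r + y))) := by
    intro k
    have hsh : Measurable fun p : ℝ × ℝ => (p.1, b p.1 + p.2) :=
      measurable_fst.prodMk ((hbc.measurable.comp measurable_fst).add measurable_snd)
    have hF : Measurable fun p : ℝ × ℝ => (k : ℝ) * deriv Real.smoothTransition (-((k : ℝ) * p.2))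
        * (G₂ p.1 (b p.1 + p.2) - deriv b p.1 * G₁ p.1 (b p.1 + p.2)) :=
      (measurable_const.mul (((Real.smoothTransition.contDiff (n := 1)).continuous_deriv le_rfl).measurable.comp
        (measurable_const.mul measurable_snd).neg)).mul
        ((hG₂.comp hsh).sub ((hb'c.measurable.comp measurable_fst).mul (hG₁.comp hsh)))
    exact hF.stronglyMeasurable.integral_prod_right' (ν := volume)
  -- bounds on `[s,t]`
  have hJb : ∀ k : ℕ, ∀ r ∈ Icc s t, ‖∫ x,
      Real.smoothTransition ((k : ℝ) * (x - a r)) * Real.smoothTransition ((k : ℝ) * (b r - x))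
        * G₁ r x‖ ≤ M * (B - A) := by
    intro k r hr
    have hrS : S < r := (hIcc hr).1
    have hg : Integrable ((Icc A B).indicator fun _ : ℝ => M) :=
      (continuous_const.integrableOn_Icc (a := A) (b := B)).integrable_indicator measurableSet_Icc
    refine (norm_integral_le_of_norm_le hg (ae_of_all _ fun x => ?_)).trans_eq ?_
    · by_cases hx : x ∈ Icc A B
      · rw [indicator_of_mem hx, Real.norm_eq_abs, abs_mul]
        calc |Real.smoothTransition ((k : ℝ) * (x - a r)) * Real.smoothTransition ((k : ℝ) * (b r - x))|
              * |G₁ r x| ≤ 1 * M :=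
            mul_le_mul (hωb k r x) (hGM r x hrS).1 (abs_nonneg _) zero_le_one
          _ = M := one_mul M
      · have hx' : x ∉ Ioo (a r) (b r) := fun h =>
          hx ⟨(hA r hr).trans h.1.le, h.2.le.trans (hB r hr)⟩
        rw [indicator_of_notMem hx, hω0 k (Nat.cast_nonneg k) r x hx', zero_mul, norm_zero]
    · rw [integral_indicator_const _ measurableSet_Icc, Real.volume_real_Icc_of_le hAB, smul_eq_mul,
        mul_comm]
  have hHb : ∀ r ∈ Icc s t, ∀ y, |G₂ r y - deriv a r * G₁ r y| ≤ M + L * M ∧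
      |G₂ r y - deriv b r * G₁ r y| ≤ M + L * M := by
    intro r hr y
    have hrS : S < r := (hIcc hr).1
    constructor
    · calc |G₂ r y - deriv a r * G₁ r y| ≤ |G₂ r y| + |deriv a r * G₁ r y| := abs_sub _ _
        _ ≤ M + L * M := by
          rw [abs_mul]
          exact add_le_add (hGM r y hrS).2
            (mul_le_mul (hL r hr).1 (hGM r y hrS).1 (abs_nonneg _) hL0)
    · calc |G₂ r y - deriv b r * G₁ r y| ≤ |G₂ r y| + |deriv b r * G₁ r y| := abs_sub _ _
        _ ≤ M + L * M := by
          rw [abs_mul]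
          exact add_le_add (hGM r y hrS).2
            (mul_le_mul (hL r hr).2 (hGM r y hrS).1 (abs_nonneg _) hL0)
  have hApb : ∀ k : ℕ, 1 ≤ k → ∀ r ∈ Icc s t, ‖∫ y,
      (k : ℝ) * deriv Real.smoothTransition ((k : ℝ) * y)
        * (G₂ r (a r + y) - deriv a r * G₁ r (a r + y))‖ ≤ D * (M + L * M) := by
    intro k hk r hr
    have hc : (0 : ℝ) < k := by exact_mod_cast hk
    have hg : Integrable ((Ioo (0 : ℝ) (1 / k)).indicator fun _ : ℝ => (k : ℝ) * D * (M + L * M)) :=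
      ((continuous_const.integrableOn_Icc (a := (0 : ℝ)) (b := 1 / k)).mono_set
        Ioo_subset_Icc_self).integrable_indicator measurableSet_Ioo
    refine (norm_integral_le_of_norm_le hg (ae_of_all _ fun y => ?_)).trans_eq ?_
    · by_cases hy : y ∈ Ioo (0 : ℝ) (1 / k)
      · rw [indicator_of_mem hy, Real.norm_eq_abs, abs_mul, abs_mul, abs_of_pos hc]
        refine mul_le_mul ?_ (hHb r hr _).1 (abs_nonneg _) (by positivity)
        exact mul_le_mul_of_nonneg_left (hD _) hc.le
      · rw [indicator_of_notMem hy, rightKernel_eq_zero hc hy, zero_mul, norm_zero]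
    · rw [integral_indicator_const _ measurableSet_Ioo, Real.volume_real_Ioo_of_le (by positivity),
        smul_eq_mul, sub_zero]
      field_simp
  have hAmb : ∀ k : ℕ, 1 ≤ k → ∀ r ∈ Icc s t, ‖∫ y,
      (k : ℝ) * deriv Real.smoothTransition (-((k : ℝ) * y))
        * (G₂ r (b r + y) - deriv b r * G₁ r (b r + y))‖ ≤ D * (M + L * M) := by
    intro k hk r hr
    have hc : (0 : ℝ) < k := by exact_mod_cast hk
    have hg : Integrable ((Ioo (-(1 / (k : ℝ))) (0 : ℝ)).indicator fun _ : ℝ => (k : ℝ) * D * (M + L * M)) :=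
      ((continuous_const.integrableOn_Icc (a := -(1 / (k : ℝ))) (b := 0)).mono_set
        Ioo_subset_Icc_self).integrable_indicator measurableSet_Ioo
    refine (norm_integral_le_of_norm_le hg (ae_of_all _ fun y => ?_)).trans_eq ?_
    · by_cases hy : y ∈ Ioo (-(1 / (k : ℝ))) (0 : ℝ)
      · rw [indicator_of_mem hy, Real.norm_eq_abs, abs_mul, abs_mul, abs_of_pos hc]
        refine mul_le_mul ?_ (hHb r hr _).2 (abs_nonneg _) (by positivity)
        exact mul_le_mul_of_nonneg_left (hD _) hc.le
      · rw [indicator_of_notMem hy, leftKernel_eq_zero hc hy, zero_mul, norm_zero]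
    · rw [integral_indicator_const _ measurableSet_Ioo, Real.volume_real_Ioo_of_le (by
        rw [neg_nonpos]; positivity),
        smul_eq_mul, sub_neg_eq_add, zero_add]
      field_simp
  -- integrability in `r` of the two outer integrands
  have hiJ : ∀ k : ℕ, Integrable fun r => χ' r * ∫ x,
      Real.smoothTransition ((k : ℝ) * (x - a r)) * Real.smoothTransition ((k : ℝ) * (b r - x))
        * G₁ r x := by
    intro k
    refine Integrable.mono' (g := (Icc s t).indicator fun _ => 2 * D / τ * (M * (B - A)))
      ((continuous_const.integrableOn_Icc (a := s) (b := t)).integrable_indicator measurableSet_Icc)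
      (hχ'c.aestronglyMeasurable.mul (hJm k)) (ae_of_all _ fun r => ?_)
    by_cases hr : r ∈ Icc s t
    · rw [indicator_of_mem hr, norm_mul, Real.norm_eq_abs]
      exact mul_le_mul (hχ'b r) (hJb k r hr) (norm_nonneg _) (by positivity)
    · rw [indicator_of_notMem hr, hχ'0 r fun h => hr (Ioo_subset_Icc_self h), zero_mul, norm_zero]
  have hiA : ∀ k : ℕ, 1 ≤ k → Integrable fun r => χ r * ((∫ y,
      (k : ℝ) * deriv Real.smoothTransition ((k : ℝ) * y)
        * (G₂ r (a r + y) - deriv a r * G₁ r (a r + y))) - ∫ y,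
      (k : ℝ) * deriv Real.smoothTransition (-((k : ℝ) * y))
        * (G₂ r (b r + y) - deriv b r * G₁ r (b r + y))) := by
    intro k hk
    refine Integrable.mono' (g := (Icc s t).indicator fun _ => 1 * (D * (M + L * M) + D * (M + L * M)))
      ((continuous_const.integrableOn_Icc (a := s) (b := t)).integrable_indicator measurableSet_Icc)
      (hχc.aestronglyMeasurable.mul
        ((hApm k).aestronglyMeasurable.sub (hAmm k).aestronglyMeasurable)) (ae_of_all _ fun r => ?_)
    by_cases hr : r ∈ Icc s t
    · rw [indicator_of_mem hr, norm_mul, Real.norm_eq_abs]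
      refine mul_le_mul (hχb r) ((norm_sub_le _ _).trans (add_le_add (hApb k hk r hr)
        (hAmb k hk r hr))) (norm_nonneg _) zero_le_one
    · rw [indicator_of_notMem hr, hχ0 r fun h => hr (Ioo_subset_Icc_self h), zero_mul, norm_zero]
  ------------------------------------------------------------------
  -- the inequality for each admissible `k`
  ------------------------------------------------------------------
  have hWk : ∀ k : ℕ, 1 ≤ k → 2 / (k : ℝ) ≤ m →
      0 ≤ (∫ r, χ' r * ∫ x, Real.smoothTransition ((k : ℝ) * (x - a r))
              * Real.smoothTransition ((k : ℝ) * (b r - x)) * G₁ r x)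
        + ∫ r, χ r * ((∫ y, (k : ℝ) * deriv Real.smoothTransition ((k : ℝ) * y)
              * (G₂ r (a r + y) - deriv a r * G₁ r (a r + y)))
            - ∫ y, (k : ℝ) * deriv Real.smoothTransition (-((k : ℝ) * y))
              * (G₂ r (b r + y) - deriv b r * G₁ r (b r + y))) := by
    intro k hk hkm
    have hc : (0 : ℝ) < k := by exact_mod_cast hk
    -- the test function
    set φ : ℝ × ℝ → ℝ := fun p => χ p.1 * (Real.smoothTransition ((k : ℝ) * (p.2 - a p.1))
      * Real.smoothTransition ((k : ℝ) * (b p.1 - p.2))) with hφ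
    have hφs : ContDiff ℝ (⊤ : ℕ∞) φ := by
      have h1 : ContDiff ℝ (⊤ : ℕ∞) fun p : ℝ × ℝ => (p.1 - s) / τ :=
        (contDiff_fst.sub contDiff_const).div_const τ
      have h2 : ContDiff ℝ (⊤ : ℕ∞) fun p : ℝ × ℝ => (t - p.1) / τ :=
        (contDiff_const.sub contDiff_fst).div_const τ
      have h3 : ContDiff ℝ (⊤ : ℕ∞) fun p : ℝ × ℝ => (k : ℝ) * (p.2 - a p.1) :=
        contDiff_const.mul (contDiff_snd.sub (ha.comp contDiff_fst))
      have h4 : ContDiff ℝ (⊤ : ℕ∞) fun p : ℝ × ℝ => (k : ℝ) * (b p.1 - p.2) :=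
        contDiff_const.mul ((hb.comp contDiff_fst).sub contDiff_snd)
      exact ((Real.smoothTransition.contDiff.comp h1).mul
        (Real.smoothTransition.contDiff.comp h2)).mul
        ((Real.smoothTransition.contDiff.comp h3).mul (Real.smoothTransition.contDiff.comp h4))
    have hφK : ∀ p : ℝ × ℝ, p ∉ Icc s t ×ˢ Icc A B → φ p = 0 := by
      intro p hp
      by_cases hr : p.1 ∈ Ioo s t
      · have hr' : p.1 ∈ Icc s t := Ioo_subset_Icc_self hr
        have hx : p.2 ∉ Ioo (a p.1) (b p.1) := fun hx =>
          hp ⟨hr', ⟨(hA _ hr').trans hx.1.le, hx.2.le.trans (hB _ hr')⟩⟩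
        simp only [hφ, hω0 k hc.le p.1 p.2 hx, mul_zero]
      · simp only [hφ, hχ0 p.1 hr, zero_mul]
    have hφcs : HasCompactSupport φ :=
      HasCompactSupport.intro (isCompact_Icc.prod isCompact_Icc) hφK
    have hφ0 : ∀ p, 0 ≤ φ p := fun p =>
      mul_nonneg (mul_nonneg (hΘ01 _).1 (hΘ01 _).1) (mul_nonneg (hΘ01 _).1 (hΘ01 _).1)
    have hφts : ∀ p ∈ tsupport φ, S < p.1 ∧ p.1 < T := by
      intro p hp
      have hsub : tsupport φ ⊆ Icc s t ×ˢ Icc A B :=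
        closure_minimal (fun q hq => by_contra fun h => hq (hφK q h))
          (isClosed_Icc.prod isClosed_Icc)
      have := hsub hp
      exact ⟨hSs.trans_le this.1.1, this.1.2.trans_lt htT⟩
    have h0 := hineq φ hφs hφcs hφ0 hφts
    -- the slice derivatives
    have hdr : ∀ r x, deriv (fun s' => φ (s', x)) r
        = χ' r * (Real.smoothTransition ((k : ℝ) * (x - a r))
            * Real.smoothTransition ((k : ℝ) * (b r - x)))
          + χ r * (-((k : ℝ) * deriv a r) * (deriv Real.smoothTransition ((k : ℝ) * (x - a r))
              * Real.smoothTransition ((k : ℝ) * (b r - x)))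
            + (k : ℝ) * deriv b r * (Real.smoothTransition ((k : ℝ) * (x - a r))
              * deriv Real.smoothTransition ((k : ℝ) * (b r - x)))) :=
      fun r x => ((hχd r).mul (hωr k r x)).deriv
    have hdx : ∀ r x, deriv (fun y => φ (r, y)) x
        = χ r * ((k : ℝ) * (deriv Real.smoothTransition ((k : ℝ) * (x - a r))
              * Real.smoothTransition ((k : ℝ) * (b r - x)))
            - (k : ℝ) * (Real.smoothTransition ((k : ℝ) * (x - a r))
              * deriv Real.smoothTransition ((k : ℝ) * (b r - x)))) :=
      fun r x => ((hωx k r x).const_mul (χ r)).deriv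
    -- pointwise form of the weak integrand
    have hWV : ∀ r x, deriv (fun s' => φ (s', x)) r * G₁ r x + deriv (fun y => φ (r, y)) x * G₂ r x
        = χ' r * (Real.smoothTransition ((k : ℝ) * (x - a r))
            * Real.smoothTransition ((k : ℝ) * (b r - x)) * G₁ r x)
          + χ r * ((k : ℝ) * deriv Real.smoothTransition ((k : ℝ) * (x - a r))
              * (G₂ r x - deriv a r * G₁ r x)
            - (k : ℝ) * deriv Real.smoothTransition ((k : ℝ) * (b r - x))
              * (G₂ r x - deriv b r * G₁ r x)) := by
      intro r x
      rw [hdr, hdx]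
      by_cases hr : r ∈ Icc s t
      · rw [hsep1 k hc hkm r hr x, hsep2 k hc hkm r hr x]
        ring
      · rw [hχ0 r fun h => hr (Ioo_subset_Icc_self h), hχ'0 r fun h => hr (Ioo_subset_Icc_self h)]
        ring
    simp_rw [hWV] at h0
    -- from `(0,∞)` to `ℝ`
    have hV0 : ∀ r, r ∉ Ioo s t → ∀ x,
        χ' r * (Real.smoothTransition ((k : ℝ) * (x - a r))
            * Real.smoothTransition ((k : ℝ) * (b r - x)) * G₁ r x)
          + χ r * ((k : ℝ) * deriv Real.smoothTransition ((k : ℝ) * (x - a r))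
              * (G₂ r x - deriv a r * G₁ r x)
            - (k : ℝ) * deriv Real.smoothTransition ((k : ℝ) * (b r - x))
              * (G₂ r x - deriv b r * G₁ r x)) = 0 := by
      intro r hr x
      rw [hχ0 r hr, hχ'0 r hr]
      ring
    rw [setIntegral_eq_integral_of_forall_compl_eq_zero] at h0
    swap
    · intro r hr
      have hr' : r ∉ Ioo s t := fun h => hr (mem_Ioi.2 (hS.trans_lt (hSs.trans h.1)))
      simp only [hV0 r hr', integral_zero]
    -- integrability in `x`, for `S < r`
    have hi1 : ∀ r, S < r → Integrable fun x =>
        Real.smoothTransition ((k : ℝ) * (x - a r)) * Real.smoothTransition ((k : ℝ) * (b r - x))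
          * G₁ r x := by
      intro r hr
      have hcont : Continuous fun x =>
          Real.smoothTransition ((k : ℝ) * (x - a r)) * Real.smoothTransition ((k : ℝ) * (b r - x)) :=
        (Real.smoothTransition.continuous.comp
          (continuous_const.mul (continuous_id.sub continuous_const))).mul
          (Real.smoothTransition.continuous.comp
            (continuous_const.mul (continuous_const.sub continuous_id)))
      have hsupp : HasCompactSupport fun x =>
          Real.smoothTransition ((k : ℝ) * (x - a r)) * Real.smoothTransition ((k : ℝ) * (b r - x)) :=
        HasCompactSupport.intro isCompact_Icc fun x hx =>
          hω0 k hc.le r x fun h => hx (Ioo_subset_Icc_self h)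
      exact (hcont.integrable_of_hasCompactSupport hsupp).mul_bdd (hG₁m r).aestronglyMeasurable
        (ae_of_all _ fun x => by rw [Real.norm_eq_abs]; exact (hGM r x hr).1)
    have hi2 : ∀ r, S < r → Integrable fun x =>
        (k : ℝ) * deriv Real.smoothTransition ((k : ℝ) * (x - a r))
          * (G₂ r x - deriv a r * G₁ r x) := by
      intro r hr
      have hcont : Continuous fun x => (k : ℝ) * deriv Real.smoothTransition ((k : ℝ) * (x - a r)) :=
        continuous_const.mul (((Real.smoothTransition.contDiff (n := 1)).continuous_deriv le_rfl).comp
          (continuous_const.mul (continuous_id.sub continuous_const)))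
      have hsupp : HasCompactSupport fun x =>
          (k : ℝ) * deriv Real.smoothTransition ((k : ℝ) * (x - a r)) := by
        refine HasCompactSupport.intro (isCompact_Icc (a := a r) (b := a r + 1 / k)) fun x hx => ?_
        have : x - a r ∉ Ioo (0 : ℝ) (1 / k) := fun h => hx ⟨by linarith [h.1], by linarith [h.2]⟩
        exact rightKernel_eq_zero hc this
      refine (hcont.integrable_of_hasCompactSupport hsupp).mul_bdd (c := M + |deriv a r| * M)
        ((hG₂m r).sub ((hG₁m r).const_mul _)).aestronglyMeasurable
        (ae_of_all _ fun x => ?_)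
      rw [Real.norm_eq_abs]
      calc |G₂ r x - deriv a r * G₁ r x| ≤ |G₂ r x| + |deriv a r * G₁ r x| := abs_sub _ _
        _ ≤ M + |deriv a r| * M := by
          rw [abs_mul]
          exact add_le_add (hGM r x hr).2 (mul_le_mul_of_nonneg_left (hGM r x hr).1 (abs_nonneg _))
    have hi3 : ∀ r, S < r → Integrable fun x =>
        (k : ℝ) * deriv Real.smoothTransition ((k : ℝ) * (b r - x))
          * (G₂ r x - deriv b r * G₁ r x) := by
      intro r hr
      have hcont : Continuous fun x => (k : ℝ) * deriv Real.smoothTransition ((k : ℝ) * (b r - x)) :=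
        continuous_const.mul (((Real.smoothTransition.contDiff (n := 1)).continuous_deriv le_rfl).comp
          (continuous_const.mul (continuous_const.sub continuous_id)))
      have hsupp : HasCompactSupport fun x =>
          (k : ℝ) * deriv Real.smoothTransition ((k : ℝ) * (b r - x)) := by
        refine HasCompactSupport.intro (isCompact_Icc (a := b r - 1 / k) (b := b r)) fun x hx => ?_
        rw [deriv_smoothTransition_eq_zero_of_not_mem, mul_zero]
        rintro ⟨h1, h2⟩
        refine hx ⟨?_, ?_⟩
        · have : b r - x < 1 / k := by rw [lt_div_iff₀ hc, mul_comm]; exact h2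
          linarith
        · nlinarith
      refine (hcont.integrable_of_hasCompactSupport hsupp).mul_bdd (c := M + |deriv b r| * M)
        ((hG₂m r).sub ((hG₁m r).const_mul _)).aestronglyMeasurable
        (ae_of_all _ fun x => ?_)
      rw [Real.norm_eq_abs]
      calc |G₂ r x - deriv b r * G₁ r x| ≤ |G₂ r x| + |deriv b r * G₁ r x| := abs_sub _ _
        _ ≤ M + |deriv b r| * M := by
          rw [abs_mul]
          exact add_le_add (hGM r x hr).2 (mul_le_mul_of_nonneg_left (hGM r x hr).1 (abs_nonneg _))
    -- translations to the kernel form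
    have ht2 : ∀ r, ∫ x, (k : ℝ) * deriv Real.smoothTransition ((k : ℝ) * (x - a r))
          * (G₂ r x - deriv a r * G₁ r x)
        = ∫ y, (k : ℝ) * deriv Real.smoothTransition ((k : ℝ) * y)
          * (G₂ r (a r + y) - deriv a r * G₁ r (a r + y)) := by
      intro r
      have := integral_add_left_eq_self (μ := (volume : Measure ℝ))
        (fun x => (k : ℝ) * deriv Real.smoothTransition ((k : ℝ) * (x - a r))
          * (G₂ r x - deriv a r * G₁ r x)) (a r)
      rw [← this]
      simp only [add_sub_cancel_left]
    have ht3 : ∀ r, ∫ x, (k : ℝ) * deriv Real.smoothTransition ((k : ℝ) * (b r - x))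
          * (G₂ r x - deriv b r * G₁ r x)
        = ∫ y, (k : ℝ) * deriv Real.smoothTransition (-((k : ℝ) * y))
          * (G₂ r (b r + y) - deriv b r * G₁ r (b r + y)) := by
      intro r
      have := integral_add_left_eq_self (μ := (volume : Measure ℝ))
        (fun x => (k : ℝ) * deriv Real.smoothTransition ((k : ℝ) * (b r - x))
          * (G₂ r x - deriv b r * G₁ r x)) (b r)
      rw [← this]
      have e : ∀ y : ℝ, (k : ℝ) * (b r - (b r + y)) = -((k : ℝ) * y) := fun y => by ring
      simp only [e]
    -- the inner integrals
    have hinner : ∀ r, (∫ x, (χ' r * (Real.smoothTransition ((k : ℝ) * (x - a r))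
            * Real.smoothTransition ((k : ℝ) * (b r - x)) * G₁ r x)
          + χ r * ((k : ℝ) * deriv Real.smoothTransition ((k : ℝ) * (x - a r))
              * (G₂ r x - deriv a r * G₁ r x)
            - (k : ℝ) * deriv Real.smoothTransition ((k : ℝ) * (b r - x))
              * (G₂ r x - deriv b r * G₁ r x))))
        = χ' r * (∫ x, Real.smoothTransition ((k : ℝ) * (x - a r))
            * Real.smoothTransition ((k : ℝ) * (b r - x)) * G₁ r x)
          + χ r * ((∫ y, (k : ℝ) * deriv Real.smoothTransition ((k : ℝ) * y)
              * (G₂ r (a r + y) - deriv a r * G₁ r (a r + y)))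
            - ∫ y, (k : ℝ) * deriv Real.smoothTransition (-((k : ℝ) * y))
              * (G₂ r (b r + y) - deriv b r * G₁ r (b r + y))) := by
      intro r
      by_cases hr : r ∈ Ioo s t
      · have hrS : S < r := hSs.trans hr.1
        have iA : Integrable fun x => χ' r * (Real.smoothTransition ((k : ℝ) * (x - a r))
            * Real.smoothTransition ((k : ℝ) * (b r - x)) * G₁ r x) := (hi1 r hrS).const_mul _
        have iB : Integrable fun x => χ r * ((k : ℝ) * deriv Real.smoothTransition ((k : ℝ) * (x - a r))
              * (G₂ r x - deriv a r * G₁ r x)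
            - (k : ℝ) * deriv Real.smoothTransition ((k : ℝ) * (b r - x))
              * (G₂ r x - deriv b r * G₁ r x)) := ((hi2 r hrS).sub (hi3 r hrS)).const_mul _
        rw [integral_add iA iB, integral_const_mul, integral_const_mul,
          integral_sub (hi2 r hrS) (hi3 r hrS), ht2, ht3]
      · rw [hχ0 r hr, hχ'0 r hr]
        simp
    simp_rw [hinner] at h0
    rwa [integral_add (hiJ k) (hiA k hk)] at h0
  ------------------------------------------------------------------
  -- admissible `k` are eventually all
  ------------------------------------------------------------------
  have hev : ∀ᶠ k : ℕ in atTop, 1 ≤ k ∧ 2 / (k : ℝ) ≤ m := by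
    obtain ⟨n, hn⟩ := exists_nat_gt (2 / m)
    filter_upwards [eventually_ge_atTop (max n 1)] with k hk
    have hk1 : 1 ≤ k := (le_max_right n 1).trans hk
    have hkpos : (0 : ℝ) < k := by exact_mod_cast hk1
    have hnk : (n : ℝ) ≤ k := by exact_mod_cast (le_max_left n 1).trans hk
    refine ⟨hk1, ?_⟩
    rw [div_le_iff₀ hkpos]
    have h2 : 2 < (n : ℝ) * m := (div_lt_iff₀ hm0).1 hn
    nlinarith
  ------------------------------------------------------------------
  -- limit of the cutoff term
  ------------------------------------------------------------------
  have hJlim : Tendsto (fun k : ℕ => ∫ r, χ' r * ∫ x,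
      Real.smoothTransition ((k : ℝ) * (x - a r)) * Real.smoothTransition ((k : ℝ) * (b r - x))
        * G₁ r x) atTop (𝓝 (∫ r, χ' r * ∫ x in a r..b r, G₁ r x)) := by
    have hin : ∀ r ∈ Ioo s t, Tendsto (fun k : ℕ => ∫ x,
        Real.smoothTransition ((k : ℝ) * (x - a r)) * Real.smoothTransition ((k : ℝ) * (b r - x))
          * G₁ r x) atTop (𝓝 (∫ x in a r..b r, G₁ r x)) := by
      intro r hr
      have hrS : S < r := (hIcc (Ioo_subset_Icc_self hr)).1
      have hab' : a r < b r := hab r (hIcc (Ioo_subset_Icc_self hr))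
      rw [intervalIntegral.integral_of_le hab'.le, integral_Ioc_eq_integral_Ioo,
        ← integral_indicator measurableSet_Ioo]
      refine tendsto_integral_of_dominated_convergence ((Ioo (a r) (b r)).indicator fun _ => M)
        ?_ ?_ ?_ ?_
      · intro k
        exact (((Real.smoothTransition.continuous.comp (continuous_const.mul
          (continuous_id.sub continuous_const))).mul (Real.smoothTransition.continuous.comp
          (continuous_const.mul (continuous_const.sub continuous_id)))).aestronglyMeasurable).mul
          (hG₁m r).aestronglyMeasurable
      · exact ((continuous_const.integrableOn_Icc (a := a r) (b := b r)).mono_set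
          Ioo_subset_Icc_self).integrable_indicator measurableSet_Ioo
      · intro k
        refine ae_of_all _ fun x => ?_
        by_cases hx : x ∈ Ioo (a r) (b r)
        · rw [indicator_of_mem hx, Real.norm_eq_abs, abs_mul]
          calc |Real.smoothTransition ((k : ℝ) * (x - a r)) * Real.smoothTransition ((k : ℝ) * (b r - x))|
                * |G₁ r x| ≤ 1 * M :=
              mul_le_mul (hωb k r x) (hGM r x hrS).1 (abs_nonneg _) zero_le_one
            _ = M := one_mul M
        · rw [indicator_of_notMem hx, hω0 k (Nat.cast_nonneg k) r x hx, zero_mul, norm_zero]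
      · refine ae_of_all _ fun x => ?_
        by_cases hx : x ∈ Ioo (a r) (b r)
        · rw [indicator_of_mem hx]
          refine tendsto_const_nhds.congr' ?_
          obtain ⟨N, hN⟩ := exists_nat_gt (max (1 / (x - a r)) (1 / (b r - x)))
          filter_upwards [eventually_ge_atTop N] with k hk
          have hk' : (N : ℝ) ≤ k := by exact_mod_cast hk
          have hxa : 0 < x - a r := sub_pos.2 hx.1
          have hxb : 0 < b r - x := sub_pos.2 hx.2
          have h1 : 1 ≤ (k : ℝ) * (x - a r) := by
            have : 1 / (x - a r) ≤ k := ((le_max_left _ _).trans hN.le).trans hk'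
            rwa [div_le_iff₀ hxa] at this
          have h2 : 1 ≤ (k : ℝ) * (b r - x) := by
            have : 1 / (b r - x) ≤ k := ((le_max_right _ _).trans hN.le).trans hk'
            rwa [div_le_iff₀ hxb] at this
          rw [Real.smoothTransition.one_of_one_le h1, Real.smoothTransition.one_of_one_le h2]
          ring
        · rw [indicator_of_notMem hx]
          have : ∀ k : ℕ, Real.smoothTransition ((k : ℝ) * (x - a r))
              * Real.smoothTransition ((k : ℝ) * (b r - x)) * G₁ r x = 0 := fun k => by
            rw [hω0 k (Nat.cast_nonneg k) r x hx, zero_mul]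
          simp only [this]
          exact tendsto_const_nhds
    refine tendsto_integral_filter_of_dominated_convergence
      ((Icc s t).indicator fun _ => 2 * D / τ * (M * (B - A))) ?_ ?_ ?_ ?_
    · exact Eventually.of_forall fun k => hχ'c.aestronglyMeasurable.mul (hJm k)
    · refine Eventually.of_forall fun k => ae_of_all _ fun r => ?_
      by_cases hr : r ∈ Icc s t
      · rw [indicator_of_mem hr, norm_mul, Real.norm_eq_abs]
        exact mul_le_mul (hχ'b r) (hJb k r hr) (norm_nonneg _) (by positivity)
      · rw [indicator_of_notMem hr, hχ'0 r fun h => hr (Ioo_subset_Icc_self h), zero_mul, norm_zero]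
    · exact (continuous_const.integrableOn_Icc (a := s) (b := t)).integrable_indicator
        measurableSet_Icc
    · refine ae_of_all _ fun r => ?_
      by_cases hr : r ∈ Ioo s t
      · exact (hin r hr).const_mul (χ' r)
      · simp only [hχ'0 r hr, zero_mul]
        exact tendsto_const_nhds
  ------------------------------------------------------------------
  -- limit of the trace term
  ------------------------------------------------------------------
  have hiΦ : Integrable fun r => χ r * (Φa r - Φb r) := by
    refine Integrable.mono' (g := (Icc s t).indicator fun _ => 1 * (M + M))
      ((continuous_const.integrableOn_Icc (a := s) (b := t)).integrable_indicator measurableSet_Icc)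
      (hχc.aestronglyMeasurable.mul (hΦam.sub hΦbm).aestronglyMeasurable) (ae_of_all _ fun r => ?_)
    by_cases hr : r ∈ Icc s t
    · rw [indicator_of_mem hr, norm_mul, Real.norm_eq_abs, Real.norm_eq_abs]
      exact mul_le_mul (hχb r) ((abs_sub _ _).trans (add_le_add (hΦM r).1 (hΦM r).2))
        (abs_nonneg _) zero_le_one
    · rw [indicator_of_notMem hr, hχ0 r fun h => hr (Ioo_subset_Icc_self h), zero_mul, norm_zero]
  have hAlim : Tendsto (fun k : ℕ => ∫ r, χ r * ((∫ y,
      (k : ℝ) * deriv Real.smoothTransition ((k : ℝ) * y)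
        * (G₂ r (a r + y) - deriv a r * G₁ r (a r + y))) - ∫ y,
      (k : ℝ) * deriv Real.smoothTransition (-((k : ℝ) * y))
        * (G₂ r (b r + y) - deriv b r * G₁ r (b r + y)))) atTop
      (𝓝 (∫ r, χ r * (Φa r - Φb r))) := by
    have hdiff : ∀ᶠ k : ℕ in atTop, ‖(∫ r, χ r * ((∫ y,
        (k : ℝ) * deriv Real.smoothTransition ((k : ℝ) * y)
          * (G₂ r (a r + y) - deriv a r * G₁ r (a r + y))) - ∫ y,
        (k : ℝ) * deriv Real.smoothTransition (-((k : ℝ) * y))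
          * (G₂ r (b r + y) - deriv b r * G₁ r (b r + y)))) - ∫ r, χ r * (Φa r - Φb r)‖ₑ
        ≤ (∫⁻ r in Ioo S T, ‖(∫ y, (k : ℝ) * deriv Real.smoothTransition ((k : ℝ) * y)
            * (G₂ r (a r + y) - deriv a r * G₁ r (a r + y))) - Φa r‖ₑ)
          + ∫⁻ r in Ioo S T, ‖(∫ y, (k : ℝ) * deriv Real.smoothTransition (-((k : ℝ) * y))
            * (G₂ r (b r + y) - deriv b r * G₁ r (b r + y))) - Φb r‖ₑ := by
      filter_upwards [hev] with k hk
      rw [← integral_sub (hiA k hk.1) hiΦ]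
      refine (enorm_integral_le_lintegral_enorm _).trans ?_
      have hmeas : AEMeasurable (fun r => ‖(∫ y, (k : ℝ) * deriv Real.smoothTransition ((k : ℝ) * y)
          * (G₂ r (a r + y) - deriv a r * G₁ r (a r + y))) - Φa r‖ₑ)
          (volume.restrict (Ioo S T)) :=
        (((hApm k).measurable.sub hΦam).enorm).aemeasurable
      rw [← lintegral_add_left' hmeas, ← lintegral_indicator measurableSet_Ioo]
      refine lintegral_mono fun r => ?_
      by_cases hr : r ∈ Ioo s t
      · rw [indicator_of_mem (hIcc (Ioo_subset_Icc_self hr)), ← mul_sub, enorm_mul,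
          Real.enorm_eq_ofReal_abs, Real.enorm_eq_ofReal_abs, Real.enorm_eq_ofReal_abs,
          Real.enorm_eq_ofReal_abs, ← ENNReal.ofReal_add (abs_nonneg _) (abs_nonneg _),
          ← ENNReal.ofReal_mul (abs_nonneg _)]
        refine ENNReal.ofReal_le_ofReal ?_
        calc |χ r| * |((∫ y, (k : ℝ) * deriv Real.smoothTransition ((k : ℝ) * y)
                * (G₂ r (a r + y) - deriv a r * G₁ r (a r + y))) - ∫ y,
                (k : ℝ) * deriv Real.smoothTransition (-((k : ℝ) * y))
                  * (G₂ r (b r + y) - deriv b r * G₁ r (b r + y))) - (Φa r - Φb r)|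
            ≤ 1 * |((∫ y, (k : ℝ) * deriv Real.smoothTransition ((k : ℝ) * y)
                * (G₂ r (a r + y) - deriv a r * G₁ r (a r + y))) - ∫ y,
                (k : ℝ) * deriv Real.smoothTransition (-((k : ℝ) * y))
                  * (G₂ r (b r + y) - deriv b r * G₁ r (b r + y))) - (Φa r - Φb r)| :=
              mul_le_mul_of_nonneg_right (hχb r) (abs_nonneg _)
          _ ≤ _ := by
              rw [one_mul]
              have e : ∀ p q u v : ℝ, (p - q) - (u - v) = (p - u) - (q - v) := fun p q u v => by ring
              rw [e]
              exact abs_sub _ _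
      · rw [hχ0 r hr, zero_mul, zero_mul, sub_zero, enorm_zero]
        exact zero_le
    have hlim0 := hΦa.add hΦb
    rw [add_zero] at hlim0
    have hE := tendsto_of_tendsto_of_tendsto_of_le_of_le' tendsto_const_nhds hlim0
      (Eventually.of_forall fun k => zero_le) hdiff
    have h2 := (ENNReal.tendsto_toReal ENNReal.zero_ne_top).comp hE
    rw [ENNReal.toReal_zero] at h2
    refine tendsto_iff_norm_sub_tendsto_zero.2 (h2.congr fun k => ?_)
    simp only [Function.comp_apply, toReal_enorm]
  ------------------------------------------------------------------
  -- conclusion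
  ------------------------------------------------------------------
  refine ge_of_tendsto (hJlim.add hAlim) ?_
  filter_upwards [hev] with k hk
  exact hWk k hk.1 hk.2


/-- **Cell inequality between smooth curves, from kernel traces.** Under the hypotheses of
`cellIneq_mollified`, off a Lebesgue-null set of times the cell functional
`I(r) = ∫_{a(r)}^{b(r)} G₁(r,x) dx` satisfies, for `S < s < t < T`,
`I(t) ≤ I(s) + ∫_s^t (Φa(r) - Φb(r)) dr` — the integrated form of
`d/dt ∫_{a}^{b} G₁ dx ≤ [G₂ - a' G₁](a+) - [G₂ - b' G₁](b-)` ("integrating (3.1) on `Q` and using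
the strong trace property", §7; Lemma 4.2). The exceptional set consists of the non-Lebesgue points
of `I`; the time cutoffs of `cellIneq_mollified` are removed by the Lebesgue differentiation
theorem. [cite: ChenKrupaVasseur2022, §7 (integration of (3.1) on a cell), Lemma 4.2 (proof)] -/
theorem cellIneq_of_kernelTraces {G₁ G₂ : ℝ → ℝ → ℝ} {a b Φa Φb : ℝ → ℝ} {S T M : ℝ}
    (hS : 0 ≤ S)
    (hG₁ : Measurable (Function.uncurry G₁)) (hG₂ : Measurable (Function.uncurry G₂))
    (hGM : ∀ r x, S < r → |G₁ r x| ≤ M ∧ |G₂ r x| ≤ M)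
    (ha : ContDiff ℝ (⊤ : ℕ∞) a) (hb : ContDiff ℝ (⊤ : ℕ∞) b) (hab : ∀ r ∈ Ioo S T, a r < b r)
    (hΦam : Measurable Φa) (hΦbm : Measurable Φb) (hΦM : ∀ r, |Φa r| ≤ M ∧ |Φb r| ≤ M)
    (hΦa : Tendsto (fun k : ℕ => ∫⁻ r in Ioo S T,
        ‖(∫ y, (k : ℝ) * deriv Real.smoothTransition ((k : ℝ) * y)
            * (G₂ r (a r + y) - deriv a r * G₁ r (a r + y))) - Φa r‖ₑ) atTop (𝓝 0))
    (hΦb : Tendsto (fun k : ℕ => ∫⁻ r in Ioo S T,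
        ‖(∫ y, (k : ℝ) * deriv Real.smoothTransition (-((k : ℝ) * y))
            * (G₂ r (b r + y) - deriv b r * G₁ r (b r + y))) - Φb r‖ₑ) atTop (𝓝 0))
    (hineq : ∀ φ : ℝ × ℝ → ℝ, ContDiff ℝ (⊤ : ℕ∞) φ → HasCompactSupport φ → (∀ p, 0 ≤ φ p) →
      (∀ p ∈ tsupport φ, S < p.1 ∧ p.1 < T) →
      0 ≤ ∫ r in Ioi (0 : ℝ), ∫ x, (deriv (fun s => φ (s, x)) r * G₁ r x
        + deriv (fun y => φ (r, y)) x * G₂ r x)) :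
    ∃ N : Set ℝ, volume N = 0 ∧ ∀ s t, S < s → s < t → t < T → s ∉ N → t ∉ N →
      ∫ x in a t..b t, G₁ t x ≤ (∫ x in a s..b s, G₁ s x) + ∫ r in s..t, (Φa r - Φb r) := by
  rcases le_or_gt T S with hTS | hST
  · exact ⟨∅, measure_empty, fun s t hSs hst htT _ _ => by linarith⟩
  obtain ⟨D, hD1, hD⟩ := exists_one_le_bound_deriv_smoothTransition
  have hD0 : 0 ≤ D := zero_le_one.trans hD1
  have hM0 : 0 ≤ M := (abs_nonneg _).trans (hΦM 0).1
  have hac : Continuous a := ha.continuous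
  have hbc : Continuous b := hb.continuous
  have hΘ01 : ∀ z, 0 ≤ Real.smoothTransition z ∧ Real.smoothTransition z ≤ 1 :=
    fun z => ⟨Real.smoothTransition.nonneg z, Real.smoothTransition.le_one z⟩
  -- the cell functional `I`, extended by zero off `(S,T)`
  set I : ℝ → ℝ := fun r => ∫ x in a r..b r, G₁ r x with hI
  set Ĩ : ℝ → ℝ := (Ioo S T).indicator I with hĨ
  have hIm' : StronglyMeasurable fun r => ∫ x,
      ({p : ℝ × ℝ | a p.1 < p.2 ∧ p.2 ≤ b p.1}.indicator (Function.uncurry G₁)) (r, x) := by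
    refine (Measurable.stronglyMeasurable ?_).integral_prod_right' (ν := volume)
    exact hG₁.indicator ((measurableSet_lt (hac.measurable.comp measurable_fst) measurable_snd).inter
      (measurableSet_le measurable_snd (hbc.measurable.comp measurable_fst)))
  have hIeq : ∀ r ∈ Ioo S T, I r = ∫ x,
      ({p : ℝ × ℝ | a p.1 < p.2 ∧ p.2 ≤ b p.1}.indicator (Function.uncurry G₁)) (r, x) := by
    intro r hr
    simp only [hI]
    rw [intervalIntegral.integral_of_le (hab r hr).le, ← integral_indicator measurableSet_Ioc]
    congr 1 with x
  have hĨeq : Ĩ = (Ioo S T).indicator fun r => ∫ x,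
      ({p : ℝ × ℝ | a p.1 < p.2 ∧ p.2 ≤ b p.1}.indicator (Function.uncurry G₁)) (r, x) := by
    funext r
    simp only [hĨ]
    by_cases hr : r ∈ Ioo S T
    · rw [indicator_of_mem hr, indicator_of_mem hr, hIeq r hr]
    · rw [indicator_of_notMem hr, indicator_of_notMem hr]
  have hĨm : AEStronglyMeasurable Ĩ volume := by
    rw [hĨeq]
    exact (hIm'.indicator measurableSet_Ioo).aestronglyMeasurable
  -- a bound for `Ĩ`
  obtain ⟨A, hA⟩ : ∃ A, ∀ r ∈ Icc S T, A ≤ a r := by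
    obtain ⟨A, hA⟩ := (isCompact_Icc (a := S) (b := T)).bddBelow_image hac.continuousOn
    exact ⟨A, fun r hr => hA (mem_image_of_mem a hr)⟩
  obtain ⟨B, hB⟩ : ∃ B, ∀ r ∈ Icc S T, b r ≤ B := by
    obtain ⟨B, hB⟩ := (isCompact_Icc (a := S) (b := T)).bddAbove_image hbc.continuousOn
    exact ⟨B, fun r hr => hB (mem_image_of_mem b hr)⟩
  have hIb : ∀ r ∈ Ioo S T, ‖I r‖ ≤ M * (B - A) := by
    intro r hr
    have hr' : r ∈ Icc S T := Ioo_subset_Icc_self hr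
    have h1 := intervalIntegral.norm_integral_le_of_norm_le_const (a := a r) (b := b r)
      (f := fun x => G₁ r x) (C := M) fun x _ => by
        rw [Real.norm_eq_abs]; exact (hGM r x hr.1).1
    refine h1.trans ?_
    rw [abs_of_pos (sub_pos.2 (hab r hr))]
    exact mul_le_mul_of_nonneg_left (by linarith [hA r hr', hB r hr']) hM0
  have hĨb : ∀ r, ‖Ĩ r‖ ≤ (Ioo S T).indicator (fun _ => M * (B - A)) r := by
    intro r
    by_cases hr : r ∈ Ioo S T
    · rw [hĨ, indicator_of_mem hr, indicator_of_mem hr]; exact hIb r hr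
    · rw [hĨ, indicator_of_notMem hr, indicator_of_notMem hr, norm_zero]
  have hĨint : Integrable Ĩ :=
    Integrable.mono' (((continuous_const.integrableOn_Icc (a := S) (b := T)).mono_set
      Ioo_subset_Icc_self).integrable_indicator measurableSet_Ioo) hĨm (ae_of_all _ hĨb)
  -- Lebesgue points of `Ĩ`
  have hLeb := IsUnifLocDoublingMeasure.ae_tendsto_average_norm_sub (μ := (volume : Measure ℝ))
    hĨint.locallyIntegrable 1
  set N : Set ℝ := {x | ¬ (Tendsto (fun τ : ℝ => ⨍ y in Metric.closedBall (x + τ / 2) (τ / 2),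
      ‖Ĩ y - Ĩ x‖) (𝓝[>] 0) (𝓝 0) ∧ Tendsto (fun τ : ℝ => ⨍ y in Metric.closedBall (x - τ / 2) (τ / 2),
      ‖Ĩ y - Ĩ x‖) (𝓝[>] 0) (𝓝 0))} with hN
  have hδ : Tendsto (fun τ : ℝ => τ / 2) (𝓝[>] (0 : ℝ)) (𝓝[>] 0) := by
    refine tendsto_nhdsWithin_iff.2 ⟨?_, ?_⟩
    · have : Tendsto (fun τ : ℝ => τ / 2) (𝓝 0) (𝓝 (0 / 2)) := tendsto_id.div_const 2
      rw [zero_div] at this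
      exact this.mono_left nhdsWithin_le_nhds
    · filter_upwards [self_mem_nhdsWithin] with τ hτ using mem_Ioi.2 (half_pos (mem_Ioi.1 hτ))
  have hNnull : volume N = 0 := by
    rw [hN, ← ae_iff]
    filter_upwards [hLeb] with x hx
    constructor
    · refine hx (fun τ => x + τ / 2) (fun τ => τ / 2) hδ ?_
      filter_upwards [self_mem_nhdsWithin] with τ (hτ : 0 < τ)
      rw [Metric.mem_closedBall, Real.dist_eq, one_mul, show x - (x + τ / 2) = -(τ / 2) by ring,
        abs_neg, abs_of_pos (half_pos hτ)]
    · refine hx (fun τ => x - τ / 2) (fun τ => τ / 2) hδ ?_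
      filter_upwards [self_mem_nhdsWithin] with τ (hτ : 0 < τ)
      rw [Metric.mem_closedBall, Real.dist_eq, one_mul, show x - (x - τ / 2) = τ / 2 by ring,
        abs_of_pos (half_pos hτ)]
  refine ⟨N, hNnull, fun s t hSs hst htT hsN htN => ?_⟩
  have hsP : Tendsto (fun τ : ℝ => ⨍ y in Metric.closedBall (s + τ / 2) (τ / 2), ‖Ĩ y - Ĩ s‖)
      (𝓝[>] 0) (𝓝 0) := by
    have h' := hsN
    simp only [hN, mem_setOf_eq, not_not] at h'
    exact h'.1
  have htP : Tendsto (fun τ : ℝ => ⨍ y in Metric.closedBall (t - τ / 2) (τ / 2), ‖Ĩ y - Ĩ t‖)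
      (𝓝[>] 0) (𝓝 0) := by
    have h' := htN
    simp only [hN, mem_setOf_eq, not_not] at h'
    exact h'.2
  have hsST : s ∈ Ioo S T := ⟨hSs, hst.trans htT⟩
  have htST : t ∈ Ioo S T := ⟨hSs.trans hst, htT⟩
  have hIoo : Ioo s t ⊆ Ioo S T := fun r hr => ⟨hSs.trans hr.1, hr.2.trans htT⟩
  have hIĨ : ∀ r ∈ Ioo S T, I r = Ĩ r := fun r hr => by rw [hĨ, indicator_of_mem hr]
  -- the sequence of time cutoffs `τ_j → 0⁺`
  set τs : ℕ → ℝ := fun j => (t - s) / (2 * ((j : ℝ) + 2)) with hτs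
  have hτpos : ∀ j, 0 < τs j := fun j => by
    simp only [hτs]
    exact div_pos (sub_pos.2 hst) (by positivity)
  have hτ2 : ∀ j, 2 * τs j ≤ t - s := fun j => by
    simp only [hτs]
    have h1 : (1 : ℝ) / (2 * ((j : ℝ) + 2)) ≤ 1 / 2 :=
      one_div_le_one_div_of_le two_pos (by nlinarith [(by positivity : (0 : ℝ) ≤ j)])
    have h2 : (t - s) / (2 * ((j : ℝ) + 2)) = (t - s) * (1 / (2 * ((j : ℝ) + 2))) := by
      rw [div_eq_mul_one_div]
    rw [h2]
    nlinarith [sub_pos.2 hst]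
  have hτlt : ∀ j, τs j < t - s := fun j => by linarith [hτ2 j, hτpos j]
  have hτlim0 : Tendsto τs atTop (𝓝 0) := by
    have h1 : Tendsto (fun j : ℕ => 2 * ((j : ℝ) + 2)) atTop atTop :=
      Tendsto.const_mul_atTop two_pos (tendsto_natCast_atTop_atTop.atTop_add tendsto_const_nhds)
    exact tendsto_const_nhds.div_atTop h1
  have hτlim : Tendsto τs atTop (𝓝[>] 0) :=
    tendsto_nhdsWithin_iff.2 ⟨hτlim0, Eventually.of_forall hτpos⟩
  have hmoll : ∀ j, 0 ≤ (∫ r, ((τs j)⁻¹ * deriv Real.smoothTransition ((r - s) / τs j)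
        - (τs j)⁻¹ * deriv Real.smoothTransition ((t - r) / τs j)) * I r)
      + ∫ r, Real.smoothTransition ((r - s) / τs j) * Real.smoothTransition ((t - r) / τs j)
        * (Φa r - Φb r) := fun j =>
    cellIneq_mollified hS hG₁ hG₂ hGM ha hb hab hΦam hΦbm hΦM hΦa hΦb hineq hSs hst htT
      (hτpos j) (hτ2 j)
  ------------------------------------------------------------------
  -- the trace term: `∫ χ_j (Φa - Φb) → ∫_s^t (Φa - Φb)`
  ------------------------------------------------------------------
  have hcut0 : ∀ τ : ℝ, 0 < τ → ∀ r, r ∉ Ioo s t →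
      Real.smoothTransition ((r - s) / τ) * Real.smoothTransition ((t - r) / τ) = 0 := by
    intro τ hτ r hr
    rcases le_or_gt r s with h | h
    · rw [Real.smoothTransition.zero_of_nonpos
        (div_nonpos_of_nonpos_of_nonneg (by linarith : r - s ≤ 0) hτ.le), zero_mul]
    · have h' : t ≤ r := by
        by_contra h''
        exact hr ⟨h, not_le.1 h''⟩
      rw [Real.smoothTransition.zero_of_nonpos
        (div_nonpos_of_nonpos_of_nonneg (by linarith : t - r ≤ 0) hτ.le), mul_zero]
  have hY : Tendsto (fun j => ∫ r, Real.smoothTransition ((r - s) / τs j)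
      * Real.smoothTransition ((t - r) / τs j) * (Φa r - Φb r)) atTop
      (𝓝 (∫ r in s..t, (Φa r - Φb r))) := by
    rw [intervalIntegral.integral_of_le hst.le, integral_Ioc_eq_integral_Ioo,
      ← integral_indicator measurableSet_Ioo]
    refine tendsto_integral_of_dominated_convergence ((Ioo s t).indicator fun _ => M + M)
      ?_ ?_ ?_ ?_
    · intro j
      exact (((Real.smoothTransition.continuous.comp
        ((continuous_id.sub continuous_const).div_const _)).mul
        (Real.smoothTransition.continuous.comp
          ((continuous_const.sub continuous_id).div_const _))).aestronglyMeasurable).mul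
        (hΦam.sub hΦbm).aestronglyMeasurable
    · exact ((continuous_const.integrableOn_Icc (a := s) (b := t)).mono_set
        Ioo_subset_Icc_self).integrable_indicator measurableSet_Ioo
    · intro j
      refine ae_of_all _ fun r => ?_
      by_cases hr : r ∈ Ioo s t
      · rw [indicator_of_mem hr, norm_mul, Real.norm_eq_abs, Real.norm_eq_abs, abs_mul,
          abs_of_nonneg (hΘ01 _).1, abs_of_nonneg (hΘ01 _).1]
        exact (mul_le_mul (mul_le_one₀ (hΘ01 _).2 (hΘ01 _).1 (hΘ01 _).2)
          ((abs_sub _ _).trans (add_le_add (hΦM r).1 (hΦM r).2)) (abs_nonneg _)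
          zero_le_one).trans_eq (one_mul _)
      · rw [indicator_of_notMem hr, hcut0 _ (hτpos j) r hr, zero_mul, norm_zero]
    · refine ae_of_all _ fun r => ?_
      by_cases hr : r ∈ Ioo s t
      · rw [indicator_of_mem hr]
        refine tendsto_const_nhds.congr' ?_
        have hε : 0 < min (r - s) (t - r) := lt_min (sub_pos.2 hr.1) (sub_pos.2 hr.2)
        filter_upwards [hτlim0.eventually (gt_mem_nhds hε)] with j hj
        have h1 : 1 ≤ (r - s) / τs j := by
          rw [le_div_iff₀ (hτpos j)]; linarith [min_le_left (r - s) (t - r)]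
        have h2 : 1 ≤ (t - r) / τs j := by
          rw [le_div_iff₀ (hτpos j)]; linarith [min_le_right (r - s) (t - r)]
        rw [Real.smoothTransition.one_of_one_le h1, Real.smoothTransition.one_of_one_le h2]
        ring
      · rw [indicator_of_notMem hr]
        have : ∀ j, Real.smoothTransition ((r - s) / τs j)
            * Real.smoothTransition ((t - r) / τs j) * (Φa r - Φb r) = 0 := fun j => by
          rw [hcut0 _ (hτpos j) r hr, zero_mul]
        simp only [this]
        exact tendsto_const_nhds
  ------------------------------------------------------------------
  -- the cutoff term: kernel forms at `s` (right window) and `t` (left window)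
  ------------------------------------------------------------------
  have hform_s : ∀ j r, (τs j)⁻¹ * deriv Real.smoothTransition ((r - s) / τs j) * I r
      = (τs j)⁻¹ * deriv Real.smoothTransition ((τs j)⁻¹ * (r - s)) * Ĩ r := by
    intro j r
    rw [div_eq_inv_mul]
    by_cases hr : r ∈ Ioo S T
    · rw [hIĨ r hr]
    · rw [deriv_smoothTransition_eq_zero_of_not_mem, mul_zero, zero_mul, zero_mul]
      rintro ⟨h1, h2⟩
      have hτ := hτpos j
      have e1 : 0 < r - s := by
        by_contra h
        have : (τs j)⁻¹ * (r - s) ≤ 0 :=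
          mul_nonpos_of_nonneg_of_nonpos (inv_nonneg.2 hτ.le) (not_lt.1 h)
        linarith
      have e2 : r - s < τs j := by
        by_contra h
        have : 1 ≤ (τs j)⁻¹ * (r - s) := by
          rw [le_inv_mul_iff₀ hτ, mul_one]; exact not_lt.1 h
        linarith
      exact hr ⟨hSs.trans (by linarith), by linarith [hτlt j]⟩
  have hform_t : ∀ j r, (τs j)⁻¹ * deriv Real.smoothTransition ((t - r) / τs j) * I r
      = (τs j)⁻¹ * deriv Real.smoothTransition (-((τs j)⁻¹ * (r - t))) * Ĩ r := by
    intro j r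
    rw [show (t - r) / τs j = -((τs j)⁻¹ * (r - t)) by rw [div_eq_inv_mul]; ring]
    by_cases hr : r ∈ Ioo S T
    · rw [hIĨ r hr]
    · rw [deriv_smoothTransition_eq_zero_of_not_mem, mul_zero, zero_mul, zero_mul]
      rintro ⟨h1, h2⟩
      have hτ := hτpos j
      have e1 : 0 < t - r := by
        by_contra h
        have : -((τs j)⁻¹ * (r - t)) ≤ 0 := by
          rw [neg_nonpos]
          exact mul_nonneg (inv_nonneg.2 hτ.le) (by linarith [not_lt.1 h])
        linarith
      have e2 : t - r < τs j := by
        by_contra h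
        have : 1 ≤ -((τs j)⁻¹ * (r - t)) := by
          rw [show -((τs j)⁻¹ * (r - t)) = (τs j)⁻¹ * (t - r) by ring, le_inv_mul_iff₀ hτ,
            mul_one]
          exact not_lt.1 h
        linarith
      exact hr ⟨by linarith [hτlt j], by linarith⟩
  -- integrability of the kernel forms
  have hκs : ∀ j, Continuous fun r => (τs j)⁻¹ * deriv Real.smoothTransition ((τs j)⁻¹ * (r - s)) :=
    fun j => continuous_const.mul (((Real.smoothTransition.contDiff (n := 1)).continuous_deriv le_rfl).comp
      (continuous_const.mul (continuous_id.sub continuous_const)))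
  have hκt : ∀ j, Continuous fun r =>
      (τs j)⁻¹ * deriv Real.smoothTransition (-((τs j)⁻¹ * (r - t))) :=
    fun j => continuous_const.mul (((Real.smoothTransition.contDiff (n := 1)).continuous_deriv le_rfl).comp
      (continuous_const.mul (continuous_id.sub continuous_const)).neg)
  have hκsb : ∀ j r, ‖(τs j)⁻¹ * deriv Real.smoothTransition ((τs j)⁻¹ * (r - s))‖
      ≤ (τs j)⁻¹ * D := fun j r => by
    rw [Real.norm_eq_abs, abs_mul, abs_of_pos (inv_pos.2 (hτpos j))]
    exact mul_le_mul_of_nonneg_left (hD _) (inv_nonneg.2 (hτpos j).le)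
  have hκtb : ∀ j r, ‖(τs j)⁻¹ * deriv Real.smoothTransition (-((τs j)⁻¹ * (r - t)))‖
      ≤ (τs j)⁻¹ * D := fun j r => by
    rw [Real.norm_eq_abs, abs_mul, abs_of_pos (inv_pos.2 (hτpos j))]
    exact mul_le_mul_of_nonneg_left (hD _) (inv_nonneg.2 (hτpos j).le)
  have hi_s : ∀ j, Integrable fun r =>
      (τs j)⁻¹ * deriv Real.smoothTransition ((τs j)⁻¹ * (r - s)) * Ĩ r :=
    fun j => hĨint.bdd_mul (hκs j).aestronglyMeasurable (ae_of_all _ (hκsb j))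
  have hi_t : ∀ j, Integrable fun r =>
      (τs j)⁻¹ * deriv Real.smoothTransition (-((τs j)⁻¹ * (r - t))) * Ĩ r :=
    fun j => hĨint.bdd_mul (hκt j).aestronglyMeasurable (ae_of_all _ (hκtb j))
  -- masses
  have hmass_s : ∀ j, ∫ r, (τs j)⁻¹ * deriv Real.smoothTransition ((τs j)⁻¹ * (r - s)) = 1 := by
    intro j
    have := integral_sub_right_eq_self (μ := (volume : Measure ℝ))
      (fun r => (τs j)⁻¹ * deriv Real.smoothTransition ((τs j)⁻¹ * r)) s
    rw [this]
    exact integral_rightKernel (inv_pos.2 (hτpos j))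
  have hmass_t : ∀ j, ∫ r, (τs j)⁻¹ * deriv Real.smoothTransition (-((τs j)⁻¹ * (r - t))) = 1 := by
    intro j
    have := integral_sub_right_eq_self (μ := (volume : Measure ℝ))
      (fun r => (τs j)⁻¹ * deriv Real.smoothTransition (-((τs j)⁻¹ * r))) t
    rw [this]
    exact integral_leftKernel (inv_pos.2 (hτpos j))
  have hκsi : ∀ j, Integrable fun r => (τs j)⁻¹ * deriv Real.smoothTransition ((τs j)⁻¹ * (r - s)) := by
    intro j
    by_contra h
    have := hmass_s j
    rw [integral_undef h] at this
    exact zero_ne_one this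
  have hκti : ∀ j, Integrable fun r =>
      (τs j)⁻¹ * deriv Real.smoothTransition (-((τs j)⁻¹ * (r - t))) := by
    intro j
    by_contra h
    have := hmass_t j
    rw [integral_undef h] at this
    exact zero_ne_one this
  -- convergence at `s`
  have hXs : Tendsto (fun j => ∫ r,
      (τs j)⁻¹ * deriv Real.smoothTransition ((τs j)⁻¹ * (r - s)) * Ĩ r) atTop (𝓝 (I s)) := by
    refine tendsto_iff_norm_sub_tendsto_zero.2 ?_
    have hbound : ∀ j, ‖(∫ r, (τs j)⁻¹ * deriv Real.smoothTransition ((τs j)⁻¹ * (r - s)) * Ĩ r)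
        - I s‖ ≤ D * ⨍ y in Metric.closedBall (s + τs j / 2) (τs j / 2), ‖Ĩ y - Ĩ s‖ := by
      intro j
      have hτ := hτpos j
      have hdiff : (∫ r, (τs j)⁻¹ * deriv Real.smoothTransition ((τs j)⁻¹ * (r - s)) * Ĩ r) - I s
          = ∫ r, (τs j)⁻¹ * deriv Real.smoothTransition ((τs j)⁻¹ * (r - s)) * (Ĩ r - Ĩ s) := by
        have e : (fun r => (τs j)⁻¹ * deriv Real.smoothTransition ((τs j)⁻¹ * (r - s)) * (Ĩ r - Ĩ s))
            = fun r => (τs j)⁻¹ * deriv Real.smoothTransition ((τs j)⁻¹ * (r - s)) * Ĩ r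
              - (τs j)⁻¹ * deriv Real.smoothTransition ((τs j)⁻¹ * (r - s)) * Ĩ s := by
          funext r; ring
        rw [e, integral_sub (hi_s j) ((hκsi j).mul_const _), integral_mul_const, hmass_s j, one_mul,
          hIĨ s hsST]
      rw [hdiff]
      have hg' : IntegrableOn (fun r => (τs j)⁻¹ * D * ‖Ĩ r - Ĩ s‖) (Icc s (s + τs j)) :=
        ((hĨint.integrableOn (s := Icc s (s + τs j))).sub
          (continuous_const.integrableOn_Icc (a := s) (b := s + τs j))).norm.const_mul
          ((τs j)⁻¹ * D)
      have hg : Integrable ((Icc s (s + τs j)).indicator fun r => (τs j)⁻¹ * D * ‖Ĩ r - Ĩ s‖) :=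
        hg'.integrable_indicator measurableSet_Icc
      refine (norm_integral_le_of_norm_le hg (ae_of_all _ fun r => ?_)).trans ?_
      · by_cases hr : r ∈ Icc s (s + τs j)
        · rw [indicator_of_mem hr, norm_mul]
          exact mul_le_mul_of_nonneg_right (hκsb j r) (norm_nonneg _)
        · rw [indicator_of_notMem hr]
          have : (τs j)⁻¹ * deriv Real.smoothTransition ((τs j)⁻¹ * (r - s)) = 0 := by
            refine rightKernel_eq_zero (inv_pos.2 hτ) (y := r - s) fun h => hr ⟨by linarith [h.1], ?_⟩
            have h2 := h.2
            rw [one_div, inv_inv] at h2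
            linarith
          rw [this, zero_mul, norm_zero]
      · rw [integral_indicator measurableSet_Icc, integral_const_mul, MeasureTheory.setAverage_eq,
          smul_eq_mul, Real.closedBall_eq_Icc, show s + τs j / 2 - τs j / 2 = s by ring,
          show s + τs j / 2 + τs j / 2 = s + τs j by ring,
          Real.volume_real_Icc_of_le (by linarith), show s + τs j - s = τs j by ring]
        exact le_of_eq (by ring)
    have hlimavg : Tendsto (fun j => D * ⨍ y in Metric.closedBall (s + τs j / 2) (τs j / 2),
        ‖Ĩ y - Ĩ s‖) atTop (𝓝 0) := by
      have := (hsP.comp hτlim).const_mul D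
      rw [mul_zero] at this
      exact this
    exact squeeze_zero (fun j => norm_nonneg _) hbound hlimavg
  -- convergence at `t`
  have hXt : Tendsto (fun j => ∫ r,
      (τs j)⁻¹ * deriv Real.smoothTransition (-((τs j)⁻¹ * (r - t))) * Ĩ r) atTop (𝓝 (I t)) := by
    refine tendsto_iff_norm_sub_tendsto_zero.2 ?_
    have hbound : ∀ j, ‖(∫ r, (τs j)⁻¹ * deriv Real.smoothTransition (-((τs j)⁻¹ * (r - t))) * Ĩ r)
        - I t‖ ≤ D * ⨍ y in Metric.closedBall (t - τs j / 2) (τs j / 2), ‖Ĩ y - Ĩ t‖ := by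
      intro j
      have hτ := hτpos j
      have hdiff : (∫ r, (τs j)⁻¹ * deriv Real.smoothTransition (-((τs j)⁻¹ * (r - t))) * Ĩ r) - I t
          = ∫ r, (τs j)⁻¹ * deriv Real.smoothTransition (-((τs j)⁻¹ * (r - t))) * (Ĩ r - Ĩ t) := by
        have e : (fun r => (τs j)⁻¹ * deriv Real.smoothTransition (-((τs j)⁻¹ * (r - t)))
              * (Ĩ r - Ĩ t))
            = fun r => (τs j)⁻¹ * deriv Real.smoothTransition (-((τs j)⁻¹ * (r - t))) * Ĩ r
              - (τs j)⁻¹ * deriv Real.smoothTransition (-((τs j)⁻¹ * (r - t))) * Ĩ t := by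
          funext r; ring
        rw [e, integral_sub (hi_t j) ((hκti j).mul_const _), integral_mul_const, hmass_t j, one_mul,
          hIĨ t htST]
      rw [hdiff]
      have hg' : IntegrableOn (fun r => (τs j)⁻¹ * D * ‖Ĩ r - Ĩ t‖) (Icc (t - τs j) t) :=
        ((hĨint.integrableOn (s := Icc (t - τs j) t)).sub
          (continuous_const.integrableOn_Icc (a := t - τs j) (b := t))).norm.const_mul
          ((τs j)⁻¹ * D)
      have hg : Integrable ((Icc (t - τs j) t).indicator fun r => (τs j)⁻¹ * D * ‖Ĩ r - Ĩ t‖) :=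
        hg'.integrable_indicator measurableSet_Icc
      refine (norm_integral_le_of_norm_le hg (ae_of_all _ fun r => ?_)).trans ?_
      · by_cases hr : r ∈ Icc (t - τs j) t
        · rw [indicator_of_mem hr, norm_mul]
          exact mul_le_mul_of_nonneg_right (hκtb j r) (norm_nonneg _)
        · rw [indicator_of_notMem hr]
          have : (τs j)⁻¹ * deriv Real.smoothTransition (-((τs j)⁻¹ * (r - t))) = 0 := by
            refine leftKernel_eq_zero (inv_pos.2 hτ) (y := r - t) fun h => hr ⟨?_, by linarith [h.2]⟩
            have h1 := h.1
            rw [one_div, inv_inv] at h1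
            linarith
          rw [this, zero_mul, norm_zero]
      · rw [integral_indicator measurableSet_Icc, integral_const_mul, MeasureTheory.setAverage_eq,
          smul_eq_mul, Real.closedBall_eq_Icc, show t - τs j / 2 - τs j / 2 = t - τs j by ring,
          show t - τs j / 2 + τs j / 2 = t by ring,
          Real.volume_real_Icc_of_le (by linarith), show t - (t - τs j) = τs j by ring]
        exact le_of_eq (by ring)
    have hlimavg : Tendsto (fun j => D * ⨍ y in Metric.closedBall (t - τs j / 2) (τs j / 2),
        ‖Ĩ y - Ĩ t‖) atTop (𝓝 0) := by
      have := (htP.comp hτlim).const_mul D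
      rw [mul_zero] at this
      exact this
    exact squeeze_zero (fun j => norm_nonneg _) hbound hlimavg
  -- the cutoff term converges to `I s - I t`
  have hX : Tendsto (fun j => ∫ r, ((τs j)⁻¹ * deriv Real.smoothTransition ((r - s) / τs j)
      - (τs j)⁻¹ * deriv Real.smoothTransition ((t - r) / τs j)) * I r) atTop (𝓝 (I s - I t)) := by
    have e : ∀ j, (∫ r, ((τs j)⁻¹ * deriv Real.smoothTransition ((r - s) / τs j)
        - (τs j)⁻¹ * deriv Real.smoothTransition ((t - r) / τs j)) * I r)
        = (∫ r, (τs j)⁻¹ * deriv Real.smoothTransition ((τs j)⁻¹ * (r - s)) * Ĩ r)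
          - ∫ r, (τs j)⁻¹ * deriv Real.smoothTransition (-((τs j)⁻¹ * (r - t))) * Ĩ r := by
      intro j
      simp_rw [sub_mul, hform_s j, hform_t j]
      exact integral_sub (hi_s j) (hi_t j)
    simp_rw [e]
    exact hXs.sub hXt
  have h0 : 0 ≤ (I s - I t) + ∫ r in s..t, (Φa r - Φb r) :=
    ge_of_tendsto (hX.add hY) (Eventually.of_forall hmoll)
  linarith



/-- Measurability in the time variable of kernel averages `r ↦ ∫ κ(y) G(r, c(r)+y) dy` of a
jointly measurable `G` along a continuous curve `c`. [folklore] -/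
theorem measurable_integral_kernel_comp_curve {G : ℝ → ℝ → ℝ}
    (hG : Measurable (Function.uncurry G)) {c : ℝ → ℝ} (hc : Continuous c) {κ : ℝ → ℝ}
    (hκ : Continuous κ) : Measurable fun r => ∫ y, κ y * G r (c r + y) := by
  have hsh : Measurable fun p : ℝ × ℝ => (p.1, c p.1 + p.2) :=
    measurable_fst.prodMk ((hc.measurable.comp measurable_fst).add measurable_snd)
  have hF : Measurable fun p : ℝ × ℝ => κ p.2 * G p.1 (c p.1 + p.2) :=
    (hκ.measurable.comp measurable_snd).mul (hG.comp hsh)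
  exact (hF.stronglyMeasurable.integral_prod_right' (ν := volume)).measurable

/-- **Cell inequality between smooth curves, from strong traces** (the form of Def. 1.2). Let
`G₁, G₂` be bounded measurable on `{r > S}` (`S ≥ 0`) with `∂ₜ G₁ + ∂ₓ G₂ ≤ 0` in the sense of
distributions on `(S,T) × ℝ` (integral form of §1, test functions supported in `S < t < T`), let
`a < b` be smooth curves on `(S,T)`, and let `Ga₁, Ga₂` be strong traces of `G₁, G₂` from the
RIGHT along `a` and `Gb₁, Gb₂` strong traces from the LEFT along `b` on `(S,T)`, in the sense of
Def. 1.2: `∫_S^T ess sup_{0<y<1/k} |Gᵢ(r, a(r)+y) - Gaᵢ(r)| dr → 0`,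
`∫_S^T ess sup_{-1/k<y<0} |Gᵢ(r, b(r)+y) - Gbᵢ(r)| dr → 0`. Then off a null set of times,
for `S < s < t < T`:
`∫_{a(t)}^{b(t)} G₁(t,·) ≤ ∫_{a(s)}^{b(s)} G₁(s,·) + ∫_s^t ([Ga₂ - a' Ga₁] - [Gb₂ - b' Gb₁]) dr`,
i.e. `d/dt ∫_a^b G₁ ≤ (G₂ - a'G₁)(a+) - (G₂ - b'G₁)(b-)` in integrated form — "integrating
(3.1) on `Q = {t_j < r < t, h_i(r) < x < h_{i+1}(r)}` and using the strong trace property of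
Definition 1.2" (§7), as in the proofs of Lemma 4.2 and Prop. 4.4. With `G₁ = η(u|b)`,
`G₂ = q(u;b)` from (3.1) and the traces of `u ∈ 𝒮_weak` (passed to `η(·|b)`, `q(·;b)` by
`tendsto_lintegral_essSup_comp_of_uniformContinuousOn`) this is the cell estimate of §7 with the
fluxes `F_i^±`. [cite: ChenKrupaVasseur2022, §7 (integration of (3.1) on a cell, fluxes `F_i^±`),
Lemma 4.2 and Prop. 4.4 (proofs)] -/
theorem cellIneq_of_strongTraces {G₁ G₂ : ℝ → ℝ → ℝ} {a b Ga₁ Ga₂ Gb₁ Gb₂ : ℝ → ℝ} {S T M : ℝ}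
    (hS : 0 ≤ S)
    (hG₁ : Measurable (Function.uncurry G₁)) (hG₂ : Measurable (Function.uncurry G₂))
    (hGM : ∀ r x, S < r → |G₁ r x| ≤ M ∧ |G₂ r x| ≤ M)
    (ha : ContDiff ℝ (⊤ : ℕ∞) a) (hb : ContDiff ℝ (⊤ : ℕ∞) b) (hab : ∀ r ∈ Ioo S T, a r < b r)
    (hGa₁m : Measurable Ga₁) (hGa₂m : Measurable Ga₂) (hGb₁m : Measurable Gb₁)
    (hGb₂m : Measurable Gb₂) (htrM : ∀ r, |Ga₁ r| ≤ M ∧ |Ga₂ r| ≤ M ∧ |Gb₁ r| ≤ M ∧ |Gb₂ r| ≤ M)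
    (hGa₁ : Tendsto (fun k : ℕ => ∫⁻ r in Ioo S T, essSup (fun y => ‖G₁ r (a r + y) - Ga₁ r‖ₑ)
      (volume.restrict (Ioo 0 (1 / (k : ℝ))))) atTop (𝓝 0))
    (hGa₂ : Tendsto (fun k : ℕ => ∫⁻ r in Ioo S T, essSup (fun y => ‖G₂ r (a r + y) - Ga₂ r‖ₑ)
      (volume.restrict (Ioo 0 (1 / (k : ℝ))))) atTop (𝓝 0))
    (hGb₁ : Tendsto (fun k : ℕ => ∫⁻ r in Ioo S T, essSup (fun y => ‖G₁ r (b r + y) - Gb₁ r‖ₑ)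
      (volume.restrict (Ioo (-(1 / (k : ℝ))) 0))) atTop (𝓝 0))
    (hGb₂ : Tendsto (fun k : ℕ => ∫⁻ r in Ioo S T, essSup (fun y => ‖G₂ r (b r + y) - Gb₂ r‖ₑ)
      (volume.restrict (Ioo (-(1 / (k : ℝ))) 0))) atTop (𝓝 0))
    (hineq : ∀ φ : ℝ × ℝ → ℝ, ContDiff ℝ (⊤ : ℕ∞) φ → HasCompactSupport φ → (∀ p, 0 ≤ φ p) →
      (∀ p ∈ tsupport φ, S < p.1 ∧ p.1 < T) →
      0 ≤ ∫ r in Ioi (0 : ℝ), ∫ x, (deriv (fun s => φ (s, x)) r * G₁ r x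
        + deriv (fun y => φ (r, y)) x * G₂ r x)) :
    ∃ N : Set ℝ, volume N = 0 ∧ ∀ s t, S < s → s < t → t < T → s ∉ N → t ∉ N →
      ∫ x in a t..b t, G₁ t x ≤ (∫ x in a s..b s, G₁ s x)
        + ∫ r in s..t, ((Ga₂ r - deriv a r * Ga₁ r) - (Gb₂ r - deriv b r * Gb₁ r)) := by
  rcases le_or_gt T S with hTS | hST
  · exact ⟨∅, measure_empty, fun s t hSs hst htT _ _ => by linarith⟩
  have hM0 : 0 ≤ M := (abs_nonneg _).trans (htrM 0).1
  have ha1 : ContDiff ℝ 1 a := ha.of_le (by exact_mod_cast le_top)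
  have hb1 : ContDiff ℝ 1 b := hb.of_le (by exact_mod_cast le_top)
  have hac : Continuous a := ha.continuous
  have hbc : Continuous b := hb.continuous
  have ha'c : Continuous (deriv a) := ha1.continuous_deriv le_rfl
  have hb'c : Continuous (deriv b) := hb1.continuous_deriv le_rfl
  obtain ⟨L, hL0, hL⟩ : ∃ L, 0 ≤ L ∧ ∀ r ∈ Icc S T, |deriv a r| ≤ L ∧ |deriv b r| ≤ L := by
    obtain ⟨La, hLa⟩ := isCompact_Icc.exists_bound_of_continuousOn
      (ha'c.continuousOn (s := Icc S T))
    obtain ⟨Lb, hLb⟩ := isCompact_Icc.exists_bound_of_continuousOn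
      (hb'c.continuousOn (s := Icc S T))
    refine ⟨max (max La Lb) 0, le_max_right _ _, fun r hr => ⟨?_, ?_⟩⟩
    · exact ((Real.norm_eq_abs _).symm.le.trans (hLa r hr)).trans
        ((le_max_left _ _).trans (le_max_left _ _))
    · exact ((Real.norm_eq_abs _).symm.le.trans (hLb r hr)).trans
        ((le_max_right _ _).trans (le_max_left _ _))
  have hLM : 0 ≤ L * M := mul_nonneg hL0 hM0
  -- the flux traces, extended by zero off `(S,T)`
  set Φa : ℝ → ℝ := (Ioo S T).indicator fun r => Ga₂ r - deriv a r * Ga₁ r with hΦa_def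
  set Φb : ℝ → ℝ := (Ioo S T).indicator fun r => Gb₂ r - deriv b r * Gb₁ r with hΦb_def
  have hΦam : Measurable Φa := (hGa₂m.sub (ha'c.measurable.mul hGa₁m)).indicator measurableSet_Ioo
  have hΦbm : Measurable Φb := (hGb₂m.sub (hb'c.measurable.mul hGb₁m)).indicator measurableSet_Ioo
  have hΦM : ∀ r, |Φa r| ≤ M + L * M ∧ |Φb r| ≤ M + L * M := by
    intro r
    by_cases hr : r ∈ Ioo S T
    · have hr' : r ∈ Icc S T := Ioo_subset_Icc_self hr
      simp only [hΦa_def, hΦb_def, indicator_of_mem hr]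
      constructor
      · calc |Ga₂ r - deriv a r * Ga₁ r| ≤ |Ga₂ r| + |deriv a r * Ga₁ r| := abs_sub _ _
          _ ≤ M + L * M := by
            rw [abs_mul]
            exact add_le_add (htrM r).2.1 (mul_le_mul (hL r hr').1 (htrM r).1 (abs_nonneg _) hL0)
      · calc |Gb₂ r - deriv b r * Gb₁ r| ≤ |Gb₂ r| + |deriv b r * Gb₁ r| := abs_sub _ _
          _ ≤ M + L * M := by
            rw [abs_mul]
            exact add_le_add (htrM r).2.2.2
              (mul_le_mul (hL r hr').2 (htrM r).2.2.1 (abs_nonneg _) hL0)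
    · simp only [hΦa_def, hΦb_def, indicator_of_notMem hr, abs_zero]
      exact ⟨by positivity, by positivity⟩
  have hGM' : ∀ r x, S < r → |G₁ r x| ≤ M + L * M ∧ |G₂ r x| ≤ M + L * M := fun r x hr =>
    ⟨(hGM r x hr).1.trans (le_add_of_nonneg_right hLM), (hGM r x hr).2.trans (le_add_of_nonneg_right hLM)⟩
  -- kernel traces of `G₁, G₂` (Def. 1.2 ⇒ kernel form)
  have h1 := tendsto_lintegral_rightKernelAvg_sub hG₁ (fun r y hr => (hGM r y hr).1) hGa₁
  have h2 := tendsto_lintegral_rightKernelAvg_sub hG₂ (fun r y hr => (hGM r y hr).2) hGa₂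
  have h3 := tendsto_lintegral_leftKernelAvg_sub hG₁ (fun r y hr => (hGM r y hr).1) hGb₁
  have h4 := tendsto_lintegral_leftKernelAvg_sub hG₂ (fun r y hr => (hGM r y hr).2) hGb₂
  -- slices against compactly supported kernels are integrable
  have hint : ∀ {κ : ℝ → ℝ}, Continuous κ → HasCompactSupport κ → ∀ {G : ℝ → ℝ → ℝ},
      Measurable (Function.uncurry G) → ∀ (c : ℝ → ℝ) (r : ℝ), (∀ y, |G r y| ≤ M) →
      Integrable fun y => κ y * G r (c r + y) := by
    intro κ hκ hκs G hG c r hb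
    exact (hκ.integrable_of_hasCompactSupport hκs).mul_bdd
      ((hG.of_uncurry_left.comp (measurable_const_add (c r))).aestronglyMeasurable)
      (ae_of_all _ fun y => by rw [Real.norm_eq_abs]; exact hb _)
  -- kernel trace of `G₂ - a' G₁` along `a`
  have hΦa : Tendsto (fun k : ℕ => ∫⁻ r in Ioo S T,
      ‖(∫ y, (k : ℝ) * deriv Real.smoothTransition ((k : ℝ) * y)
          * (G₂ r (a r + y) - deriv a r * G₁ r (a r + y))) - Φa r‖ₑ) atTop (𝓝 0) := by
    have hlim : Tendsto (fun k : ℕ => (∫⁻ r in Ioo S T,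
        ‖(∫ y, (k : ℝ) * deriv Real.smoothTransition ((k : ℝ) * y) * G₂ r (a r + y)) - Ga₂ r‖ₑ)
        + ENNReal.ofReal L * ∫⁻ r in Ioo S T,
        ‖(∫ y, (k : ℝ) * deriv Real.smoothTransition ((k : ℝ) * y) * G₁ r (a r + y)) - Ga₁ r‖ₑ)
        atTop (𝓝 0) := by
      have := h2.add (ENNReal.Tendsto.const_mul h1 (Or.inr ENNReal.ofReal_ne_top) (a := ENNReal.ofReal L))
      rwa [mul_zero, add_zero] at this
    refine tendsto_of_tendsto_of_tendsto_of_le_of_le' tendsto_const_nhds hlim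
      (Eventually.of_forall fun k => zero_le) ?_
    filter_upwards [eventually_ge_atTop 1] with k hk
    have hc : (0 : ℝ) < k := by exact_mod_cast hk
    have hκc : Continuous fun y => (k : ℝ) * deriv Real.smoothTransition ((k : ℝ) * y) :=
      continuous_const.mul (((Real.smoothTransition.contDiff (n := 1)).continuous_deriv le_rfl).comp (continuous_const.mul continuous_id))
    have hκs : HasCompactSupport fun y => (k : ℝ) * deriv Real.smoothTransition ((k : ℝ) * y) :=
      HasCompactSupport.intro isCompact_Icc fun y hy =>
        rightKernel_eq_zero hc fun h => hy (Ioo_subset_Icc_self h)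
    have hmeas : AEMeasurable (fun r => ‖(∫ y, (k : ℝ) * deriv Real.smoothTransition ((k : ℝ) * y)
        * G₂ r (a r + y)) - Ga₂ r‖ₑ) (volume.restrict (Ioo S T)) :=
      (((measurable_integral_kernel_comp_curve hG₂ hac hκc).sub hGa₂m).enorm).aemeasurable
    rw [← lintegral_const_mul' _ _ ENNReal.ofReal_ne_top, ← lintegral_add_left' hmeas]
    refine lintegral_mono_ae ?_
    filter_upwards [ae_restrict_mem measurableSet_Ioo] with r hr
    have hb2 : ∀ y, |G₂ r y| ≤ M := fun y => (hGM r y hr.1).2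
    have hb1 : ∀ y, |G₁ r y| ≤ M := fun y => (hGM r y hr.1).1
    have e : (∫ y, (k : ℝ) * deriv Real.smoothTransition ((k : ℝ) * y)
          * (G₂ r (a r + y) - deriv a r * G₁ r (a r + y))) - Φa r
        = ((∫ y, (k : ℝ) * deriv Real.smoothTransition ((k : ℝ) * y) * G₂ r (a r + y)) - Ga₂ r)
          - deriv a r * ((∫ y, (k : ℝ) * deriv Real.smoothTransition ((k : ℝ) * y)
            * G₁ r (a r + y)) - Ga₁ r) := by
      rw [hΦa_def, indicator_of_mem hr]
      have e1 : (fun y => (k : ℝ) * deriv Real.smoothTransition ((k : ℝ) * y)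
          * (G₂ r (a r + y) - deriv a r * G₁ r (a r + y)))
          = fun y => (k : ℝ) * deriv Real.smoothTransition ((k : ℝ) * y) * G₂ r (a r + y)
            - deriv a r * ((k : ℝ) * deriv Real.smoothTransition ((k : ℝ) * y) * G₁ r (a r + y)) := by
        funext y; ring
      rw [e1, integral_sub (hint hκc hκs hG₂ a r hb2) ((hint hκc hκs hG₁ a r hb1).const_mul _),
        integral_const_mul]
      ring
    rw [e, Real.enorm_eq_ofReal_abs, Real.enorm_eq_ofReal_abs, Real.enorm_eq_ofReal_abs,
      ← ENNReal.ofReal_mul hL0, ← ENNReal.ofReal_add (abs_nonneg _) (by positivity)]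
    refine ENNReal.ofReal_le_ofReal ?_
    refine (abs_sub _ _).trans ?_
    rw [abs_mul]
    gcongr
    exact (hL r (Ioo_subset_Icc_self hr)).1
  -- kernel trace of `G₂ - b' G₁` along `b`
  have hΦb : Tendsto (fun k : ℕ => ∫⁻ r in Ioo S T,
      ‖(∫ y, (k : ℝ) * deriv Real.smoothTransition (-((k : ℝ) * y))
          * (G₂ r (b r + y) - deriv b r * G₁ r (b r + y))) - Φb r‖ₑ) atTop (𝓝 0) := by
    have hlim : Tendsto (fun k : ℕ => (∫⁻ r in Ioo S T,
        ‖(∫ y, (k : ℝ) * deriv Real.smoothTransition (-((k : ℝ) * y)) * G₂ r (b r + y)) - Gb₂ r‖ₑ)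
        + ENNReal.ofReal L * ∫⁻ r in Ioo S T,
        ‖(∫ y, (k : ℝ) * deriv Real.smoothTransition (-((k : ℝ) * y)) * G₁ r (b r + y)) - Gb₁ r‖ₑ)
        atTop (𝓝 0) := by
      have := h4.add (ENNReal.Tendsto.const_mul h3 (Or.inr ENNReal.ofReal_ne_top) (a := ENNReal.ofReal L))
      rwa [mul_zero, add_zero] at this
    refine tendsto_of_tendsto_of_tendsto_of_le_of_le' tendsto_const_nhds hlim
      (Eventually.of_forall fun k => zero_le) ?_
    filter_upwards [eventually_ge_atTop 1] with k hk
    have hc : (0 : ℝ) < k := by exact_mod_cast hk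
    have hκc : Continuous fun y => (k : ℝ) * deriv Real.smoothTransition (-((k : ℝ) * y)) :=
      continuous_const.mul (((Real.smoothTransition.contDiff (n := 1)).continuous_deriv le_rfl).comp
        (continuous_const.mul continuous_id).neg)
    have hκs : HasCompactSupport fun y => (k : ℝ) * deriv Real.smoothTransition (-((k : ℝ) * y)) :=
      HasCompactSupport.intro isCompact_Icc fun y hy =>
        leftKernel_eq_zero hc fun h => hy (Ioo_subset_Icc_self h)
    have hmeas : AEMeasurable (fun r => ‖(∫ y, (k : ℝ) * deriv Real.smoothTransition (-((k : ℝ) * y))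
        * G₂ r (b r + y)) - Gb₂ r‖ₑ) (volume.restrict (Ioo S T)) :=
      (((measurable_integral_kernel_comp_curve hG₂ hbc hκc).sub hGb₂m).enorm).aemeasurable
    rw [← lintegral_const_mul' _ _ ENNReal.ofReal_ne_top, ← lintegral_add_left' hmeas]
    refine lintegral_mono_ae ?_
    filter_upwards [ae_restrict_mem measurableSet_Ioo] with r hr
    have hb2 : ∀ y, |G₂ r y| ≤ M := fun y => (hGM r y hr.1).2
    have hb1 : ∀ y, |G₁ r y| ≤ M := fun y => (hGM r y hr.1).1
    have e : (∫ y, (k : ℝ) * deriv Real.smoothTransition (-((k : ℝ) * y))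
          * (G₂ r (b r + y) - deriv b r * G₁ r (b r + y))) - Φb r
        = ((∫ y, (k : ℝ) * deriv Real.smoothTransition (-((k : ℝ) * y)) * G₂ r (b r + y)) - Gb₂ r)
          - deriv b r * ((∫ y, (k : ℝ) * deriv Real.smoothTransition (-((k : ℝ) * y))
            * G₁ r (b r + y)) - Gb₁ r) := by
      rw [hΦb_def, indicator_of_mem hr]
      have e1 : (fun y => (k : ℝ) * deriv Real.smoothTransition (-((k : ℝ) * y))
          * (G₂ r (b r + y) - deriv b r * G₁ r (b r + y)))
          = fun y => (k : ℝ) * deriv Real.smoothTransition (-((k : ℝ) * y)) * G₂ r (b r + y)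
            - deriv b r * ((k : ℝ) * deriv Real.smoothTransition (-((k : ℝ) * y))
              * G₁ r (b r + y)) := by
        funext y; ring
      rw [e1, integral_sub (hint hκc hκs hG₂ b r hb2) ((hint hκc hκs hG₁ b r hb1).const_mul _),
        integral_const_mul]
      ring
    rw [e, Real.enorm_eq_ofReal_abs, Real.enorm_eq_ofReal_abs, Real.enorm_eq_ofReal_abs,
      ← ENNReal.ofReal_mul hL0, ← ENNReal.ofReal_add (abs_nonneg _) (by positivity)]
    refine ENNReal.ofReal_le_ofReal ?_
    refine (abs_sub _ _).trans ?_
    rw [abs_mul]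
    gcongr
    exact (hL r (Ioo_subset_Icc_self hr)).2
  -- the cell inequality with `Φa, Φb`, then unfold them on `(s,t) ⊆ (S,T)`
  obtain ⟨N, hN, hcell⟩ := cellIneq_of_kernelTraces hS hG₁ hG₂ hGM' ha hb hab hΦam hΦbm hΦM
    hΦa hΦb hineq
  refine ⟨N, hN, fun s t hSs hst htT hsN htN => ?_⟩
  have h := hcell s t hSs hst htT hsN htN
  have e : ∫ r in s..t, (Φa r - Φb r)
      = ∫ r in s..t, ((Ga₂ r - deriv a r * Ga₁ r) - (Gb₂ r - deriv b r * Gb₁ r)) := by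
    refine intervalIntegral.integral_congr fun r hr => ?_
    rw [uIcc_of_le hst.le] at hr
    have hr' : r ∈ Ioo S T := ⟨hSs.trans_le hr.1, hr.2.trans_lt htT⟩
    simp only [hΦa_def, hΦb_def, indicator_of_mem hr']
  rwa [e] at h

end CellInequality

/-! ## The cell inequality for the relative entropy `η(u|c)` of a solution with strong traces -/

section RelativeEntropyCells

/-- **Traces may be taken with values in the closure of the state set.** A one-sided trace `up`
of a `W`-valued `v` along `X` (Def. 1.2, windows `I_k` of positive measure for `k ≥ 1`, every
horizon `T > 0`) can be modified on a null set of times into a trace `up'` valued in `W̄`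
everywhere, with the same convergence property. [folklore] -/
theorem exists_trace_mem_closure {v : ℝ → ℝ → Fin n → ℝ} (hv : Measurable (Function.uncurry v))
    {X : ℝ → ℝ} (hX : Measurable X) {up : ℝ → Fin n → ℝ} (hup : Measurable up)
    {W : Set (Fin n → ℝ)} (hW : W.Nonempty) (hvW : ∀ t y, 0 < t → v t y ∈ W)
    {I : ℕ → Set ℝ} (hI : ∀ k, 1 ≤ k → volume (I k) ≠ 0)
    (htr : ∀ T, 0 < T → Tendsto (fun k : ℕ => ∫⁻ t in Ioo 0 T,
        essSup (fun y => ‖v t (X t + y) - up t‖ₑ) (volume.restrict (I k))) atTop (𝓝 0)) :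
    ∃ up' : ℝ → Fin n → ℝ, Measurable up' ∧ (∀ t, up' t ∈ closure W) ∧
      ∀ T, 0 < T → Tendsto (fun k : ℕ => ∫⁻ t in Ioo 0 T,
        essSup (fun y => ‖v t (X t + y) - up' t‖ₑ) (volume.restrict (I k))) atTop (𝓝 0) := by
  classical
  obtain ⟨w₀, hw₀⟩ := hW
  have hmeas : MeasurableSet (up ⁻¹' closure W) := hup isClosed_closure.measurableSet
  set up' : ℝ → Fin n → ℝ := (up ⁻¹' closure W).piecewise up (fun _ => w₀) with hup'
  have hup'm : Measurable up' := Measurable.piecewise hmeas hup measurable_const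
  have hup'W : ∀ t, up' t ∈ closure W := by
    intro t
    by_cases ht : t ∈ up ⁻¹' closure W
    · rw [hup', piecewise_eq_of_mem _ _ _ ht]; exact ht
    · rw [hup', piecewise_eq_of_notMem _ _ _ ht]; exact subset_closure hw₀
  refine ⟨up', hup'm, hup'W, fun T hT => ?_⟩
  -- a.e. on `(0,T)`, `up' = up`
  have hshift : Tendsto (fun k : ℕ => ∫⁻ t in Ioo 0 T,
      essSup (fun y => ‖v t (X t + y) - up t‖ₑ) (volume.restrict (I (k + 1)))) atTop (𝓝 0) :=
    (htr T hT).comp (tendsto_add_atTop_nat 1)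
  have hae : ∀ᵐ t ∂(volume.restrict (Ioo 0 T)), up t ∈ closure W :=
    ae_mem_closure_of_tendsto_lintegral_essSup hv hX hup hvW (I := fun k => I (k + 1))
      (fun k => hI (k + 1) (Nat.le_add_left 1 k)) hshift
  have heq : ∀ᵐ t ∂(volume.restrict (Ioo 0 T)), up' t = up t := by
    filter_upwards [hae] with t ht
    rw [hup', piecewise_eq_of_mem _ _ _ (show t ∈ up ⁻¹' closure W from ht)]
  have hcongr : ∀ k : ℕ, (∫⁻ t in Ioo 0 T,
      essSup (fun y => ‖v t (X t + y) - up' t‖ₑ) (volume.restrict (I k)))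
      = ∫⁻ t in Ioo 0 T, essSup (fun y => ‖v t (X t + y) - up t‖ₑ) (volume.restrict (I k)) := by
    intro k
    refine lintegral_congr_ae ?_
    filter_upwards [heq] with t ht
    rw [ht]
  simp_rw [hcongr]
  exact htr T hT

/-- Lipschitz bound for the linear part of the relative quantities:
`|π·p - π·p'| ≤ (∑ |πᵢ|) ‖p - p'‖` (sup norm). [folklore] -/
theorem abs_dotProduct_sub_le (π p p' : Fin n → ℝ) :
    |π ⬝ᵥ p - π ⬝ᵥ p'| ≤ (∑ i, |π i|) * ‖p - p'‖ := by
  rw [← dotProduct_sub, dotProduct, Finset.sum_mul]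
  refine (Finset.abs_sum_le_sum_abs _ _).trans (Finset.sum_le_sum fun i _ => ?_)
  rw [abs_mul]
  exact mul_le_mul_of_nonneg_left
    ((Real.norm_eq_abs _).symm.le.trans (norm_le_pi_norm (p - p') i)) (abs_nonneg _)

/-- **The cell inequality of §7 for the relative entropy** (smooth fronts). Let `u` be jointly
measurable, valued in a bounded state set `𝒰₀` for `t > 0`, with `η, q, f` measurable, bounded
and uniformly continuous on `𝒰̄₀`; let `u` satisfy the relative entropy inequality (3.1) for the
constant state `c` and the vector `π` (`η(u|c) = η(u) - η(c) - π(u-c)`,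
`q(u;c) = q(u) - q(c) - π(f(u)-f(c))`, printed with `π = ∇η(c)`; e.g. from
`relEntropy_weak_ineq_const`), and let `ua`, `ub` be strong traces of `u` (Def. 1.2, valued in
`𝒰̄₀`, cf. `exists_trace_mem_closure`) from the right along a smooth curve `a` and from the left
along a smooth curve `b > a` on `(S,T)`, `S ≥ 0`. Then off a null set of times, for
`S < s < t < T`:
`∫_{a(t)}^{b(t)} η(u(t,x)|c) dx ≤ ∫_{a(s)}^{b(s)} η(u(s,x)|c) dx + ∫_s^t (F⁺_a(r) - F⁻_b(r)) dr`,
`F⁺_a = q(ua;c) - a' η(ua|c)`, `F⁻_b = q(ub;c) - b' η(ub|c)` — the displayed estimate of §7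
("integrating (3.1) on `Q`, and using the strong trace property of Definition 1.2, we find …")
for one cell with the constant weight dropped, and the integrated form of Lemma 4.2's first step.
[cite: ChenKrupaVasseur2022, §7 (cell estimate with fluxes `F_i^±`), §3 (3.1), Def. 1.2] -/
theorem cellIneq_relEntropy {f : (Fin n → ℝ) → (Fin n → ℝ)} {η q : (Fin n → ℝ) → ℝ}
    {U₀ : Set (Fin n → ℝ)} {u₀ : ℝ → Fin n → ℝ} {u : ℝ → ℝ → Fin n → ℝ} {a b : ℝ → ℝ}
    {ua ub : ℝ → Fin n → ℝ} {S T B : ℝ} (c π : Fin n → ℝ) (hS : 0 ≤ S)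
    (hum : Measurable (Function.uncurry u)) (huU : ∀ t x, 0 < t → u t x ∈ U₀) (hU : IsBounded U₀)
    (hηm : Measurable η) (hqm : Measurable q) (hfm : Measurable f)
    (hηc : UniformContinuousOn η (closure U₀)) (hqc : UniformContinuousOn q (closure U₀))
    (hfc : UniformContinuousOn f (closure U₀))
    (hB : ∀ p ∈ closure U₀, |η p| ≤ B ∧ |q p| ≤ B ∧ ‖f p‖ ≤ B)
    (ha : ContDiff ℝ (⊤ : ℕ∞) a) (hb : ContDiff ℝ (⊤ : ℕ∞) b) (hab : ∀ r ∈ Ioo S T, a r < b r)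
    (huam : Measurable ua) (hubm : Measurable ub) (huaW : ∀ t, ua t ∈ closure U₀)
    (hubW : ∀ t, ub t ∈ closure U₀)
    (hua : Tendsto (fun k : ℕ => ∫⁻ t in Ioo 0 T, essSup (fun y => ‖u t (a t + y) - ua t‖ₑ)
      (volume.restrict (Ioo 0 (1 / (k : ℝ))))) atTop (𝓝 0))
    (hub : Tendsto (fun k : ℕ => ∫⁻ t in Ioo 0 T, essSup (fun y => ‖u t (b t + y) - ub t‖ₑ)
      (volume.restrict (Ioo (-(1 / (k : ℝ))) 0))) atTop (𝓝 0))
    (h31 : ∀ φ : ℝ × ℝ → ℝ, ContDiff ℝ (⊤ : ℕ∞) φ → HasCompactSupport φ → (∀ p, 0 ≤ φ p) →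
      0 ≤ (∫ t in Ioi (0 : ℝ), ∫ x, (deriv (fun s => φ (s, x)) t * (η (u t x) - η c - π ⬝ᵥ (u t x - c))
          + deriv (fun y => φ (t, y)) x * (q (u t x) - q c - π ⬝ᵥ (f (u t x) - f c))))
        + ∫ x, φ (0, x) * (η (u₀ x) - η c - π ⬝ᵥ (u₀ x - c))) :
    ∃ N : Set ℝ, volume N = 0 ∧ ∀ s t, S < s → s < t → t < T → s ∉ N → t ∉ N →
      ∫ x in a t..b t, (η (u t x) - η c - π ⬝ᵥ (u t x - c))
        ≤ (∫ x in a s..b s, (η (u s x) - η c - π ⬝ᵥ (u s x - c)))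
          + ∫ r in s..t, (((q (ua r) - q c - π ⬝ᵥ (f (ua r) - f c))
                - deriv a r * (η (ua r) - η c - π ⬝ᵥ (ua r - c)))
              - ((q (ub r) - q c - π ⬝ᵥ (f (ub r) - f c))
                - deriv b r * (η (ub r) - η c - π ⬝ᵥ (ub r - c)))) := by
  rcases le_or_gt T S with hTS | hST
  · exact ⟨∅, measure_empty, fun s t hSs hst htT _ _ => by linarith⟩
  have hT : 0 < T := hS.trans_lt hST
  -- the relative quantities as observables
  set E₁ : (Fin n → ℝ) → ℝ := fun p => η p - η c - π ⬝ᵥ (p - c) with hE₁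
  set E₂ : (Fin n → ℝ) → ℝ := fun p => q p - q c - π ⬝ᵥ (f p - f c) with hE₂
  set Λ : ℝ := ∑ i, |π i| with hΛ
  have hΛ0 : 0 ≤ Λ := Finset.sum_nonneg fun i _ => abs_nonneg _
  -- uniform continuity of `E₁, E₂` on `𝒰̄₀`
  have hE₁c : UniformContinuousOn E₁ (closure U₀) := by
    rw [Metric.uniformContinuousOn_iff]
    intro ε hε
    obtain ⟨δ₁, hδ₁, h₁⟩ := Metric.uniformContinuousOn_iff.1 hηc (ε / 2) (half_pos hε)
    refine ⟨min δ₁ (ε / 2 / (Λ + 1)), lt_min hδ₁ (by positivity), fun p hp p' hp' hpp' => ?_⟩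
    have hd1 : dist p p' < δ₁ := hpp'.trans_le (min_le_left _ _)
    have hd2 : dist p p' < ε / 2 / (Λ + 1) := hpp'.trans_le (min_le_right _ _)
    have hη' : dist (η p) (η p') < ε / 2 := h₁ p hp p' hp' hd1
    rw [Real.dist_eq] at hη' ⊢
    rw [dist_eq_norm] at hd2
    have hlin : |π ⬝ᵥ (p - c) - π ⬝ᵥ (p' - c)| ≤ Λ * ‖p - p'‖ := by
      have := abs_dotProduct_sub_le π (p - c) (p' - c)
      rwa [show p - c - (p' - c) = p - p' by abel] at this
    have hlin' : Λ * ‖p - p'‖ < ε / 2 := by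
      calc Λ * ‖p - p'‖ ≤ (Λ + 1) * ‖p - p'‖ :=
            mul_le_mul_of_nonneg_right (by linarith) (norm_nonneg _)
        _ < (Λ + 1) * (ε / 2 / (Λ + 1)) := mul_lt_mul_of_pos_left hd2 (by positivity)
        _ = ε / 2 := by field_simp
    have e : E₁ p - E₁ p' = (η p - η p') - (π ⬝ᵥ (p - c) - π ⬝ᵥ (p' - c)) := by
      simp only [hE₁]; ring
    rw [e]
    calc |(η p - η p') - (π ⬝ᵥ (p - c) - π ⬝ᵥ (p' - c))|
        ≤ |η p - η p'| + |π ⬝ᵥ (p - c) - π ⬝ᵥ (p' - c)| := abs_sub _ _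
      _ < ε / 2 + ε / 2 := add_lt_add_of_lt_of_le hη' (hlin.trans hlin'.le)
      _ = ε := add_halves ε
  have hE₂c : UniformContinuousOn E₂ (closure U₀) := by
    rw [Metric.uniformContinuousOn_iff]
    intro ε hε
    obtain ⟨δ₁, hδ₁, h₁⟩ := Metric.uniformContinuousOn_iff.1 hqc (ε / 2) (half_pos hε)
    obtain ⟨δ₂, hδ₂, h₂⟩ := Metric.uniformContinuousOn_iff.1 hfc (ε / 2 / (Λ + 1)) (by positivity)
    refine ⟨min δ₁ δ₂, lt_min hδ₁ hδ₂, fun p hp p' hp' hpp' => ?_⟩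
    have hd1 : dist p p' < δ₁ := hpp'.trans_le (min_le_left _ _)
    have hd2 : dist p p' < δ₂ := hpp'.trans_le (min_le_right _ _)
    have hq' : dist (q p) (q p') < ε / 2 := h₁ p hp p' hp' hd1
    have hf' : dist (f p) (f p') < ε / 2 / (Λ + 1) := h₂ p hp p' hp' hd2
    rw [Real.dist_eq] at hq' ⊢
    rw [dist_eq_norm] at hf'
    have hlin : |π ⬝ᵥ (f p - f c) - π ⬝ᵥ (f p' - f c)| ≤ Λ * ‖f p - f p'‖ := by
      have := abs_dotProduct_sub_le π (f p - f c) (f p' - f c)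
      rwa [show f p - f c - (f p' - f c) = f p - f p' by abel] at this
    have hlin' : Λ * ‖f p - f p'‖ < ε / 2 := by
      calc Λ * ‖f p - f p'‖ ≤ (Λ + 1) * ‖f p - f p'‖ :=
            mul_le_mul_of_nonneg_right (by linarith) (norm_nonneg _)
        _ < (Λ + 1) * (ε / 2 / (Λ + 1)) := mul_lt_mul_of_pos_left hf' (by positivity)
        _ = ε / 2 := by field_simp
    have e : E₂ p - E₂ p' = (q p - q p') - (π ⬝ᵥ (f p - f c) - π ⬝ᵥ (f p' - f c)) := by
      simp only [hE₂]; ring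
    rw [e]
    calc |(q p - q p') - (π ⬝ᵥ (f p - f c) - π ⬝ᵥ (f p' - f c))|
        ≤ |q p - q p'| + |π ⬝ᵥ (f p - f c) - π ⬝ᵥ (f p' - f c)| := abs_sub _ _
      _ < ε / 2 + ε / 2 := add_lt_add_of_lt_of_le hq' (hlin.trans hlin'.le)
      _ = ε := add_halves ε
  -- bounds on `𝒰̄₀`
  obtain ⟨R, hR⟩ := hU.closure.exists_norm_le
  set M : ℝ := max (B + |η c| + Λ * (R + ‖c‖)) (B + |q c| + Λ * (B + ‖f c‖)) with hM
  have hE₁b : ∀ p ∈ closure U₀, |E₁ p| ≤ M := by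
    intro p hp
    refine le_trans ?_ (le_max_left _ _)
    have h1 : |π ⬝ᵥ (p - c)| ≤ Λ * (R + ‖c‖) := by
      have := abs_dotProduct_sub_le π (p - c) 0
      rw [dotProduct_zero, sub_zero, sub_zero] at this
      refine this.trans (mul_le_mul_of_nonneg_left ((norm_sub_le _ _).trans ?_) hΛ0)
      exact add_le_add (hR p hp) le_rfl
    calc |E₁ p| = |η p - η c - π ⬝ᵥ (p - c)| := rfl
      _ ≤ |η p - η c| + |π ⬝ᵥ (p - c)| := abs_sub _ _
      _ ≤ (|η p| + |η c|) + Λ * (R + ‖c‖) := add_le_add (abs_sub _ _) h1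
      _ ≤ B + |η c| + Λ * (R + ‖c‖) := by linarith [(hB p hp).1]
  have hE₂b : ∀ p ∈ closure U₀, |E₂ p| ≤ M := by
    intro p hp
    refine le_trans ?_ (le_max_right _ _)
    have h1 : |π ⬝ᵥ (f p - f c)| ≤ Λ * (B + ‖f c‖) := by
      have := abs_dotProduct_sub_le π (f p - f c) 0
      rw [dotProduct_zero, sub_zero, sub_zero] at this
      refine this.trans (mul_le_mul_of_nonneg_left ((norm_sub_le _ _).trans ?_) hΛ0)
      exact add_le_add (hB p hp).2.2 le_rfl
    calc |E₂ p| = |q p - q c - π ⬝ᵥ (f p - f c)| := rfl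
      _ ≤ |q p - q c| + |π ⬝ᵥ (f p - f c)| := abs_sub _ _
      _ ≤ (|q p| + |q c|) + Λ * (B + ‖f c‖) := add_le_add (abs_sub _ _) h1
      _ ≤ B + |q c| + Λ * (B + ‖f c‖) := by linarith [(hB p hp).2.1]
  -- the observables along `u` and their traces
  have hπc : Continuous fun p : Fin n → ℝ => π ⬝ᵥ p := continuous_const.dotProduct continuous_id
  have hE₁m : Measurable E₁ :=
    (hηm.sub measurable_const).sub (hπc.measurable.comp (measurable_id.sub measurable_const))
  have hE₂m : Measurable E₂ :=
    (hqm.sub measurable_const).sub (hπc.measurable.comp (hfm.sub measurable_const))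
  have hG₁ : Measurable (Function.uncurry fun t x => E₁ (u t x)) := hE₁m.comp hum
  have hG₂ : Measurable (Function.uncurry fun t x => E₂ (u t x)) := hE₂m.comp hum
  have huW : ∀ t x, 0 < t → u t x ∈ closure U₀ := fun t x ht => subset_closure (huU t x ht)
  have hGM : ∀ r x, S < r → |E₁ (u r x)| ≤ M ∧ |E₂ (u r x)| ≤ M := fun r x hr =>
    ⟨hE₁b _ (huW r x (hS.trans_lt hr)), hE₂b _ (huW r x (hS.trans_lt hr))⟩
  have htrM : ∀ r, |E₁ (ua r)| ≤ M ∧ |E₂ (ua r)| ≤ M ∧ |E₁ (ub r)| ≤ M ∧ |E₂ (ub r)| ≤ M :=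
    fun r => ⟨hE₁b _ (huaW r), hE₂b _ (huaW r), hE₁b _ (hubW r), hE₂b _ (hubW r)⟩
  -- strong traces of the observables (Def. 1.2 on `(0,T)`, then restricted to `(S,T)`)
  have hrestr : ∀ {F : ℕ → ℝ → ℝ≥0∞}, Tendsto (fun k => ∫⁻ t in Ioo 0 T, F k t) atTop (𝓝 0) →
      Tendsto (fun k => ∫⁻ t in Ioo S T, F k t) atTop (𝓝 0) := fun h =>
    tendsto_of_tendsto_of_tendsto_of_le_of_le' tendsto_const_nhds h
      (Eventually.of_forall fun k => zero_le)
      (Eventually.of_forall fun k => lintegral_mono_set (Ioo_subset_Ioo_left hS))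
  have hGa₁ := hrestr (tendsto_lintegral_essSup_comp_of_uniformContinuousOn hE₁c hE₁b huW
    (ae_of_all _ huaW) hua)
  have hGa₂ := hrestr (tendsto_lintegral_essSup_comp_of_uniformContinuousOn hE₂c hE₂b huW
    (ae_of_all _ huaW) hua)
  have hGb₁ := hrestr (tendsto_lintegral_essSup_comp_of_uniformContinuousOn hE₁c hE₁b huW
    (ae_of_all _ hubW) hub)
  have hGb₂ := hrestr (tendsto_lintegral_essSup_comp_of_uniformContinuousOn hE₂c hE₂b huW
    (ae_of_all _ hubW) hub)
  -- (3.1) for test functions supported in `S < t < T`: the `t = 0` term drops out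
  have hineq : ∀ φ : ℝ × ℝ → ℝ, ContDiff ℝ (⊤ : ℕ∞) φ → HasCompactSupport φ → (∀ p, 0 ≤ φ p) →
      (∀ p ∈ tsupport φ, S < p.1 ∧ p.1 < T) →
      0 ≤ ∫ r in Ioi (0 : ℝ), ∫ x, (deriv (fun s => φ (s, x)) r * E₁ (u r x)
        + deriv (fun y => φ (r, y)) x * E₂ (u r x)) := by
    intro φ hφ hφs hφ0 hφT
    have h0 : ∀ x, φ (0, x) = 0 := fun x =>
      image_eq_zero_of_notMem_tsupport fun h => (lt_irrefl (0 : ℝ)) (hS.trans_lt (hφT _ h).1)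
    have := h31 φ hφ hφs hφ0
    simpa only [h0, zero_mul, integral_zero, add_zero] using this
  obtain ⟨N, hN, hcell⟩ := cellIneq_of_strongTraces (G₁ := fun t x => E₁ (u t x))
    (G₂ := fun t x => E₂ (u t x)) (Ga₁ := fun r => E₁ (ua r)) (Ga₂ := fun r => E₂ (ua r))
    (Gb₁ := fun r => E₁ (ub r)) (Gb₂ := fun r => E₂ (ub r)) hS hG₁ hG₂ hGM ha hb hab
    (hE₁m.comp huam) (hE₂m.comp huam) (hE₁m.comp hubm) (hE₂m.comp hubm) htrM
    hGa₁ hGa₂ hGb₁ hGb₂ hineq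
  exact ⟨N, hN, hcell⟩

end RelativeEntropyCells

/-! ## One-sided limits along generic times (Lemma 7.1) -/

section ApproximateLimits

/-- A Lebesgue-null set has dense complement: every nonempty open interval meets `Nᶜ`.
[folklore] -/
theorem exists_mem_Ioo_notMem_of_volume_eq_zero {N : Set ℝ} (hN : volume N = 0) {x y : ℝ}
    (hxy : x < y) : ∃ r ∈ Ioo x y, r ∉ N := by
  by_contra h
  have h1 : volume (Ioo x y) ≤ volume N :=
    measure_mono fun r hr => by_contra fun hrN => h ⟨r, hr, hrN⟩
  rw [hN, Real.volume_Ioo, nonpos_iff_eq_zero, ENNReal.ofReal_eq_zero] at h1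
  linarith

/-- **Stopping and restarting the clock (Lemma 7.1, abstract form).** If a function `I`, bounded
on `(S,T)`, satisfies the cell inequality `I(t) ≤ I(s) + ∫_s^t Φ` for all `s < t` in `(S,T)` off
a null set `N` (as provided by `cellIneq_of_strongTraces` / `cellIneq_relEntropy`), with `Φ`
integrable on `(S,T)`, then `I` has one-sided limits ALONG GENERIC TIMES at every point: right
limits `Ip t₀` at every `t₀ ∈ [S,T)` and left limits `Im t₀` at every `t₀ ∈ (S,T]` (the
approximate limits `ap lim_{t → t₀±} ∫_c^d η(u(t,x)|v) dx` of Lemma 7.1, here along `Nᶜ`); they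
verify `Ip t₀ ≤ Im t₀` on `(S,T)` ((7.2): the jump at any time — e.g. a wave interaction time —
is nonpositive), `Im t₂ ≤ Ip t₁ + ∫_{t₁}^{t₂} Φ` for `S ≤ t₁ < t₂ ≤ T` (the cell inequality
between ARBITRARY times, as used in §7 from `t_j` to `t`), and `Ip t₀ ≤ I t₀ ≤ Im t₀` at generic
`t₀`. Proof: `J = I - ∫^· Φ` is antitone off `N`, and `Nᶜ` is dense.
[cite: ChenKrupaVasseur2022, Lemma 7.1 (7.1)–(7.2) and §7 (telescoping over interaction times)] -/
theorem oneSidedLimits_of_ae_cellIneq {I Φ : ℝ → ℝ} {S T C : ℝ} {N : Set ℝ} (hN : volume N = 0)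
    (hΦ : IntegrableOn Φ (Ioo S T)) (hIb : ∀ r ∈ Ioo S T, |I r| ≤ C)
    (h : ∀ s t, S < s → s < t → t < T → s ∉ N → t ∉ N → I t ≤ I s + ∫ r in s..t, Φ r) :
    ∃ Im Ip : ℝ → ℝ,
      (∀ t₀ ∈ Ioc S T, Tendsto I (𝓝[Iio t₀ ∩ Nᶜ] t₀) (𝓝 (Im t₀))) ∧
      (∀ t₀ ∈ Ico S T, Tendsto I (𝓝[Ioi t₀ ∩ Nᶜ] t₀) (𝓝 (Ip t₀))) ∧
      (∀ t₀ ∈ Ioo S T, Ip t₀ ≤ Im t₀) ∧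
      (∀ t₁ t₂, S ≤ t₁ → t₁ < t₂ → t₂ ≤ T → Im t₂ ≤ Ip t₁ + ∫ r in t₁..t₂, Φ r) ∧
      (∀ t₀ ∈ Ioo S T, t₀ ∉ N → Ip t₀ ≤ I t₀ ∧ I t₀ ≤ Im t₀) := by
  rcases le_or_gt T S with hTS | hST
  · refine ⟨fun _ => 0, fun _ => 0, fun t₀ ht₀ => absurd (ht₀.1.trans_le ht₀.2) hTS.not_gt,
      fun t₀ ht₀ => absurd (ht₀.1.trans_lt ht₀.2) hTS.not_gt,
      fun t₀ ht₀ => absurd (ht₀.1.trans ht₀.2) hTS.not_gt,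
      fun t₁ t₂ h₁ h₁₂ h₂ => absurd ((h₁.trans_lt h₁₂).trans_le h₂) hTS.not_gt,
      fun t₀ ht₀ => absurd (ht₀.1.trans ht₀.2) hTS.not_gt⟩
  -- the primitive `P` of `Φ` (extended by zero) and the functional `J = I - P`, antitone off `N`
  set Φ' : ℝ → ℝ := (Ioo S T).indicator Φ with hΦ'
  have hΦ'i : Integrable Φ' := hΦ.integrable_indicator measurableSet_Ioo
  set m : ℝ := (S + T) / 2 with hm
  set P : ℝ → ℝ := fun r => ∫ x in m..r, Φ' x with hP
  have hPc : Continuous P :=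
    intervalIntegral.continuous_primitive (fun _ _ => hΦ'i.intervalIntegrable) m
  have haeT : ∀ᵐ r : ℝ, r ≠ T := by
    rw [ae_iff]
    simp
  have hPdiff : ∀ s t, S ≤ s → s ≤ t → t ≤ T → P t - P s = ∫ r in s..t, Φ r := by
    intro s t hs hst ht
    simp only [hP]
    rw [intervalIntegral.integral_interval_sub_left hΦ'i.intervalIntegrable hΦ'i.intervalIntegrable]
    refine intervalIntegral.integral_congr_ae ?_
    rw [uIoc_of_le hst]
    filter_upwards [haeT] with r hrT hr
    have hr' : r ∈ Ioo S T := ⟨hs.trans_lt hr.1, lt_of_le_of_ne (hr.2.trans ht) hrT⟩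
    simp only [hΦ', indicator_of_mem hr']
  set J : ℝ → ℝ := fun r => I r - P r with hJ
  have hIJ : ∀ r, I r = J r + P r := fun r => by simp only [hJ]; ring
  have hJanti : ∀ s, s ∈ Ioo S T → s ∉ N → ∀ t, t ∈ Ioo S T → t ∉ N → s < t → J t ≤ J s := by
    intro s hs hsN t ht htN hst
    have h1 := h s t hs.1 hst ht.2 hsN htN
    have h2 := hPdiff s t hs.1.le hst.le ht.2.le
    simp only [hJ]
    linarith
  -- bounds
  have hPb : ∀ r, |P r| ≤ ∫ x, ‖Φ' x‖ := by
    intro r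
    simp only [hP]
    refine (Real.norm_eq_abs _).symm.le.trans
      ((intervalIntegral.norm_integral_le_integral_norm_uIoc).trans ?_)
    exact setIntegral_le_integral hΦ'i.norm (ae_of_all _ fun x => norm_nonneg _)
  set K : ℝ := C + ∫ x, ‖Φ' x‖ with hK
  have hJb : ∀ r ∈ Ioo S T, |J r| ≤ K := by
    intro r hr
    simp only [hJ, hK]
    exact (abs_sub _ _).trans (add_le_add (hIb r hr) (hPb r))
  -- the one-sided limit values of `J`
  set Lm : ℝ → ℝ := fun t₀ => sInf (J '' (Ioo S t₀ ∩ Nᶜ)) with hLm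
  set Lp : ℝ → ℝ := fun t₀ => sSup (J '' (Ioo t₀ T ∩ Nᶜ)) with hLp
  have hne_m : ∀ t₀ ∈ Ioc S T, (J '' (Ioo S t₀ ∩ Nᶜ)).Nonempty := by
    intro t₀ ht₀
    obtain ⟨r, hr, hrN⟩ := exists_mem_Ioo_notMem_of_volume_eq_zero hN ht₀.1
    exact ⟨J r, r, ⟨hr, hrN⟩, rfl⟩
  have hne_p : ∀ t₀ ∈ Ico S T, (J '' (Ioo t₀ T ∩ Nᶜ)).Nonempty := by
    intro t₀ ht₀
    obtain ⟨r, hr, hrN⟩ := exists_mem_Ioo_notMem_of_volume_eq_zero hN ht₀.2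
    exact ⟨J r, r, ⟨hr, hrN⟩, rfl⟩
  have hbdd_m : ∀ t₀ ∈ Ioc S T, BddBelow (J '' (Ioo S t₀ ∩ Nᶜ)) := by
    intro t₀ ht₀
    refine ⟨-K, ?_⟩
    rintro _ ⟨r, hr, rfl⟩
    have := hJb r ⟨hr.1.1, hr.1.2.trans_le ht₀.2⟩
    rw [abs_le] at this
    exact this.1
  have hbdd_p : ∀ t₀ ∈ Ico S T, BddAbove (J '' (Ioo t₀ T ∩ Nᶜ)) := by
    intro t₀ ht₀
    refine ⟨K, ?_⟩
    rintro _ ⟨r, hr, rfl⟩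
    have := hJb r ⟨ht₀.1.trans_lt hr.1.1, hr.1.2⟩
    rw [abs_le] at this
    exact this.2
  -- left limits of `J` along `Nᶜ`
  have hJm : ∀ t₀ ∈ Ioc S T, Tendsto J (𝓝[Iio t₀ ∩ Nᶜ] t₀) (𝓝 (Lm t₀)) := by
    intro t₀ ht₀
    rw [Metric.tendsto_nhdsWithin_nhds]
    intro ε hε
    obtain ⟨_, ⟨r₁, hr₁, rfl⟩, hlt⟩ :=
      exists_lt_of_csInf_lt (hne_m t₀ ht₀) (lt_add_of_pos_right (Lm t₀) hε)
    refine ⟨t₀ - r₁, sub_pos.2 hr₁.1.2, fun r hr hdist => ?_⟩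
    have hrt : r < t₀ := hr.1
    have hr1 : r₁ < r := by
      rw [Real.dist_eq, abs_of_neg (sub_neg.2 hrt)] at hdist
      linarith
    have hrST : r ∈ Ioo S T := ⟨hr₁.1.1.trans hr1, hrt.trans_le ht₀.2⟩
    have h1 : J r ≤ J r₁ :=
      hJanti r₁ ⟨hr₁.1.1, hr₁.1.2.trans_le ht₀.2⟩ hr₁.2 r hrST hr.2 hr1
    have h2 : Lm t₀ ≤ J r := csInf_le (hbdd_m t₀ ht₀) ⟨r, ⟨⟨hrST.1, hrt⟩, hr.2⟩, rfl⟩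
    rw [Real.dist_eq, abs_lt]
    constructor <;> linarith
  -- right limits of `J` along `Nᶜ`
  have hJp : ∀ t₀ ∈ Ico S T, Tendsto J (𝓝[Ioi t₀ ∩ Nᶜ] t₀) (𝓝 (Lp t₀)) := by
    intro t₀ ht₀
    rw [Metric.tendsto_nhdsWithin_nhds]
    intro ε hε
    obtain ⟨_, ⟨r₁, hr₁, rfl⟩, hlt⟩ :=
      exists_lt_of_lt_csSup (hne_p t₀ ht₀) (sub_lt_self (Lp t₀) hε)
    refine ⟨r₁ - t₀, sub_pos.2 hr₁.1.1, fun r hr hdist => ?_⟩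
    have hrt : t₀ < r := hr.1
    have hr1 : r < r₁ := by
      rw [Real.dist_eq, abs_of_pos (sub_pos.2 hrt)] at hdist
      linarith
    have hrST : r ∈ Ioo S T := ⟨ht₀.1.trans_lt hrt, hr1.trans hr₁.1.2⟩
    have h1 : J r₁ ≤ J r :=
      hJanti r hrST hr.2 r₁ ⟨ht₀.1.trans_lt hr₁.1.1, hr₁.1.2⟩ hr₁.2 hr1
    have h2 : J r ≤ Lp t₀ := le_csSup (hbdd_p t₀ ht₀) ⟨r, ⟨⟨hrt, hrST.2⟩, hr.2⟩, rfl⟩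
    rw [Real.dist_eq, abs_lt]
    constructor <;> linarith
  -- `Lp ≤ Lm` across any pair of times `t₁ < t₂`
  have hcross : ∀ t₁ t₂, S ≤ t₁ → t₁ < t₂ → t₂ ≤ T → Lm t₂ ≤ Lp t₁ := by
    intro t₁ t₂ h₁ h₁₂ h₂
    obtain ⟨r, hr, hrN⟩ := exists_mem_Ioo_notMem_of_volume_eq_zero hN h₁₂
    calc Lm t₂ ≤ J r :=
          csInf_le (hbdd_m t₂ ⟨h₁.trans_lt h₁₂, h₂⟩) ⟨r, ⟨⟨h₁.trans_lt hr.1, hr.2⟩, hrN⟩, rfl⟩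
      _ ≤ Lp t₁ := le_csSup (hbdd_p t₁ ⟨h₁, h₁₂.trans_le h₂⟩) ⟨r, ⟨⟨hr.1, hr.2.trans_le h₂⟩, hrN⟩, rfl⟩
  refine ⟨fun t₀ => Lm t₀ + P t₀, fun t₀ => Lp t₀ + P t₀, ?_, ?_, ?_, ?_, ?_⟩
  · intro t₀ ht₀
    have hI : I = fun r => J r + P r := funext hIJ
    rw [hI]
    exact (hJm t₀ ht₀).add ((hPc.tendsto t₀).mono_left nhdsWithin_le_nhds)
  · intro t₀ ht₀
    have hI : I = fun r => J r + P r := funext hIJ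
    rw [hI]
    exact (hJp t₀ ht₀).add ((hPc.tendsto t₀).mono_left nhdsWithin_le_nhds)
  · intro t₀ ht₀
    have : Lp t₀ ≤ Lm t₀ := by
      refine csSup_le (hne_p t₀ ⟨ht₀.1.le, ht₀.2⟩) ?_
      rintro _ ⟨r', hr', rfl⟩
      refine le_csInf (hne_m t₀ ⟨ht₀.1, ht₀.2.le⟩) ?_
      rintro _ ⟨r, hr, rfl⟩
      exact hJanti r ⟨hr.1.1, hr.1.2.trans ht₀.2⟩ hr.2 r' ⟨ht₀.1.trans hr'.1.1, hr'.1.2⟩ hr'.2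
        (hr.1.2.trans hr'.1.1)
    linarith
  · intro t₁ t₂ h₁ h₁₂ h₂
    rw [← hPdiff t₁ t₂ h₁ h₁₂.le h₂]
    linarith [hcross t₁ t₂ h₁ h₁₂ h₂]
  · intro t₀ ht₀ ht₀N
    rw [hIJ t₀]
    constructor
    · have : Lp t₀ ≤ J t₀ := by
        refine csSup_le (hne_p t₀ ⟨ht₀.1.le, ht₀.2⟩) ?_
        rintro _ ⟨r', hr', rfl⟩
        exact hJanti t₀ ht₀ ht₀N r' ⟨ht₀.1.trans hr'.1.1, hr'.1.2⟩ hr'.2 hr'.1.1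
      linarith
    · have : J t₀ ≤ Lm t₀ := by
        refine le_csInf (hne_m t₀ ⟨ht₀.1, ht₀.2.le⟩) ?_
        rintro _ ⟨r, hr, rfl⟩
        exact hJanti r ⟨hr.1.1, hr.1.2.trans ht₀.2⟩ hr.2 t₀ ht₀ ht₀N hr.1.2
      linarith

end ApproximateLimits

end Literature.Analysis.PDE
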